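import Literature.MathematicalPhysics.QuantumFieldTheory.Balaban1983to89.B5G183RateTorusW
import Literature.MathematicalPhysics.QuantumFieldTheory.Balaban1983to89.B5Prop11Lower

/-!
# Bałaban [CMP 95 (1984)] (1.83)/(1.89) at `U = 1`, King [CMP 102 (1986)] (2.10)/(4.18)/(4.38): the UNIT-LATTICE
TOWER of block averagings and the EXISTENCE, with geometric rate `L^{−k}`, of the `k → ∞` limit of the
unit-lattice block-averaged free covariance (and of three further items) on a fixed finite torus; v1.1: King's
weighted order-two item for REAL `θ ∈ (0,1]` against `Q_R` at the SOFT rate `η^θ`, and its unit-lattice limit; v1.2: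
the same item against `Q_R` at the SHARP rate `η^{min(2θ,1)}` (the averaging defect is a `Wt`-admissible sandwich of
b05's fibre), and its unit-lattice limit with rate `L^{−min(2θ,1)k}`; v1.3: the two ONE-SIDED weighted items
`∇_ν∇_{ν′}𝒲₂𝒢`, `𝒢𝒲₂∇*_ν∇*_{ν′}` against `Q_R` at the full rate `η` and their unit-lattice limits — so all six items of
(1.89) (King's weights on the order-two ones) against block averaging at `U = 1`; v1.4: the composite averaging `Qtow_k`
IS King's `L^k`-block averaging (2.10), entrywise (the semigroup property of block averaging), and King's (4.38) SHAPE
`‖c_k − c_{k+n}‖ ≤ C·L^{−k}/(1 − L^{−1})` at any two finite levels for all six towers; v1.5: the ZERO MODES of the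
covariance tower — Bałaban's «GJ = GJ′ + a^{−1}J₀. (1.82)» at `U = 1` (`𝒢` multiplies the `x`-constant vector fields by
`a^{−1}`), hence `c_k(c) = a^{−1}c` for every `k`, `a^{−1} ≤ ‖c_k‖ ≤ Cst`, and `0 ≤ c_k`

v1 = p196344, commit 74834ae6fac9 (companion of `B5G183RateTorusW` v1.3, p195822, commit ecd75b729b77 — a separate
leaf only because that file sits at the proposal size cap; nothing in it is modified).  v1.1 = p196906, commit
e53e751c138d, APPEND-ONLY: v1's code region is byte-identical; it adds §4 (the last cell of TorusW's `Q_R`-table — the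
weighted item for real `θ` at the soft exponent `θ`) and §5 (the tower under a general / geometric step law, and the
`θ`-item's unit-lattice limit with rate `L^{−θk}`).  v1.2 = p197613, commit 92ee84f2b2f3, APPEND-ONLY on v1.1 (code regions of v1
and v1.1 byte-identical): it adds §6 (the SHARP exponent `min(2θ,1)` of the `θ`-item's `Q_R`-law, by b05's uniform bound
for `Wt`-ADMISSIBLE PAIRS of weights) and §7 (the `θ`-item's unit-lattice limit with the sharp rate `L^{−min(2θ,1)k}`).
v1.3 = p198069, commit 77d04f270a49, APPEND-ONLY on v1.2 (code regions of v1, v1.1, v1.2 byte-identical): it adds §8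
(the `Q_R`-laws of the two one-sided weighted items at the full rate `η`, by the same admissible-pair packaging) and §9
(their unit-lattice limits, rate `L^{−k}`).  v1.4 = p198863, commit 4f32559770f2, APPEND-ONLY on v1.3 (code regions of v1–v1.3
byte-identical except ONE docstring sentence of §1's `Qtow`, which now points to §10): it adds §10 (the ENTRYWISE identification of the composite `Qtow_k` with King's single `L^k`-block
averaging (2.10) — the semigroup property of block averaging, by induction on `k` — and the block-mean formula for
`unitAvg`) and §11 (King's Lemma 4.5 (4.38) SHAPE — two finite levels `k`, `k + n` compared at rate `L^{−k}` — for the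
abstract tower and the six towers, by the finite geometric sum instead of the limit).  v1.5 (this revision) is
APPEND-ONLY on v1.4 (code regions of v1–v1.4 byte-identical) plus ONE added import (`B5Prop11Lower`, for b05's
`calG_posSemidef` and its `ℓ²`-form toolkit; `B5Prop11Lower` already imports `B5Prop11Inverse`, so no new dependency
direction is created): it adds §12 (the ZERO MODES and the POSITIVITY of the covariance tower: `𝒢(J₀) = a^{−1}J₀` for
`x`-constant `J₀` — Bałaban's (1.82) at `U = 1`, typed as a matrix identity for b05's `calG` —, `Qtow_k Qtow_kᴴ = n_k^{−d}·1`,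
`c_k(c) = a^{−1}c`, `a^{−1} ≤ ‖c_k‖ ≤ Cst(d,a)` and `0 ≤ c_k` for every `k`).

HONEST FRAMING (cell `pub-balaban`, T⁴ programme, estimate NE2 = U1a «η-rate, linear theory»; residual
(R9.ii′) «King's block averaging `Q_k`, composed steps» of the cell record).  The one-step `Q_L`-laws of
`B5G183RateTorusW` §7/§9 — `‖Q_L X^{(η/L)} Q_Lᴴ − L^{−d} X^{(η)}‖ ≤ L^{−d}·C·η` for `X = 𝒢`, `∇_ν𝒢`, `𝒢∇*_ν`,
`𝒲_1∇_ν𝒢∇*_{ν′}𝒲_1`, every level `η = 1/N`, SAME constant — are telescoped along the level sequence `n_k = L^k`: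
with `Qtow_k` the `k`-fold COMPOSITE of `L`-block averagings from level `n_k` down to the UNIT LATTICE `n_0 = 1`
(the torus `Π_μ ℤ/M_μ`; v1.4 §10: entrywise this composite IS the `L^k`-block averaging `Q_k` of (2.10)) and `c_k(X) = n_k^d · Qtow_k X_{n_k} Qtow_kᴴ`, one gets `‖c_{k+1} − c_k‖ ≤ C·L^{−k}`, and
since all `c_k` live in ONE finite-dimensional space, the sequence converges, `‖c_k − c_∞‖ ≤ C·L^{−k}/(1 − L^{−1})`
(`L ≥ 2`).  So this module CONSTRUCTS ONE LIMIT OBJECT: the `k → ∞` — lattice spacing `L^{−k} → 0` — limit of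
the unit-lattice block-averaged FREE (Gaussian) covariance `𝒢 = Δ_a^{−1}` of (1.83) at TRIVIAL background
`U = 1` on a FIXED finite unit torus, in `ℓ²`-operator norm: the Gaussian, trivial-background, finite-volume,
UN-IDENTIFIED toy of this programme's target shape («existence of the ε → 0 limit of unit-scale averaged
expectations on a fixed finite torus»), and NOT that target.  Nothing here is infinite-volume, nothing is a
mass gap, nothing is uniform in a coupling, nothing concerns `U ≠ 1` or an interacting measure, and nothing in
this file is progress on any Clay problem or on the summit statement of this programme; it is finite-dimensional
linear algebra (a recursion, operator-norm submultiplicativity, a geometric series, completeness of a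
finite-dimensional normed space) on top of the ACCEPTED kernel module `B5G183RateTorusW` cited BY NAME
(`Qavg`, `opNorm_Qavg_le`, `opNorm_Qavg_calG_rate`, `opNorm_Qavg_fdiff_calG_rate`,
`opNorm_Qavg_calG_star_fdiff_rate`, `opNorm_Qavg_weightedItem_rate_one`, constants `CQ`, `CQL`, `CQW`; for v1.1 also
`opNorm_weightedItem_rate`, `Qavg_mul_Jmat`, `norm_uCen_sub_one_le`, `norm_uCen_le_one`, `CTW`, b05's
`opNorm_fdiff_calG_star_fdiff_le` / `Cst`, and `B5G183RateO2Op.norm_w1dSym_le`; for v1.2 also TorusW's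
`weightedItem_eq_mulW`, `mulOp_mul_mulW`, `wfsym_restrict`, `wsym_restrict`, b05's block packaging
`B5Prop11Plancherel.opNorm_le_of_blocks` / `reindex_conj_mulW` / `blocks` / `restrict_fsym` / `Delta_zero_zero`, the
fibre bounds `B5Prop11Fiber.opNorm_sandwich_G_le` (admissible pairs `B5Prop11Bound.Fiber.Wt`) and
`B5Prop11Bound.opNorm_sandwich_G₀_le`, `B5Prop11Fiber.Delta_eq`, `B5Prop11Leaves.DeltaXir_shift_ge_four`; for v1.3 also
TorusW's `oneSidedL_eq_mulW`, `oneSidedR_eq_mulW`, `opNorm_oneSidedL_rate`, `opNorm_oneSidedR_rate`, `CT2` and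
`B5G183RateO2Op.wdSym`; for v1.4 also the block parametrisation `B5G183RateTorus.cpt` / `B5G183RateTorusW.off` of
`Qavg`, and Mathlib's `dist_le_Ico_sum_of_dist_le`, `geom_sum_Ico_le_of_lt_one`; for v1.5 also b05's
`B5Prop11Lower.calG_posSemidef` / `exists_gram` / `smul_gram_posSemidef` / `nsq_mulVec_le`, `B5Prop11Plancherel.dftV_apply` /
`dft` / `sum_chi` / `star_dftV_mul` / `blockEquiv_symm_apply` / `blocks` / `calGhat` / `opNorm_calG_le`, `B5Prop11Bound.G₀`, TorusW's
`Qavg_mul_conjTranspose`, and Mathlib's `Matrix.PosSemidef.mul_mul_conjTranspose_same`).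
Bałaban prints NO rate in `η`; King's scalar Lemmas 4.3/4.5 are the printed TEMPLATES; the vector-layer
statements, the normalisation `n_k^d`, the composite `Qtow_k` and every constant are OURS and are NOT attributed
to either author.  `[cite: …]` tags locate TEXT, never a proof.

WHAT IS PRINTED (renders in this cell; [King1986] = C. King, Commun. Math. Phys. 102 (1986) 649–677, p. 672 =
`king-renders/1986-cmp102-king-u1-higgs-I-p024-x2.png`, p. 674 = `…-p026-x2.png`, both re-read by this seat; the
Bałaban and King (2.10) quotations are inherited verbatim from `B5G183RateTorusW`).  Bałaban
[Balaban1984PropagatorsI] p. 33: «Proposition 1.1. The operator G is a symmetric operator on L²(T_η) and ‖GJ‖,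
‖∇GJ‖, ‖G∇*J‖, ‖∇G∇*J‖, ‖∇∇GJ‖, ‖G∇*∇*J‖ ≤ γ₀^{−1}‖J‖, (1.89) with a positive constant γ₀ independent of k, T_η,
and depending on d only (if we put a = 1).»  King p. 653: «Q_k A_μ(y) = L^{−kd} Σ_{x∈B^k(y)} A_μ(x), (2.10)»
(typed one `L`-step at a time as `B5G183RateTorusW.Qavg`).  King p. 672, Lemma 4.3: «|Δ^{(k)}(p′) − Δ^{(k+n)}(p′)|
≦ CL^{−2k}Δ^{(k)}(p′). (4.18)» (the effective Laplacian symbol (4.5) p. 670 of the scalar field after `k`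
block-spin steps); p. 674: «We also need convergence properties of the operator C^{(k)} defined in (2.16).» and
«Lemma 4.5. |C^{(k)}(x, y) − C^{(k+n)}(x, y)| ≦ CL^{−k}e^{−δ₀|x−y|}. (4.38)» (the unit-lattice fluctuation
covariance of the scalar `U(1)` Higgs model, `d = 2, 3`, with exponential decay).  These are the printed scalar
templates; the `δ_{μν}`-coupled VECTOR layer (the x-block (1.83)), every `d`, operator norm, no decay, is OURS.  [v1.5]
Bałaban p. 30 (`b2b-balaban-ref1/pages/1984-cmp95-propagators-rt-I/…-p014-x2.png`, read by this seat): «At first let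
us prove that Δ_a is a positive operator. Of course it is a symmetric operator and it is non-negative as a sum of two
non-negative operators Δ − ∂P∂* and aQ*Q, a > 0.», «Δ_a^{−1} = G_k, or simply G. (1.71)», «a⟨1, Q*QA_μ⟩ = a⟨1, A_μ⟩ =
⟨1, J_μ⟩, (1.74) so ⟨1, A_μ⟩ = a^{−1}⟨1, J_μ⟩, 1 denotes here a function on T_η identically equal to 1.»; p. 31
(`…-p015-x2.png`, read by this seat): «For arbitrary J we take the decomposition J = J′ + J₀, J₀ constant, J′ orthogonal
to constant functions, and we put GJ = GJ′ + a^{−1}J₀. (1.82)», and after (1.83): «for p′ ≠ 0, Ã_μ(l) = (1/Δ(l)) J̃_μ(l),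
Ã_μ(0) = a^{−1}J̃_μ(0)».  King p. 653 (`king-renders/…-p005-x2.png`, read by this seat): «The effective Laplacian of the
average scalar field on Ω^{(k)} is Δ^{(k),L^kε}(Ω, A) = a_k(L^kε)^{−2}I − a_k²(L^kε)^{−4}Q_k(A)G_k^ε(Ω, A)Q_k(A)^*. (2.14)»
and «All the corresponding expressions for the vector field are obtained from (2.13)–(2.17) by setting m² = μ₀², N = d
and A = 0.» (quoted only for NOT CLAIMED (vii) below).

WHAT IS TYPED.
* §1 (levels and the composite averaging).  `lev L k` (`n_0 = 1`, `n_{k+1} = L·n_k`, structurally recursive so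
  that one averaging step `Qavg (lev L k) L M : level n_{k+1} → level n_k` lands DEFINITIONALLY on the next
  level; `atSucc` is the identity transport between the two spellings of that index type); `Qtow L M k`, the
  `k`-fold composite `Q_L^{(n_0←n_1)} ⋯ Q_L^{(n_{k−1}←n_k)}` (`Qtow 0 = 1`); **`opNorm_Qtow_sq_le`:
  `‖Qtow_k‖² ≤ n_k^{−d}`** (from `‖Q_L‖ ≤ L^{−d/2}`).
* §2 (the abstract tower).  `unitAvg L M X k = n_k^d · Qtow_k X_k Qtow_kᴴ` for a tower `X_k` of level-`n_k`
  operators (`n_k^d` compensates `‖Qtow_k‖²`, the ratio of the `ℓ²` normalisations); **`opNorm_towerCore_le`**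
  (no recursion: `‖Q₀‖² ≤ N^{−d}` and the one-step law at level `N` give `‖(LN)^d(Q₀Q_L)X₁(Q₀Q_L)ᴴ − N^d Q₀X₀Q₀ᴴ‖
  ≤ C/N`); **`opNorm_unitAvg_succ_sub_le`: `‖c_{k+1} − c_k‖ ≤ C/n_k`**; **`unitAvg_tendsto`** (`L ≥ 2`): `∃ c_∞`,
  `c_k → c_∞` and `‖c_k − c_∞‖ ≤ C·(L^{−1})^k/(1 − L^{−1})` (Mathlib `cauchySeq_of_le_geometric`,
  `cauchySeq_tendsto_of_complete`, `dist_le_of_le_geometric_of_tendsto`).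
* §3 (the four towers at `U = 1`).  **`opNorm_unitCov_succ_sub_le`: `‖c_{k+1}(𝒢) − c_k(𝒢)‖ ≤ CQ(d,a)·L^{−k}`**
  (`L ≥ 1`) and **`unitCov_tendsto`: the `k → ∞` limit of `c_k(𝒢) = n_k^d Qtow_k 𝒢^{(L^{−k})} Qtow_kᴴ` EXISTS with
  `‖c_k − c_∞‖ ≤ CQ·L^{−k}/(1 − L^{−1})`** (`L ≥ 2`); **`unitAvg_items_tendsto`**: likewise for `∇_ν𝒢`, `𝒢∇*_ν`
  (constant `CQL`) and King's weighted item `𝒲_1∇_ν𝒢∇*_{ν′}𝒲_1` (`CQW`) — every `d`, every finite unit torus,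
  every `a > 0`.
* §4 (v1.1; the last cell of the `Q_R`-table).  **`opNorm_Qavg_weightedItem_rate_theta`**: for `0 ≤ θ ≤ 1`,
  `‖Q_R(𝒲_θ′∇_ν′𝒢′∇′*_{ν′}𝒲_θ′)Q_Rᴴ − R^{−d}𝒲_θ∇_ν𝒢∇*_{ν′}𝒲_θ‖ ≤ R^{−d}·CQWθ(d,a,θ)·η^θ`, `CQWθ = CTW + 2·Cdefθ·Cst`,
  `Cdefθ = 2^{1−θ}(dπ²/2)^θ`: TorusW's `J_R`-law `opNorm_weightedItem_rate` (rate `η^{min(2θ,1)} ≤ η^θ`) packaged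
  against `Q_R` by the pointwise interpolation `|u_R − 1|·W^θ ≤ min(2, x)·W^θ ≤ 2^{1−θ}(xW)^θ ≤ Cdefθ·η^θ`
  (`x = (π/2)ηΣ_μ|∂_μ|` from `norm_uCen_sub_one_le`, `W|∂_μ| ≤ π` from `B5G183RateO2Op.norm_w1dSym_le`) — the
  multiplier plumbing and the packaging law of TorusW §9 are re-derived privately (they are not exported there).  THE
  EXPONENT `θ` IS THE SOFT ONE; `min(2θ,1)` is NOT claimed against `Q_R` in §4 — it is PROVED in §6 (v1.2; §4 is kept
  verbatim as landed).
* §5 (v1.1).  `opNorm_towerCore_le'` / `opNorm_unitAvg_succ_sub_le'` (arbitrary step bound `e_k`),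
  **`unitAvg_tendsto_geom`** (step bounds `C·ρ^k`, `ρ < 1` ⇒ limit with `‖c_k − c_∞‖ ≤ Cρ^k/(1 − ρ)`), and
  **`unitAvgWθ_tendsto`**: for `0 < θ ≤ 1`, `L ≥ 2`, the unit-lattice images of `𝒲_θ∇_ν𝒢∇*_{ν′}𝒲_θ` converge, rate
  `CQWθ·(L^{−θ})^k/(1 − L^{−θ})`.
* §6 (v1.2; the sharp exponent).  **`opNorm_mulW_le_of_wt`**: b05's Plancherel packaging `‖mulW W₁ W₂‖ ≤ Cst(d,a)` for
  GENERAL pairs of multipliers whose coset restrictions are `Wt`-admissible for Bałaban's fibre (`p′ ≠ 0`) and satisfy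
  the product conditions of the `p′ = 0` fibre (the tree's `opNorm_mulW_le` takes integer derivative orders only);
  **`opNorm_mulOp_uCen_sub_one_mul_weightedItem_le`**: the averaging defect
  `‖(mulOp u_R − 1)·𝒲_θ∇_ν𝒢∇*_{ν′}𝒲_θ‖ ≤ Kθ(d,θ)·Cst(d,a)·η^{min(2θ,1)}` for every `θ ≥ 0`, `Kθ = Cdefθ(d,min(2θ,1))
  + π(d+1)/4` — the defect is `mulW((u_R − 1)W^θ∂_ν, W^θ∂_{ν′})`, and the pair `(η^{−γ}Kθ^{−1}(u_R − 1)W^θ∂_ν, W^θ∂_{ν′})`,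
  `γ = min(2θ,1)`, is admissible: the PRODUCT of the two weights carries `|u_R − 1|W^{2θ} ≤ |u_R − 1|W^γ ≤ Cdefθ·η^γ`
  (§4's interpolation at the exponent `γ`), each single weight only `η^{−γ}|u_R − 1||∂_ν| ≤ (π(d+1)/4)Δ`;
  **`opNorm_Qavg_weightedItem_rate_sharp`**: for `0 ≤ θ ≤ 1`,
  `‖Q_R(𝒲_θ′∇′_ν𝒢′∇′*_{ν′}𝒲_θ′)Q_Rᴴ − R^{−d}𝒲_θ∇_ν𝒢∇*_{ν′}𝒲_θ‖ ≤ R^{−d}·CQWθS(d,a,θ)·η^{min(2θ,1)}`,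
  `CQWθS = CTW + 2·Kθ·Cst` — the SAME exponent as the `J_R`-law `opNorm_weightedItem_rate`.
* §7 (v1.2).  **`unitAvgWθ_tendsto_sharp`**: for `0 < θ ≤ 1`, `L ≥ 2`, the unit-lattice images of
  `𝒲_θ∇_ν𝒢∇*_{ν′}𝒲_θ` converge with rate `CQWθS·(L^{−γ})^k/(1 − L^{−γ})`, `γ = min(2θ,1)`.
* §8 (v1.3; the one-sided items).  **`opNorm_mulOp_uCen_sub_one_mul_oneSidedL_le`**,
  **`opNorm_mulOp_uCen_sub_one_mul_oneSidedR_le`**: the averaging defects `‖(mulOp u_R − 1)·∇_ν∇_{ν′}𝒲₂𝒢‖`,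
  `‖(mulOp u_R − 1)·𝒢𝒲₂∇*_ν∇*_{ν′}‖ ≤ K₂·Cst(d,a)·η`, `K₂ = dπ²/2 + π(d+1)/2` — the defects are the sandwiches
  `mulW((u_R − 1)∂_νW²∂_{ν′}, 1)`, `mulW(u_R − 1, ∂_νW²∂_{ν′})`, admissible for §6's `opNorm_mulW_le_of_wt` after scaling by
  `η^{−1}K₂^{−1}` (pointwise: `|∂_ν|W²|∂_{ν′}| ≤ Δ`, `η^{−1}|u_R − 1| ≤ (π/2)Σ_μ|∂_μ| ≤ (πd/2)·max(1,Δ)`, and the product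
  carries `|u_R − 1|W ≤ Cdefθ(d,1)η` of §4); the right defects are adjoints of the mirror items' left defects;
  **`opNorm_Qavg_oneSidedL_rate`**, **`opNorm_Qavg_oneSidedR_rate`**:
  `‖Q_R(∇′_ν∇′_{ν′}𝒲₂′𝒢′)Q_Rᴴ − R^{−d}∇_ν∇_{ν′}𝒲₂𝒢‖, ‖Q_R(𝒢′𝒲₂′∇′*_ν∇′*_{ν′})Q_Rᴴ − R^{−d}𝒢𝒲₂∇*_ν∇*_{ν′}‖ ≤ R^{−d}·CQ2(d,a)·η`,
  `CQ2 = CT2 + 2K₂·Cst` (TorusW's `J_R`-laws `opNorm_oneSidedL_rate` / `opNorm_oneSidedR_rate` packaged against `Q_R`) —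
  with TorusW §9 and §4/§6 above, ALL SIX items of (1.89) now have `Q_R`-laws at `U = 1`.
* §9 (v1.3).  `unitAvgDDWG`, `unitAvgGWDD` and **`unitAvg_oneSided_tendsto`** (`L ≥ 2`): the unit-lattice images of the
  two one-sided weighted items converge, `‖c_k − c_∞‖ ≤ CQ2·L^{−k}/(1 − L^{−1})`.
* §10 (v1.4; the composite IS King's `Q_k`).  `parSite` (the parent site `⌊y/L⌋` of one block step) and **`Qtow_apply`**:
  ENTRYWISE, `Qtow_k((x₀,μ),(y,ν)) = n_k^{−d}·δ_{μν}·[⌊y_i/n_k⌋ = (x₀)_i ∀ i]` (representatives `0 ≤ y_i < n_k M_i`,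
  `0 ≤ (x₀)_i < M_i`) — the matrix of the `L^k`-block averaging of (2.10) («Q_k A_μ(y) = L^{−kd} Σ_{x∈B^k(y)} A_μ(x)»,
  block = the `n_k^d` fine sites `n_k x₀ + j`, `0 ≤ j_i < n_k`): the SEMIGROUP PROPERTY of block averaging (`k` steps of
  `L`-blocks = one `L^k`-block), by induction on `k` (one step: the fine site `y` lies in the block of the coarse site
  `z` iff `z = ⌊y/L⌋`, for exactly one offset); **`unitAvg_apply`**: `unitAvg X k` has the entries
  `n_k^{−d} Σ_{y ∈ B^k(x₀)×{μ}, y′ ∈ B^k(x₀′)×{μ′}} X_k(y,y′)` (King's `Q_k X_k Q_k^*`, the block means of the kernel).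
* §11 (v1.4; (4.38) shape).  **`opNorm_unitAvg_sub_unitAvg_le`**: under the one-step law with constant `C`, `L ≥ 2`, ANY
  TWO levels satisfy `‖unitAvg X k − unitAvg X (k+n)‖ ≤ C·(L^{−1})^k/(1 − L^{−1})` (finite geometric sum; no limit
  object needed); **`opNorm_unitCov_sub_unitCov_le`** (`CQ`) and **`opNorm_unitAvg_items_sub_le`** (`CQL`, `CQL`, `CQW`,
  `CQ2`, `CQ2`): the same for the six towers of §3/§9 — the operator-norm, vector-layer, `U = 1`, no-decay counterpart
  of the printed comparison «|C^{(k)}(x, y) − C^{(k+n)}(x, y)| ≦ CL^{−k}e^{−δ₀|x−y|}. (4.38)».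
* §12 (v1.5; zero modes and positivity).  **`calG_mulVec_const`: `𝒢(J₀) = a^{−1}·J₀`** for every `x`-constant vector field
  `J₀ = ((x, μ) ↦ c_μ)` on any level-`n` torus — (1.82)/(1.74) at `U = 1` as a matrix identity for b05's `calG` (the
  componentwise DFT of a constant is supported at `p = 0`, `dftV_mulVec_const`; the zero-momentum column of `Ĝ` is
  `a^{−1}`·(Kronecker delta), `calGhat_apply_zero`, i.e. b05's `p′ = 0` block `G₀` at `l = 0`; inverse DFT);
  **`Qtow_mul_conjTranspose`: `Qtow_k Qtow_kᴴ = n_k^{−d}·1`** and **`Qtow_conjTranspose_mulVec_const`** (`Qtow_kᴴ` spreads a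
  unit-lattice constant to `n_k^{−d}`·constant, by §10's entry formula); hence **`unitCov_mulVec_const`: `c_k(c) = a^{−1}·c`
  for every `k`** — `a^{−1}` is an eigenvalue of every `c_k = n_k^d Qtow_k 𝒢 Qtow_kᴴ` (and so of `c_∞`) —,
  **`inv_le_opNorm_unitCov`: `a^{−1} ≤ ‖c_k‖`** (`d ≥ 1`), **`opNorm_unitCov_le`: `‖c_k‖ ≤ Cst(d,a)`**, and
  **`unitCov_posSemidef`: `0 ≤ c_k`** (congruence of b05's `calG_posSemidef`), `unitCov_isHermitian`.

NOT CLAIMED.  (i) The limits are NOT identified (no continuum free propagator, no block-averaged continuum field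
is typed); (ii) [v1.4] the composite `Qtow_k` is identified with the single `L^k`-block averaging `Q_k` of (2.10) ENTRYWISE
ONLY (`Qtow_apply`); no separate operator `Q_{L^k}` from level `n_k` to the unit lattice is typed (TorusW's
`Qavg 1 (lev L k) M` lives on the index type `fine (lev L k · 1) M`, propositionally but not definitionally the level-`n_k`
type), so the identification is an entry formula, not a matrix equation, and nothing downstream uses it; (iii) NO position-space decay (the
`e^{−δ₀|x−y|}` of (4.38)), no `p′`-derivatives, no `U ≠ 1`, no covariant averaging `Q(U)`, no interacting
measure; (iv) the rate `L^{−k}` is not claimed optimal (King's symbol rate (4.18) is `L^{−2k}`), nor any constant;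
(v) the statements are NOT instances of the cell's hypothesis shapes `T4EtaRate.NE2…` (position-space kernel
bounds over the carriers of `B9`); (vi) [v1.3] the one-sided order-two items have their `Q_R`-laws and towers ONLY with King's weight `W²` placed
between the pair of derivatives and `𝒢` (`∇_ν∇_{ν′}𝒲₂𝒢`, `𝒢𝒲₂∇*_ν∇*_{ν′}`, TorusW §8's placement, ours) — nothing is
claimed for the UNWEIGHTED order-two items (the unweighted two-sided `η`-rate is REFUTED in the `J_R`-currency,
`B5G183RateObstructionOp.not_orderTwoOpRateResidual`) or for other weight placements; the weighted item for `0 < θ < 1` has its `Q_R`-law and tower at the exponent `min(2θ,1)` (§6, §7; §4, §5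
give the soft exponent `θ`) — NO OPTIMALITY of `min(2θ,1)` is claimed against `Q_R` or for the tower (TorusW's exponent
law `torusRateWθ_law` concerns the `J_R`-currency; a lower bound does not transfer through `Q_R`), and no constant is
claimed sharp; (vii) [v1.5] NO EFFECTIVE LAPLACIAN is typed and NO positivity of King's form (2.14) is claimed for this
tower: `c_k` is King's COMPONENTWISE block averaging (2.10) applied to Bałaban's Landau-gauge `𝒢`, whose own averaging
constraint `aQ*Q` in `Δ_a` (1.69) is Bałaban's contour averaging (1.18) (symbol `u·v_μ` (1.61), b05's `B5Prop11Inverse.Qv` /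
`B5Block118.QvOp`), NOT the componentwise one (symbol `u`); King's sentence «All the corresponding expressions for the
vector field are obtained … by setting m² = μ₀², N = d and A = 0» concerns King's massive componentwise model, where `G_k`
is built with the same componentwise `Q_k`.  For the mixed object `c_k` the transform `a·1 − a²·c_k` of (2.14) is NOT
positive in general — numerically (this seat, compute job j077253, exact linear algebra in floating point on small tori:
`d = 2`, `M = (3,3)`, `n_1 = 2`, `a = 1` gives `‖c_1‖ ≈ 1.27 > 1 = a^{−1}`, while Bałaban's own averaging gives
`‖n^d Q𝒢Q^T‖ = a^{−1}` to machine precision in every tested case) —, so only `a^{−1} ≤ ‖c_k‖` is claimed here, not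
`‖c_k‖ ≤ a^{−1}`; the positive object `a − a²·Q_k𝒢Q_k^*` with Bałaban's `Q_k` (1.18) is not typed in this file.
-/

noncomputable section

namespace Literature.MathematicalPhysics.QuantumFieldTheory.Balaban1983to89.B5G183RateUnitTower

open scoped BigOperators ComplexConjugate Matrix Matrix.Norms.L2Operator
open Finset Complex Filter Topology
open Literature.MathematicalPhysics.QuantumFieldTheory.Balaban1983to89.B4Strip
open Literature.MathematicalPhysics.QuantumFieldTheory.Balaban1983to89.B5Prop11Fiber
open Literature.MathematicalPhysics.QuantumFieldTheory.Balaban1983to89.B5Prop11Bound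
open Literature.MathematicalPhysics.QuantumFieldTheory.Balaban1983to89.B5Prop11Plancherel
open Literature.MathematicalPhysics.QuantumFieldTheory.Balaban1983to89.B5Hk163Rate
open Literature.MathematicalPhysics.QuantumFieldTheory.Balaban1983to89.B5G183RateTorus
open Literature.MathematicalPhysics.QuantumFieldTheory.Balaban1983to89.B5G183RateTorusW

variable {d : ℕ}

section UnitTower

/-- the LEVEL SEQUENCE `n_0 = 1`, `n_{k+1} = L · n_k` (so `n_k = L^k`, and level `n_k` is the lattice of spacing
`L^{−k}` on the torus of periods `M`; `n_0 = 1` is the UNIT LATTICE).  Defined by structural recursion so that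
`fine (lev L (k+1)) M` is DEFINITIONALLY `fine (L * lev L k) M`, the index type of one `L`-block averaging step
`Qavg (lev L k) L M`. [folklore] -/
def lev (L : ℕ) : ℕ → ℕ
  | 0 => 1
  | k + 1 => L * lev L k

/-- `n_0 = 1`. [folklore] -/
@[simp] private theorem lev_zero (L : ℕ) : lev L 0 = 1 := rfl

/-- `n_{k+1} = L n_k` (definitional). [folklore] -/
@[simp] private theorem lev_succ (L k : ℕ) : lev L (k + 1) = L * lev L k := rfl

/-- `1 ≤ n_k` for `L ≥ 1`. [folklore] -/
private theorem one_le_lev (L : ℕ) [NeZero L] (k : ℕ) : 1 ≤ lev L k := by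
  induction k with
  | zero => exact le_rfl
  | succ k ih => exact Nat.mul_pos (Nat.pos_of_ne_zero (NeZero.ne L)) ih

/-- every level is a nonzero natural (instance plumbing for `Tor (fine (lev L k) M)`, `calG`, `Qavg`). [folklore] -/
instance lev_neZero (L : ℕ) [NeZero L] (k : ℕ) : NeZero (lev L k) :=
  ⟨Nat.pos_iff_ne_zero.mp (one_le_lev L k)⟩

/-- `n_k = L^k` as a real number. [folklore] -/
private theorem cast_lev (L k : ℕ) : ((lev L k : ℕ) : ℝ) = (L : ℝ) ^ k := by
  induction k with
  | zero => simp
  | succ k ih => rw [lev_succ, Nat.cast_mul, ih, pow_succ, mul_comm]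

variable (L : ℕ) [NeZero L] (M : Fin d → ℕ) [hM : ∀ μ, NeZero (M μ)]

/-- square matrices on the level-`n` lattice `Tor (fine n M) × Fin d` (vector-valued lattice fields). [folklore] -/
abbrev TMat (n : ℕ) : Type := Matrix (Tor (fine n M) × Fin d) (Tor (fine n M) × Fin d) ℂ

/-- identity transport `TMat (lev L (k+1)) → TMat (L · lev L k)`: the two index types are DEFINITIONALLY equal
(`lev L (k+1)` unfolds to `L * lev L k`), but instance search does not unfold `lev`, so products with the one-step
averaging `Qavg (lev L k) L M` are written through this `id`. [folklore] -/
def atSucc (k : ℕ) (X : TMat M (lev L (k + 1))) : TMat M (L * lev L k) := X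

/-- **Core of the tower step** (no recursion): if `‖Q₀‖² ≤ N^{−d}` and the one-step `Q_L`-law holds at level `N` with
constant `C`, then `‖(LN)^d·(Q₀Q_L)X₁(Q₀Q_L)ᴴ − N^d·Q₀X₀Q₀ᴴ‖ ≤ C/N`. [cite: King1986, Lemma 4.5 (4.38) p.674 (scalar
template); (2.10) p.653] — statement ours. [folklore] -/
theorem opNorm_towerCore_le {N : ℕ} [NeZero N] {ι : Type*} [Fintype ι] [DecidableEq ι]
    (Q₀ : Matrix ι (Tor (fine N M) × Fin d) ℂ) (X₁ : TMat M (L * N)) (X₀ : TMat M N) {C : ℝ}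
    (hQ : ‖Q₀‖ ^ 2 ≤ (((N : ℕ) : ℝ) ^ d)⁻¹)
    (hX : ‖Qavg N L M * X₁ * (Qavg N L M)ᴴ - ((L : ℂ) ^ d)⁻¹ • X₀‖ ≤ ((L : ℝ) ^ d)⁻¹ * C / N) :
    ‖(((L * N : ℕ) : ℂ) ^ d) • (Q₀ * Qavg N L M * X₁ * (Q₀ * Qavg N L M)ᴴ) - ((N : ℂ) ^ d) • (Q₀ * X₀ * Q₀ᴴ)‖
      ≤ C / N := by
  have hL0 : (L : ℂ) ≠ 0 := Nat.cast_ne_zero.mpr (NeZero.ne L)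
  have hLd : ((L : ℂ) ^ d) ≠ 0 := pow_ne_zero _ hL0
  have hLr : (0 : ℝ) < L := by exact_mod_cast Nat.pos_of_ne_zero (NeZero.ne L)
  have hn : (0 : ℝ) < N := by exact_mod_cast Nat.pos_of_ne_zero (NeZero.ne N)
  set E := Qavg N L M * X₁ * (Qavg N L M)ᴴ - ((L : ℂ) ^ d)⁻¹ • X₀ with hE
  have key : (((L * N : ℕ) : ℂ) ^ d) • (Q₀ * Qavg N L M * X₁ * (Q₀ * Qavg N L M)ᴴ) - ((N : ℂ) ^ d) • (Q₀ * X₀ * Q₀ᴴ)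
      = (((L * N : ℕ) : ℂ) ^ d) • (Q₀ * E * Q₀ᴴ) := by
    rw [hE, Matrix.conjTranspose_mul, Matrix.mul_sub, Matrix.sub_mul, smul_sub, Matrix.mul_smul,
      Matrix.smul_mul, smul_smul]
    congr 1
    · simp only [Matrix.mul_assoc]
    · congr 1
      rw [Nat.cast_mul, mul_pow, mul_comm ((L : ℂ) ^ d) _, mul_inv_cancel_right₀ hLd]
  rw [key, norm_smul]
  have hA : ‖(((L * N : ℕ) : ℂ) ^ d)‖ = ((L : ℝ) * N) ^ d := by
    rw [norm_pow, Complex.norm_natCast, Nat.cast_mul]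
  rw [hA]
  calc ((L : ℝ) * N) ^ d * ‖Q₀ * E * Q₀ᴴ‖
      ≤ ((L : ℝ) * N) ^ d * (‖Q₀‖ * ‖E‖ * ‖Q₀‖) := by
        refine mul_le_mul_of_nonneg_left ?_ (by positivity)
        calc ‖Q₀ * E * Q₀ᴴ‖ ≤ ‖Q₀ * E‖ * ‖Q₀ᴴ‖ := Matrix.l2_opNorm_mul _ _
          _ ≤ ‖Q₀‖ * ‖E‖ * ‖Q₀‖ := by
              rw [Matrix.l2_opNorm_conjTranspose]
              exact mul_le_mul_of_nonneg_right (Matrix.l2_opNorm_mul _ _) (norm_nonneg _)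
    _ = ((L : ℝ) * N) ^ d * ‖Q₀‖ ^ 2 * ‖E‖ := by ring
    _ ≤ ((L : ℝ) * N) ^ d * (((N : ℕ) : ℝ) ^ d)⁻¹ * (((L : ℝ) ^ d)⁻¹ * C / N) := by gcongr
    _ = C / N := by
        field_simp
        ring

/-- the `k`-FOLD COMPOSITE of `L`-block averagings from level `n_k = L^k` down to the unit lattice `n_0 = 1`:
`Qtow 0 = 1`, `Qtow (k+1) = Qtow k · Q_L^{(n_k ← L n_k)}` ([cite: King1986, (2.10) p.653] for one step).  That this
composite equals the single `L^k`-block averaging (the semigroup property of (2.10)) is proved ENTRYWISE in §10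
(v1.4, `Qtow_apply`) and used nowhere in §§1–9. [folklore] -/
def Qtow : (k : ℕ) →
    Matrix (Tor (fine (lev L 0) M) × Fin d) (Tor (fine (lev L k) M) × Fin d) ℂ
  | 0 => 1
  | k + 1 => Qtow k * Qavg (lev L k) L M

/-- the recursion step of `Qtow` (definitional). [folklore] -/
private theorem Qtow_succ (k : ℕ) : Qtow L M (k + 1) = Qtow L M k * Qavg (lev L k) L M := rfl

/-- `‖Qtow k‖² ≤ n_k^{−d}` (from `‖Q_L‖ ≤ L^{−d/2}`, `B5G183RateTorusW.opNorm_Qavg_le`, by induction on `k`).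
[cite: King1986, (2.10) p.653] — constant ours. [folklore] -/
theorem opNorm_Qtow_sq_le (k : ℕ) : ‖Qtow L M k‖ ^ 2 ≤ (((lev L k : ℕ) : ℝ) ^ d)⁻¹ := by
  induction k with
  | zero =>
    have h1 : ‖(1 : TMat M (lev L 0))‖ ≤ 1 := by
      rw [Matrix.cstar_norm_def, map_one]
      exact ContinuousLinearMap.norm_id_le
    have h0 : 0 ≤ ‖(1 : TMat M (lev L 0))‖ :=
      norm_nonneg _
    have hr : ((((lev L 0 : ℕ) : ℝ)) ^ d)⁻¹ = 1 := by simp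
    show ‖(1 : TMat M (lev L 0))‖ ^ 2 ≤ _
    rw [hr]
    calc ‖(1 : TMat M (lev L 0))‖ ^ 2
        ≤ (1 : ℝ) ^ 2 := pow_le_pow_left₀ h0 h1 2
      _ = 1 := one_pow 2
  | succ k ih =>
    rw [Qtow_succ]
    have hL : (0 : ℝ) < (L : ℝ) ^ d := pow_pos (by exact_mod_cast Nat.pos_of_ne_zero (NeZero.ne L)) d
    have hQ := opNorm_Qavg_le (lev L k) L M
    have hQ2 : ‖Qavg (lev L k) L M‖ ^ 2 ≤ ((L : ℝ) ^ d)⁻¹ := by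
      calc ‖Qavg (lev L k) L M‖ ^ 2 ≤ ((Real.sqrt ((L : ℝ) ^ d))⁻¹) ^ 2 :=
            pow_le_pow_left₀ (norm_nonneg _) hQ 2
        _ = ((L : ℝ) ^ d)⁻¹ := by rw [inv_pow, Real.sq_sqrt hL.le]
    calc ‖Qtow L M k * Qavg (lev L k) L M‖ ^ 2
        ≤ (‖Qtow L M k‖ * ‖Qavg (lev L k) L M‖) ^ 2 :=
          pow_le_pow_left₀ (norm_nonneg _) (Matrix.l2_opNorm_mul _ _) 2
      _ = ‖Qtow L M k‖ ^ 2 * ‖Qavg (lev L k) L M‖ ^ 2 := mul_pow _ _ 2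
      _ ≤ (((lev L k : ℕ) : ℝ) ^ d)⁻¹ * ((L : ℝ) ^ d)⁻¹ :=
          mul_le_mul ih hQ2 (sq_nonneg _) (inv_nonneg.mpr (pow_nonneg (Nat.cast_nonneg _) d))
      _ = (((lev L (k + 1) : ℕ) : ℝ) ^ d)⁻¹ := by
          rw [lev_succ, Nat.cast_mul, mul_pow, mul_inv, mul_comm]

/-- the UNIT-LATTICE IMAGE of a tower `X_k` of level-`n_k` operators: `n_k^d · Qtow_k X_k Qtow_kᴴ` (the factor `n_k^d`
compensates `‖Qtow_k‖² ≤ n_k^{−d}`; for `X_k = 𝒢^{(1/n_k)}` this is the block-averaged free covariance seen on the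
unit lattice). [folklore] -/
def unitAvg (X : (k : ℕ) → TMat M (lev L k)) (k : ℕ) : TMat M (lev L 0) :=
  (((lev L k : ℕ) : ℂ) ^ d) • (Qtow L M k * X k * (Qtow L M k)ᴴ)

/-- **Abstract tower step**: a one-step `Q_L`-law `‖Q_L X_{k+1} Q_Lᴴ − L^{−d} X_k‖ ≤ L^{−d}·C/n_k` at level `n_k`
telescopes to `‖unitAvg X (k+1) − unitAvg X k‖ ≤ C/n_k = C·L^{−k}` on the unit lattice.
[cite: King1986, Lemma 4.5 (4.38) p.674 (scalar template); (2.10) p.653] — statement ours. [folklore] -/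
theorem opNorm_unitAvg_succ_sub_le (X : (k : ℕ) → TMat M (lev L k)) {C : ℝ} (k : ℕ)
    (hX : ‖Qavg (lev L k) L M * atSucc L M k (X (k + 1)) * (Qavg (lev L k) L M)ᴴ - ((L : ℂ) ^ d)⁻¹ • X k‖
      ≤ ((L : ℝ) ^ d)⁻¹ * C / (lev L k : ℕ)) :
    ‖unitAvg L M X (k + 1) - unitAvg L M X k‖ ≤ C / (lev L k : ℕ) :=
  opNorm_towerCore_le L M (Qtow L M k) (atSucc L M k (X (k + 1))) (X k) (opNorm_Qtow_sq_le L M k) hX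

/-- **Abstract tower limit**: under the one-step `Q_L`-law at every level and `L ≥ 2`, the unit-lattice images
`unitAvg X k` form a Cauchy sequence with geometric rate, hence CONVERGE (finite-dimensional space), with
`‖unitAvg X k − lim‖ ≤ C·L^{−k}/(1 − L^{−1})`. [cite: King1986, Lemma 4.5 (4.38) p.674 (scalar template);
(2.10) p.653] — statement ours. [folklore] -/
theorem unitAvg_tendsto (hL : 2 ≤ L) (X : (k : ℕ) → TMat M (lev L k)) {C : ℝ}
    (hX : ∀ k, ‖Qavg (lev L k) L M * atSucc L M k (X (k + 1)) * (Qavg (lev L k) L M)ᴴ - ((L : ℂ) ^ d)⁻¹ • X k‖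
      ≤ ((L : ℝ) ^ d)⁻¹ * C / (lev L k : ℕ)) :
    ∃ Xlim : TMat M (lev L 0),
      Tendsto (unitAvg L M X) atTop (𝓝 Xlim) ∧
      ∀ k, ‖unitAvg L M X k - Xlim‖ ≤ C * ((L : ℝ)⁻¹) ^ k / (1 - (L : ℝ)⁻¹) := by
  have hL1 : (1 : ℝ) < L := by exact_mod_cast (lt_of_lt_of_le one_lt_two hL : 1 < L)
  have hr : (L : ℝ)⁻¹ < 1 := inv_lt_one_of_one_lt₀ hL1
  have hu : ∀ k, dist (unitAvg L M X k) (unitAvg L M X (k + 1)) ≤ C * ((L : ℝ)⁻¹) ^ k := by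
    intro k
    rw [dist_eq_norm, ← norm_neg, neg_sub, inv_pow, ← cast_lev, ← div_eq_mul_inv]
    exact opNorm_unitAvg_succ_sub_le L M X k (hX k)
  have hcs := cauchySeq_of_le_geometric _ _ hr hu
  obtain ⟨Xlim, hlim⟩ := cauchySeq_tendsto_of_complete hcs
  refine ⟨Xlim, hlim, fun k => ?_⟩
  rw [← dist_eq_norm]
  exact dist_le_of_le_geometric_of_tendsto _ _ hr hu hlim k

/-! ### The four towers at U = 1: `𝒢`, `∇_ν𝒢`, `𝒢∇_ν*`, and the King-weighted `𝒲₁∇_ν𝒢∇*_{ν′}𝒲₁` -/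

variable (a : ℝ) (ha : 0 < a)

/-- the UNIT-LATTICE BLOCK-AVERAGED FREE COVARIANCE after `k` steps: `c_k := n_k^d · Qtow_k 𝒢^{(1/n_k)} Qtow_kᴴ`,
`𝒢 = Δ_a^{−1}` the `a`-gauge propagator (1.83) of [Balaban1984PropagatorsI] at `U = 1` on the lattice of spacing
`L^{−k}` over the unit torus `Π_μ ℤ/M_μ`.  (The `δ_{μν}`-coupled VECTOR analogue of the scalar unit-lattice objects
`Δ^{(k)}`, `C^{(k)}` of [King1986] (4.5), (2.16); NOT King's `C^{(k)}` itself.) [folklore] -/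
def unitCov (k : ℕ) : TMat M (lev L 0) :=
  unitAvg L M (fun k => calG (lev L k) (one_le_lev L k) M a ha) k

/-- **`‖c_{k+1} − c_k‖ ≤ CQ(d,a)·L^{−k}`** — the geometric η-rate of the unit-lattice block-averaged free covariance at
`U = 1`, in `ℓ²`-operator norm on the finite unit torus, every `d`, `L ≥ 1`.  Scalar printed analogues: [King1986]
Lemma 4.3 (4.18) p.672 (`|Δ^{(k)}(p′) − Δ^{(k+n)}(p′)| ≤ CL^{−2k}Δ^{(k)}(p′)`), Lemma 4.5 (4.38) p.674
(`|C^{(k)}(x,y) − C^{(k+n)}(x,y)| ≤ CL^{−k}e^{−δ₀|x−y|}`, d = 2,3, with decay).  Statement, currency (operator norm, no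
decay factor) and constant OURS. [cite: King1986, Lemma 4.5 (4.38) p.674; Lemma 4.3 (4.18) p.672; Balaban1984PropagatorsI,
Prop. 1.1 (1.89) p.33] [folklore] -/
theorem opNorm_unitCov_succ_sub_le (k : ℕ) :
    ‖unitCov L M a ha (k + 1) - unitCov L M a ha k‖ ≤ CQ d a / (lev L k : ℕ) := by
  have hL1 : 1 ≤ L := Nat.pos_of_ne_zero (NeZero.ne L)
  exact opNorm_unitAvg_succ_sub_le L M _ k
    (opNorm_Qavg_calG_rate (lev L k) L M (one_le_lev L k) hL1 (one_le_lev L (k + 1)) a ha)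

/-- **The continuum limit of the unit-lattice block-averaged free covariance EXISTS (U = 1, finite torus, `L ≥ 2`)**,
with `‖c_k − c_∞‖ ≤ CQ(d,a)·L^{−k}/(1 − L^{−1})`. [cite: King1986, Lemma 4.5 (4.38) p.674; Balaban1984PropagatorsI,
Prop. 1.1 (1.89) p.33] — statement ours. [folklore] -/
theorem unitCov_tendsto (hL : 2 ≤ L) :
    ∃ cinf : TMat M (lev L 0),
      Tendsto (unitCov L M a ha) atTop (𝓝 cinf) ∧
      ∀ k, ‖unitCov L M a ha k - cinf‖ ≤ CQ d a * ((L : ℝ)⁻¹) ^ k / (1 - (L : ℝ)⁻¹) := by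
  have hL1 : 1 ≤ L := Nat.pos_of_ne_zero (NeZero.ne L)
  exact unitAvg_tendsto L M hL _ fun k =>
    opNorm_Qavg_calG_rate (lev L k) L M (one_le_lev L k) hL1 (one_le_lev L (k + 1)) a ha

/-- the unit-lattice image of the first-order item `∇_ν𝒢` (tower `n_k^d Qtow_k (∇^{(n_k)}_ν 𝒢^{(1/n_k)}) Qtow_kᴴ`).
[folklore] -/
def unitAvgDG (ν : Fin d) (k : ℕ) : TMat M (lev L 0) :=
  unitAvg L M (fun k => fdiff (fine (lev L k) M) ((lev L k : ℕ) : ℂ) ν * calG (lev L k) (one_le_lev L k) M a ha) k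

/-- the unit-lattice image of the first-order item `𝒢∇_ν*`. [folklore] -/
def unitAvgGD (ν : Fin d) (k : ℕ) : TMat M (lev L 0) :=
  unitAvg L M (fun k => calG (lev L k) (one_le_lev L k) M a ha * star (fdiff (fine (lev L k) M) ((lev L k : ℕ) : ℂ) ν)) k

/-- the unit-lattice image of the King-weighted (`θ = 1`) second-order item `𝒲₁∇_ν𝒢∇*_{ν′}𝒲₁`. [folklore] -/
def unitAvgWDGDW (ν ν' : Fin d) (k : ℕ) :
    TMat M (lev L 0) :=
  unitAvg L M (fun k => Wop (lev L k) M 1 *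
    (fdiff (fine (lev L k) M) ((lev L k : ℕ) : ℂ) ν * calG (lev L k) (one_le_lev L k) M a ha *
      star (fdiff (fine (lev L k) M) ((lev L k : ℕ) : ℂ) ν')) * Wop (lev L k) M 1) k

/-- **Continuum limits of the three further items against block averaging (U = 1, `L ≥ 2`)**: the unit-lattice images
of `∇_ν𝒢`, `𝒢∇_ν*` (constant `CQL`) and of the King-weighted item `𝒲₁∇_ν𝒢∇*_{ν′}𝒲₁` (constant `CQW`) converge with
geometric rate `L^{−k}`. [cite: King1986, Lemma 4.5 (4.38) p.674, (4.19)-(4.20) p.672; Balaban1984PropagatorsI, Prop. 1.1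
(1.89) p.33] — statement ours. [folklore] -/
theorem unitAvg_items_tendsto (hL : 2 ≤ L) (ν ν' : Fin d) :
    (∃ Dinf : TMat M (lev L 0),
      Tendsto (unitAvgDG L M a ha ν) atTop (𝓝 Dinf) ∧
      ∀ k, ‖unitAvgDG L M a ha ν k - Dinf‖ ≤ CQL d a * ((L : ℝ)⁻¹) ^ k / (1 - (L : ℝ)⁻¹)) ∧
    (∃ Einf : TMat M (lev L 0),
      Tendsto (unitAvgGD L M a ha ν) atTop (𝓝 Einf) ∧
      ∀ k, ‖unitAvgGD L M a ha ν k - Einf‖ ≤ CQL d a * ((L : ℝ)⁻¹) ^ k / (1 - (L : ℝ)⁻¹)) ∧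
    (∃ Finf : TMat M (lev L 0),
      Tendsto (unitAvgWDGDW L M a ha ν ν') atTop (𝓝 Finf) ∧
      ∀ k, ‖unitAvgWDGDW L M a ha ν ν' k - Finf‖ ≤ CQW d a * ((L : ℝ)⁻¹) ^ k / (1 - (L : ℝ)⁻¹)) := by
  have hL1 : 1 ≤ L := Nat.pos_of_ne_zero (NeZero.ne L)
  refine ⟨?_, ?_, ?_⟩
  · exact unitAvg_tendsto L M hL _ fun k =>
      opNorm_Qavg_fdiff_calG_rate (lev L k) L M (one_le_lev L k) hL1 (one_le_lev L (k + 1)) a ha ν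
  · exact unitAvg_tendsto L M hL _ fun k =>
      opNorm_Qavg_calG_star_fdiff_rate (lev L k) L M (one_le_lev L k) hL1 (one_le_lev L (k + 1)) a ha ν
  · exact unitAvg_tendsto L M hL _ fun k =>
      opNorm_Qavg_weightedItem_rate_one (lev L k) L M (one_le_lev L k) hL1 (one_le_lev L (k + 1)) a ha ν ν'

end UnitTower

/-! ## §4 (v1.1) The last cell of the `Q_R`-table: King's weighted item for `0 < θ ≤ 1` at the SOFT rate `η^θ`

The `J_R`-law of the weighted item for real `θ ∈ [0,1]` (`B5G183RateTorusW.opNorm_weightedItem_rate`, rate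
`η^{min(2θ,1)}`) is packaged against King's block averaging `Q_R` exactly as the `θ = 1` case (TorusW §9): the
averaging-weight defect `(mulOp(u_R) − 1)·𝒲_θ` is bounded POINTWISE by the interpolation
`|u_R − 1|·W^θ ≤ min(2, x)·W^θ ≤ 2^{1−θ}(xW)^θ ≤ 2^{1−θ}(dπ²/2)^θ·η^θ` (`x = (π/2)η Σ_μ|∂_μ|`, `W|∂_μ| ≤ π`), so the
`Q_R`-law holds with the SOFT exponent `θ` (`≤ min(2θ,1)`); the sharp exponent is NOT claimed.  The plumbing lemmas on
Fourier multipliers below are private re-derivations of TorusW's (which are not exported). -/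

section ThetaDefect

open Literature.MathematicalPhysics.QuantumFieldTheory.Balaban1983to89.B5G183RateO2Diag
open Literature.MathematicalPhysics.QuantumFieldTheory.Balaban1983to89.B5G183RateO2Op
open Literature.MathematicalPhysics.QuantumFieldTheory.Balaban1983to89.B5G183RateWTheta

variable (N R : ℕ) [NeZero N] [NeZero R] (M : Fin d → ℕ) [hM : ∀ μ, NeZero (M μ)]

/-- product of multipliers (re-derived; TorusW's copy is private). [folklore] -/
private theorem mulOp_mul_mulOp' (V W : Tor (fine N M) × Fin d → ℂ) :
    mulOp N M V * mulOp N M W = mulOp N M (fun i => V i * W i) := by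
  simp only [mulOp]
  have hU := dftV_mul_star (fine N M)
  set U := dftV (fine N M)
  calc star U * Matrix.diagonal V * U * (star U * Matrix.diagonal W * U)
      = star U * Matrix.diagonal V * (U * star U) * Matrix.diagonal W * U := by
        simp only [Matrix.mul_assoc]
    _ = star U * Matrix.diagonal (fun i => V i * W i) * U := by
        rw [hU, Matrix.mul_one, ← Matrix.diagonal_mul_diagonal]
        simp only [Matrix.mul_assoc]

/-- `mulOp V − 1 = mulOp (V − 1)` (re-derived). [folklore] -/
private theorem mulOp_sub_one' (V : Tor (fine N M) × Fin d → ℂ) :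
    mulOp N M V - 1 = mulOp N M (fun i => V i - 1) := by
  rw [← mulOp_one N M]
  simp only [mulOp]
  rw [← Matrix.sub_mul, ← Matrix.mul_sub, show (Matrix.diagonal fun i => V i - (1 : ℂ))
    = Matrix.diagonal V - Matrix.diagonal (fun _ => (1 : ℂ)) from (Matrix.diagonal_sub V _).symm]

/-- adjoint of a multiplier (re-derived). [folklore] -/
private theorem conjTranspose_mulOp' (V : Tor (fine N M) × Fin d → ℂ) :
    (mulOp N M V)ᴴ = mulOp N M (star V) := by
  simp only [mulOp]
  rw [Matrix.conjTranspose_mul, Matrix.conjTranspose_mul, Matrix.diagonal_conjTranspose,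
    ← Matrix.star_eq_conjTranspose, ← Matrix.star_eq_conjTranspose, star_star, Matrix.mul_assoc]

/-- `‖F^* diag(V) F‖ ≤ sup |V|` (re-derived). [folklore] -/
private theorem opNorm_mulOp_le' (V : Tor (fine N M) × Fin d → ℂ) {C : ℝ} (hC : 0 ≤ C) (hV : ∀ i, ‖V i‖ ≤ C) :
    ‖mulOp N M V‖ ≤ C := by
  rw [mulOp, opNorm_unitary_conj' (dftV_mem_unitaryGroup _)]
  refine opNorm_le_of_offDiag_eq_zero _ hC (fun i j hij => Matrix.diagonal_apply_ne _ hij) ?_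
  intro i
  rw [Matrix.diagonal_apply_eq]
  exact hV i

/-- `‖mulOp(ū_R)‖ ≤ 1` (re-derived). [folklore] -/
private theorem opNorm_mulOp_star_uCen_le' (hR : 1 ≤ R) : ‖mulOp N M (star (uCen N R M))‖ ≤ 1 :=
  opNorm_mulOp_le' N M _ zero_le_one fun P => by
    rw [Pi.star_apply, norm_star]; exact norm_uCen_le_one N R M hR P

/-- `|W^θ| ≤ 1` on the fine torus for `θ ≥ 0`. [folklore] -/
private theorem norm_wsym_le_one {θ : ℝ} (hθ : 0 ≤ θ) (i : Tor (fine N M) × Fin d) : ‖wsym N M θ i‖ ≤ 1 := by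
  obtain ⟨I, rfl⟩ := (blockEquiv N M).symm.surjective i
  have hW := Wc_nonneg_le_one (n := N) I.1.1 (abs_sOf_le M I.2)
  rw [wsym_restrict, Complex.norm_real, Real.norm_of_nonneg (Real.rpow_nonneg hW.1 θ)]
  exact Real.rpow_le_one hW.1 hW.2 hθ

/-- `‖𝒲_θ‖ ≤ 1` for `θ ≥ 0`. [folklore] -/
private theorem opNorm_Wop_le_one {θ : ℝ} (hθ : 0 ≤ θ) : ‖Wop N M θ‖ ≤ 1 :=
  opNorm_mulOp_le' N M _ zero_le_one (norm_wsym_le_one N M hθ)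

/-- `|W·∂_μ| ≤ π` on the fine torus (`B5G183RateO2Op.norm_w1dSym_le`; re-derived packaging). [folklore] -/
private theorem norm_wsym_one_mul_fsym_le' (hN : 1 ≤ N) (μ : Fin d) (i : Tor (fine N M) × Fin d) :
    ‖wsym N M 1 i * fsym (fine N M) (N : ℂ) μ i‖ ≤ Real.pi := by
  obtain ⟨I, rfl⟩ := (blockEquiv N M).symm.surjective i
  have h := wfsym_restrict N M 1 μ I
  rw [show (fun i => wsym N M 1 i * fsym (fine N M) (N : ℂ) μ i) ((blockEquiv N M).symm I)
      = wsym N M 1 ((blockEquiv N M).symm I) * fsym (fine N M) (N : ℂ) μ ((blockEquiv N M).symm I)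
      from rfl] at h
  rw [h, wθdSym_one]
  exact norm_w1dSym_le hN I.1.1 (abs_sOf_le M I.2) μ

/-- the scalar interpolation `u ≤ 2`, `u ≤ x`, `u ≥ 0` ⇒ `u ≤ 2^{1−θ} x^θ` for `0 ≤ θ ≤ 1`. [folklore] -/
private theorem le_rpow_interp {u x θ : ℝ} (hu0 : 0 ≤ u) (hu2 : u ≤ 2) (hux : u ≤ x) (hθ0 : 0 ≤ θ)
    (hθ1 : θ ≤ 1) : u ≤ 2 ^ (1 - θ) * x ^ θ := by
  calc u = u ^ (1 - θ) * u ^ θ := by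
        rw [← Real.rpow_add' hu0 (by norm_num : (1 - θ) + θ ≠ 0), sub_add_cancel, Real.rpow_one]
    _ ≤ 2 ^ (1 - θ) * x ^ θ :=
        mul_le_mul (Real.rpow_le_rpow hu0 hu2 (by linarith)) (Real.rpow_le_rpow hu0 hux hθ0)
          (Real.rpow_nonneg hu0 _) (Real.rpow_nonneg zero_le_two _)

omit [NeZero N] [NeZero R] hM in
/-- the `θ`-defect constant `2^{1−θ}·(dπ²/2)^θ`. [folklore] -/
def Cdefθ (d : ℕ) (θ : ℝ) : ℝ := 2 ^ (1 - θ) * (d * Real.pi ^ 2 / 2) ^ θ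

omit [NeZero N] [NeZero R] hM in
/-- `0 ≤ Cdefθ`. [folklore] -/
private theorem Cdefθ_nonneg (d : ℕ) (θ : ℝ) : 0 ≤ Cdefθ d θ := by
  unfold Cdefθ
  exact mul_nonneg (Real.rpow_nonneg zero_le_two _) (Real.rpow_nonneg (by positivity) _)

/-- **the pointwise `θ`-defect bound `|u_R − 1|·W^θ ≤ 2^{1−θ}(dπ²/2)^θ·η^θ`** (`0 ≤ θ ≤ 1`): interpolate
`|u_R − 1| ≤ min(2, (π/2)ηΣ_μ|∂_μ|)` (`norm_uCen_sub_one_le`, `norm_uCen_le_one`) against `W|∂_μ| ≤ π`. [folklore] -/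
private theorem norm_uCen_sub_one_mul_wsym_le (hN : 1 ≤ N) (hR : 1 ≤ R) {θ : ℝ} (hθ0 : 0 ≤ θ) (hθ1 : θ ≤ 1)
    (i : Tor (fine N M) × Fin d) :
    ‖(uCen N R M i - 1) * wsym N M θ i‖ ≤ Cdefθ d θ / (N : ℝ) ^ θ := by
  have hNpos : (0 : ℝ) < N := by exact_mod_cast hN
  obtain ⟨I, rfl⟩ := (blockEquiv N M).symm.surjective i
  set P := (blockEquiv N M).symm I with hP
  have hWb := Wc_nonneg_le_one (n := N) I.1.1 (abs_sOf_le M I.2)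
  have hws : wsym N M θ P = ((Wc N I.1.1 (sOf M I.2) ^ θ : ℝ) : ℂ) := wsym_restrict N M θ I
  have hws1 : wsym N M 1 P = ((Wc N I.1.1 (sOf M I.2) : ℝ) : ℂ) := by
    rw [hP, wsym_restrict, Real.rpow_one]
  set W := Wc N I.1.1 (sOf M I.2) with hWdef
  set x := Real.pi / (2 * N) * ∑ μ, ‖fsym (fine N M) (N : ℂ) μ P‖ with hx
  have hx0 : 0 ≤ x := by positivity
  have hu1 : ‖uCen N R M P - 1‖ ≤ x := norm_uCen_sub_one_le N R M hN hR P
  have hu2 : ‖uCen N R M P - 1‖ ≤ 2 := by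
    refine (norm_sub_le _ _).trans ?_
    rw [norm_one]
    linarith [norm_uCen_le_one N R M hR P]
  have hxW : x * W ≤ d * Real.pi ^ 2 / (2 * N) := by
    have e : x * W = Real.pi / (2 * N) * ∑ μ, ‖wsym N M 1 P * fsym (fine N M) (N : ℂ) μ P‖ := by
      rw [hx, mul_assoc, Finset.sum_mul]
      congr 1
      refine Finset.sum_congr rfl fun μ _ => ?_
      rw [norm_mul, hws1, Complex.norm_real, Real.norm_of_nonneg hWb.1, mul_comm]
    rw [e]
    calc Real.pi / (2 * N) * ∑ μ, ‖wsym N M 1 P * fsym (fine N M) (N : ℂ) μ P‖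
        ≤ Real.pi / (2 * N) * ∑ _μ : Fin d, Real.pi := by
          gcongr with μ _
          exact norm_wsym_one_mul_fsym_le' N M hN μ P
      _ = d * Real.pi ^ 2 / (2 * N) := by
          rw [Finset.sum_const, Finset.card_univ, Fintype.card_fin, nsmul_eq_mul]
          field_simp
  have hint := le_rpow_interp (norm_nonneg (uCen N R M P - 1)) hu2 hu1 hθ0 hθ1
  calc ‖(uCen N R M P - 1) * wsym N M θ P‖ = ‖uCen N R M P - 1‖ * W ^ θ := by
        rw [norm_mul, hws, Complex.norm_real, Real.norm_of_nonneg (Real.rpow_nonneg hWb.1 θ)]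
    _ ≤ 2 ^ (1 - θ) * x ^ θ * W ^ θ := mul_le_mul_of_nonneg_right hint (Real.rpow_nonneg hWb.1 θ)
    _ = 2 ^ (1 - θ) * (x * W) ^ θ := by rw [Real.mul_rpow hx0 hWb.1, mul_assoc]
    _ ≤ 2 ^ (1 - θ) * (d * Real.pi ^ 2 / (2 * N)) ^ θ :=
        mul_le_mul_of_nonneg_left (Real.rpow_le_rpow (mul_nonneg hx0 hWb.1) hxW hθ0)
          (Real.rpow_nonneg zero_le_two _)
    _ = Cdefθ d θ / (N : ℝ) ^ θ := by
        rw [Cdefθ, ← div_div, Real.div_rpow (by positivity) hNpos.le]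
        ring

/-- **the `θ`-weighted averaging defect `‖(mulOp(u_R) − 1)·𝒲_θ‖ ≤ Cdefθ·η^θ`.** [folklore] -/
private theorem opNorm_mulOp_uCen_sub_one_mul_Wop_theta_le (hN : 1 ≤ N) (hR : 1 ≤ R) {θ : ℝ} (hθ0 : 0 ≤ θ)
    (hθ1 : θ ≤ 1) : ‖(mulOp N M (uCen N R M) - 1) * Wop N M θ‖ ≤ Cdefθ d θ / (N : ℝ) ^ θ := by
  have hNpos : (0 : ℝ) < N := by exact_mod_cast hN
  rw [mulOp_sub_one', Wop, mulOp_mul_mulOp']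
  exact opNorm_mulOp_le' N M _ (div_nonneg (Cdefθ_nonneg d θ) (Real.rpow_nonneg hNpos.le θ))
    fun i => norm_uCen_sub_one_mul_wsym_le N R M hN hR hθ0 hθ1 i

/-- the adjoint defect `‖𝒲_θ·(mulOp(ū_R) − 1)‖ ≤ Cdefθ·η^θ`. [folklore] -/
private theorem opNorm_Wop_theta_mul_mulOp_star_uCen_sub_one_le (hN : 1 ≤ N) (hR : 1 ≤ R) {θ : ℝ}
    (hθ0 : 0 ≤ θ) (hθ1 : θ ≤ 1) :
    ‖Wop N M θ * (mulOp N M (star (uCen N R M)) - 1)‖ ≤ Cdefθ d θ / (N : ℝ) ^ θ := by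
  have hsw : star (wsym N M θ) = wsym N M θ := funext fun i => by rw [Pi.star_apply, star_wsym]
  have e : Wop N M θ * (mulOp N M (star (uCen N R M)) - 1)
      = ((mulOp N M (uCen N R M) - 1) * Wop N M θ)ᴴ := by
    rw [Matrix.conjTranspose_mul, Wop, conjTranspose_mulOp', hsw, Matrix.conjTranspose_sub,
      conjTranspose_mulOp', Matrix.conjTranspose_one]
  rw [e, Matrix.l2_opNorm_conjTranspose]
  exact opNorm_mulOp_uCen_sub_one_mul_Wop_theta_le N R M hN hR hθ0 hθ1

/-- **the `Q_R`-packaging law** (TorusW §9's abstract law, re-derived since it is private there): `J_R`-closeness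
`‖X′ − J_R X J_Rᴴ‖ ≤ r` and averaging-weight defects `≤ K` give `‖Q_R X′ Q_Rᴴ − R^{−d}X‖ ≤ R^{−d}(r + 2K)`. [folklore] -/
private theorem opNorm_Qavg_conj_sub_le' (hR : 1 ≤ R)
    (X' : Matrix (Tor (fine (R * N) M) × Fin d) (Tor (fine (R * N) M) × Fin d) ℂ)
    (X : Matrix (Tor (fine N M) × Fin d) (Tor (fine N M) × Fin d) ℂ) {r K : ℝ} (hr : 0 ≤ r) (hK : 0 ≤ K)
    (hrate : ‖X' - Jmat N R M * X * (Jmat N R M)ᴴ‖ ≤ r)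
    (h1 : ‖(mulOp N M (uCen N R M) - 1) * X‖ ≤ K) (h2 : ‖X * (mulOp N M (star (uCen N R M)) - 1)‖ ≤ K) :
    ‖Qavg N R M * X' * (Qavg N R M)ᴴ - ((R : ℂ) ^ d)⁻¹ • X‖ ≤ ((R : ℝ) ^ d)⁻¹ * (r + 2 * K) := by
  have hRd : (0 : ℝ) < (R : ℝ) ^ d := pow_pos (by exact_mod_cast Nat.pos_of_ne_zero (NeZero.ne R)) d
  have hcc : (Real.sqrt ((R : ℝ) ^ d))⁻¹ * (Real.sqrt ((R : ℝ) ^ d))⁻¹ = ((R : ℝ) ^ d)⁻¹ := by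
    rw [← mul_inv, Real.mul_self_sqrt hRd.le]
  have hc2 : ((((Real.sqrt ((R : ℝ) ^ d))⁻¹ : ℝ) : ℂ) * (((Real.sqrt ((R : ℝ) ^ d))⁻¹ : ℝ) : ℂ))
      = ((R : ℂ) ^ d)⁻¹ := by
    rw [← Complex.ofReal_mul, hcc]
    push_cast
    rfl
  have hQJ := Qavg_mul_Jmat N R M
  have hQJt : (Jmat N R M)ᴴ * (Qavg N R M)ᴴ
      = (((Real.sqrt ((R : ℝ) ^ d))⁻¹ : ℝ) : ℂ) • mulOp N M (star (uCen N R M)) := by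
    rw [← Matrix.conjTranspose_mul, hQJ, Matrix.conjTranspose_smul, conjTranspose_mulOp']
    congr 1
    exact Complex.conj_ofReal _
  have key : Qavg N R M * (Jmat N R M * X * (Jmat N R M)ᴴ) * (Qavg N R M)ᴴ
      = ((R : ℂ) ^ d)⁻¹ • (mulOp N M (uCen N R M) * X * mulOp N M (star (uCen N R M))) := by
    calc Qavg N R M * (Jmat N R M * X * (Jmat N R M)ᴴ) * (Qavg N R M)ᴴ
        = (Qavg N R M * Jmat N R M) * X * ((Jmat N R M)ᴴ * (Qavg N R M)ᴴ) := by
          simp only [Matrix.mul_assoc]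
      _ = ((R : ℂ) ^ d)⁻¹ • (mulOp N M (uCen N R M) * X * mulOp N M (star (uCen N R M))) := by
          rw [hQJ, hQJt, Matrix.smul_mul, Matrix.smul_mul, Matrix.mul_smul, smul_smul, hc2]
  have split : Qavg N R M * X' * (Qavg N R M)ᴴ - ((R : ℂ) ^ d)⁻¹ • X
      = Qavg N R M * (X' - Jmat N R M * X * (Jmat N R M)ᴴ) * (Qavg N R M)ᴴ
        + ((R : ℂ) ^ d)⁻¹ • ((mulOp N M (uCen N R M) - 1) * X * mulOp N M (star (uCen N R M))
          + X * (mulOp N M (star (uCen N R M)) - 1)) := by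
    rw [Matrix.mul_sub, Matrix.sub_mul, key, Matrix.sub_mul, Matrix.one_mul, Matrix.sub_mul, Matrix.mul_sub,
      Matrix.mul_one, sub_add_sub_cancel, smul_sub, sub_add_sub_cancel]
  rw [split]
  have hQ := opNorm_Qavg_le N R M
  have hQt : ‖(Qavg N R M)ᴴ‖ ≤ (Real.sqrt ((R : ℝ) ^ d))⁻¹ := by rw [Matrix.l2_opNorm_conjTranspose]; exact hQ
  have hc0 : 0 ≤ (Real.sqrt ((R : ℝ) ^ d))⁻¹ := inv_nonneg.mpr (Real.sqrt_nonneg _)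
  have hT1 : ‖Qavg N R M * (X' - Jmat N R M * X * (Jmat N R M)ᴴ) * (Qavg N R M)ᴴ‖ ≤ ((R : ℝ) ^ d)⁻¹ * r := by
    calc ‖Qavg N R M * (X' - Jmat N R M * X * (Jmat N R M)ᴴ) * (Qavg N R M)ᴴ‖
        ≤ ‖Qavg N R M‖ * ‖X' - Jmat N R M * X * (Jmat N R M)ᴴ‖ * ‖(Qavg N R M)ᴴ‖ :=
          (Matrix.l2_opNorm_mul _ _).trans (mul_le_mul_of_nonneg_right (Matrix.l2_opNorm_mul _ _)
            (norm_nonneg _))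
      _ ≤ (Real.sqrt ((R : ℝ) ^ d))⁻¹ * r * (Real.sqrt ((R : ℝ) ^ d))⁻¹ :=
          mul_le_mul (mul_le_mul hQ hrate (norm_nonneg _) hc0) hQt (norm_nonneg _) (mul_nonneg hc0 hr)
      _ = ((R : ℝ) ^ d)⁻¹ * r := by rw [mul_comm _ r, mul_assoc, hcc, mul_comm]
  have hT2 : ‖((R : ℂ) ^ d)⁻¹ • ((mulOp N M (uCen N R M) - 1) * X * mulOp N M (star (uCen N R M))
          + X * (mulOp N M (star (uCen N R M)) - 1))‖ ≤ ((R : ℝ) ^ d)⁻¹ * (2 * K) := by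
    rw [norm_smul, norm_inv, norm_pow, Complex.norm_natCast]
    refine mul_le_mul_of_nonneg_left ?_ (le_of_lt (inv_pos.mpr hRd))
    have h1' : ‖(mulOp N M (uCen N R M) - 1) * X * mulOp N M (star (uCen N R M))‖ ≤ K * 1 :=
      (Matrix.l2_opNorm_mul _ _).trans
        (mul_le_mul h1 (opNorm_mulOp_star_uCen_le' N R M hR) (norm_nonneg _) hK)
    calc _ ≤ _ := norm_add_le _ _
      _ ≤ K * 1 + K := add_le_add h1' h2
      _ = 2 * K := by ring
  calc _ ≤ _ := norm_add_le _ _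
    _ ≤ ((R : ℝ) ^ d)⁻¹ * r + ((R : ℝ) ^ d)⁻¹ * (2 * K) := add_le_add hT1 hT2
    _ = ((R : ℝ) ^ d)⁻¹ * (r + 2 * K) := by ring

omit [NeZero N] [NeZero R] hM in
/-- the constant of King's weighted item for real `θ` against `Q_R`: `CTW + 2·Cdefθ·Cst`. [folklore] -/
def CQWθ (d : ℕ) (a θ : ℝ) : ℝ := CTW d a + 2 * Cdefθ d θ * Cst d a

omit [NeZero N] [NeZero R] hM in
/-- `0 ≤ CQWθ`. [folklore] -/
private theorem CQWθ_nonneg (d : ℕ) (a θ : ℝ) : 0 ≤ CQWθ d a θ := by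
  have h1 := (CTW_pos d a).le
  have h2 := Cst_nonneg d a
  have h3 := Cdefθ_nonneg d θ
  unfold CQWθ
  positivity

/-- **KING'S WEIGHTED ORDER-TWO ITEM FOR REAL `θ ∈ [0,1]` AGAINST HIS BLOCK AVERAGING `Q_R`, AT THE SOFT RATE `η^θ`** —
for every finite unit torus, `N, R ≥ 1`, `a > 0`, `0 ≤ θ ≤ 1`, `ν, ν′`:
`‖Q_R (𝒲_θ′ ∇_ν′ 𝒢′ ∇_{ν′}′^* 𝒲_θ′) Q_Rᴴ − R^{−d} 𝒲_θ ∇_ν 𝒢 ∇_{ν′}^* 𝒲_θ‖ ≤ R^{−d}·CQWθ(d,a,θ)·η^θ` (primes = spacing `η/R`):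
the `J_R`-law `opNorm_weightedItem_rate` (rate `η^{min(2θ,1)} ≤ η^θ`) plus the `θ`-weighted averaging defect
`‖(mulOp(u_R) − 1)𝒲_θ‖ ≤ Cdefθ·η^θ` against b05's fourth uniform bound `‖∇𝒢∇*‖ ≤ Cst` and `‖𝒲_θ‖ ≤ 1`.  The EXPONENT `θ`
IS THE SOFT ONE: the conjectured exponent `min(2θ,1)` of the `Q_R`-law (true for the `J_R`-law) is NOT claimed; at
`θ = 0` the statement is a triviality (no rate — and none holds: `B5G183RateTorus`/TorusW §4), at `θ = 1` it is TorusW's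
`opNorm_Qavg_weightedItem_rate_one` with a worse constant.  King (4.19)–(4.23) p.672: ONE alias factor `u` on the
`Q*`-leg of the scalar kernel; the symmetric placement `𝒲_θ(·)𝒲_θ`, the conjugation by `Q_R` and the
statement/constant are OURS. [cite: King1986, (2.10) p.653, (4.19)-(4.23) p.672; Balaban1984PropagatorsI, Prop. 1.1
(1.89) p.33] [folklore] -/
theorem opNorm_Qavg_weightedItem_rate_theta (hN : 1 ≤ N) (hR : 1 ≤ R) (hRN : 1 ≤ R * N) (a : ℝ) (ha : 0 < a)
    {θ : ℝ} (hθ0 : 0 ≤ θ) (hθ1 : θ ≤ 1) (ν ν' : Fin d) :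
    ‖Qavg N R M
          * (Wop (R * N) M θ
              * (fdiff (fine (R * N) M) ((R * N : ℕ) : ℂ) ν * calG (R * N) hRN M a ha
                  * star (fdiff (fine (R * N) M) ((R * N : ℕ) : ℂ) ν'))
              * Wop (R * N) M θ)
          * (Qavg N R M)ᴴ
        - ((R : ℂ) ^ d)⁻¹
          • (Wop N M θ * (fdiff (fine N M) (N : ℂ) ν * calG N hN M a ha * star (fdiff (fine N M) (N : ℂ) ν'))
              * Wop N M θ)‖
      ≤ ((R : ℝ) ^ d)⁻¹ * CQWθ d a θ / (N : ℝ) ^ θ := by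
  have hNpos : (0 : ℝ) < N := by exact_mod_cast hN
  have hN1 : (1 : ℝ) ≤ N := by exact_mod_cast hN
  have hNθ : 0 < (N : ℝ) ^ θ := Real.rpow_pos_of_pos hNpos θ
  have hC := Cst_nonneg d a
  have hD := Cdefθ_nonneg d θ
  have hK0 : 0 ≤ Cdefθ d θ / (N : ℝ) ^ θ * Cst d a := by positivity
  set Y := fdiff (fine N M) (N : ℂ) ν * calG N hN M a ha * star (fdiff (fine N M) (N : ℂ) ν') with hY
  have hYb : ‖Y‖ ≤ Cst d a := opNorm_fdiff_calG_star_fdiff_le N hN M a ha ν ν'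
  have hW := opNorm_Wop_le_one N M hθ0
  have h1 : ‖(mulOp N M (uCen N R M) - 1) * (Wop N M θ * Y * Wop N M θ)‖ ≤ Cdefθ d θ / (N : ℝ) ^ θ * Cst d a := by
    rw [show (mulOp N M (uCen N R M) - 1) * (Wop N M θ * Y * Wop N M θ)
        = (mulOp N M (uCen N R M) - 1) * Wop N M θ * Y * Wop N M θ by simp only [Matrix.mul_assoc]]
    calc ‖(mulOp N M (uCen N R M) - 1) * Wop N M θ * Y * Wop N M θ‖
        ≤ ‖(mulOp N M (uCen N R M) - 1) * Wop N M θ‖ * ‖Y‖ * ‖Wop N M θ‖ :=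
          (Matrix.l2_opNorm_mul _ _).trans
            (mul_le_mul_of_nonneg_right (Matrix.l2_opNorm_mul _ _) (norm_nonneg _))
      _ ≤ Cdefθ d θ / (N : ℝ) ^ θ * Cst d a * 1 :=
          mul_le_mul (mul_le_mul (opNorm_mulOp_uCen_sub_one_mul_Wop_theta_le N R M hN hR hθ0 hθ1) hYb
            (norm_nonneg _) (by positivity)) hW (norm_nonneg _) hK0
      _ = Cdefθ d θ / (N : ℝ) ^ θ * Cst d a := mul_one _
  have h2 : ‖Wop N M θ * Y * Wop N M θ * (mulOp N M (star (uCen N R M)) - 1)‖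
      ≤ Cdefθ d θ / (N : ℝ) ^ θ * Cst d a := by
    rw [Matrix.mul_assoc]
    calc ‖Wop N M θ * Y * (Wop N M θ * (mulOp N M (star (uCen N R M)) - 1))‖
        ≤ ‖Wop N M θ‖ * ‖Y‖ * ‖Wop N M θ * (mulOp N M (star (uCen N R M)) - 1)‖ :=
          (Matrix.l2_opNorm_mul _ _).trans
            (mul_le_mul_of_nonneg_right (Matrix.l2_opNorm_mul _ _) (norm_nonneg _))
      _ ≤ 1 * Cst d a * (Cdefθ d θ / (N : ℝ) ^ θ) :=
          mul_le_mul (mul_le_mul hW hYb (norm_nonneg _) zero_le_one)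
            (opNorm_Wop_theta_mul_mulOp_star_uCen_sub_one_le N R M hN hR hθ0 hθ1) (norm_nonneg _)
            (by positivity)
      _ = Cdefθ d θ / (N : ℝ) ^ θ * Cst d a := by ring
  have hmin : θ ≤ min (2 * θ) 1 := le_min (by linarith) hθ1
  have hr : ‖Wop (R * N) M θ
          * (fdiff (fine (R * N) M) ((R * N : ℕ) : ℂ) ν * calG (R * N) hRN M a ha
              * star (fdiff (fine (R * N) M) ((R * N : ℕ) : ℂ) ν'))
          * Wop (R * N) M θ
        - Jmat N R M * (Wop N M θ * Y * Wop N M θ) * (Jmat N R M)ᴴ‖ ≤ CTW d a / (N : ℝ) ^ θ := by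
    refine (opNorm_weightedItem_rate N R M hN hR hRN a ha hθ0 hθ1 ν ν').trans ?_
    exact div_le_div_of_nonneg_left (CTW_pos d a).le hNθ (Real.rpow_le_rpow_of_exponent_le hN1 hmin)
  refine (opNorm_Qavg_conj_sub_le' N R M hR _ _ (div_nonneg (CTW_pos d a).le hNθ.le) hK0 hr h1 h2).trans ?_
  have hNθ' : (N : ℝ) ^ θ ≠ 0 := hNθ.ne'
  rw [CQWθ]
  apply le_of_eq
  field_simp

end ThetaDefect

/-! ## §5 (v1.1) The tower with a GENERAL step bound, and the `θ`-weighted item's unit-lattice limit (rate `L^{−θk}`) -/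

section TowerGeom

variable (L : ℕ) [NeZero L] (M : Fin d → ℕ) [hM : ∀ μ, NeZero (M μ)]

/-- the tower core with an ARBITRARY step bound `e`: `‖Q_L X₁ Q_Lᴴ − L^{−d}X₀‖ ≤ L^{−d}·e ⇒
‖(LN)^d·(Q₀Q_L)X₁(Q₀Q_L)ᴴ − N^d·Q₀X₀Q₀ᴴ‖ ≤ e`. [cite: King1986, Lemma 4.5 (4.38) p.674 (scalar template); (2.10) p.653]
— statement ours. [folklore] -/
theorem opNorm_towerCore_le' {N : ℕ} [NeZero N] {ι : Type*} [Fintype ι] [DecidableEq ι]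
    (Q₀ : Matrix ι (Tor (fine N M) × Fin d) ℂ) (X₁ : TMat M (L * N)) (X₀ : TMat M N) {e : ℝ}
    (hQ : ‖Q₀‖ ^ 2 ≤ (((N : ℕ) : ℝ) ^ d)⁻¹)
    (hX : ‖Qavg N L M * X₁ * (Qavg N L M)ᴴ - ((L : ℂ) ^ d)⁻¹ • X₀‖ ≤ ((L : ℝ) ^ d)⁻¹ * e) :
    ‖(((L * N : ℕ) : ℂ) ^ d) • (Q₀ * Qavg N L M * X₁ * (Q₀ * Qavg N L M)ᴴ) - ((N : ℂ) ^ d) • (Q₀ * X₀ * Q₀ᴴ)‖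
      ≤ e := by
  have hNpos : (0 : ℝ) < N := by exact_mod_cast Nat.pos_of_ne_zero (NeZero.ne N)
  have hX' : ‖Qavg N L M * X₁ * (Qavg N L M)ᴴ - ((L : ℂ) ^ d)⁻¹ • X₀‖ ≤ ((L : ℝ) ^ d)⁻¹ * (e * N) / N := by
    rwa [mul_div_assoc, mul_div_cancel_right₀ _ hNpos.ne']
  have h := opNorm_towerCore_le L M Q₀ X₁ X₀ hQ hX'
  rwa [mul_div_cancel_right₀ _ hNpos.ne'] at h

/-- **`‖c_{k+1}(X) − c_k(X)‖ ≤ e_k`** from the one-step law at level `n_k` with bound `L^{−d}·e_k`. [cite: King1986, Lemma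
4.5 (4.38) p.674 (scalar template); (2.10) p.653] — statement ours. [folklore] -/
theorem opNorm_unitAvg_succ_sub_le' (X : (k : ℕ) → TMat M (lev L k)) (e : ℕ → ℝ) (k : ℕ)
    (hX : ‖Qavg (lev L k) L M * atSucc L M k (X (k + 1)) * (Qavg (lev L k) L M)ᴴ - ((L : ℂ) ^ d)⁻¹ • X k‖
      ≤ ((L : ℝ) ^ d)⁻¹ * e k) :
    ‖unitAvg L M X (k + 1) - unitAvg L M X k‖ ≤ e k :=
  opNorm_towerCore_le' L M (Qtow L M k) (atSucc L M k (X (k + 1))) (X k) (opNorm_Qtow_sq_le L M k) hX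

/-- **existence of the limit under a GEOMETRIC step law**: one-step bounds `L^{−d}·C·ρ^k` with `ρ < 1` give
`c_k(X) → c_∞` with `‖c_k − c_∞‖ ≤ C·ρ^k/(1 − ρ)`. [cite: King1986, Lemma 4.5 (4.38) p.674 (scalar template)] — statement
ours. [folklore] -/
theorem unitAvg_tendsto_geom (X : (k : ℕ) → TMat M (lev L k)) {C ρ : ℝ} (hρ1 : ρ < 1)
    (hX : ∀ k, ‖Qavg (lev L k) L M * atSucc L M k (X (k + 1)) * (Qavg (lev L k) L M)ᴴ - ((L : ℂ) ^ d)⁻¹ • X k‖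
      ≤ ((L : ℝ) ^ d)⁻¹ * (C * ρ ^ k)) :
    ∃ Xlim : TMat M (lev L 0),
      Tendsto (unitAvg L M X) atTop (𝓝 Xlim) ∧
      ∀ k, ‖unitAvg L M X k - Xlim‖ ≤ C * ρ ^ k / (1 - ρ) := by
  have hu : ∀ k, dist (unitAvg L M X k) (unitAvg L M X (k + 1)) ≤ C * ρ ^ k := by
    intro k
    rw [dist_eq_norm, ← norm_neg, neg_sub]
    exact opNorm_unitAvg_succ_sub_le' L M X (fun k => C * ρ ^ k) k (hX k)
  have hcs := cauchySeq_of_le_geometric _ _ hρ1 hu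
  obtain ⟨Xlim, hlim⟩ := cauchySeq_tendsto_of_complete hcs
  refine ⟨Xlim, hlim, fun k => ?_⟩
  rw [← dist_eq_norm]
  exact dist_le_of_le_geometric_of_tendsto _ _ hρ1 hu hlim k

variable (a : ℝ) (ha : 0 < a)

/-- the unit-lattice image of King's weighted item `𝒲_θ∇_ν𝒢∇*_{ν′}𝒲_θ` for real `θ`. [folklore] -/
def unitAvgWθ (θ : ℝ) (ν ν' : Fin d) (k : ℕ) : TMat M (lev L 0) :=
  unitAvg L M (fun k => Wop (lev L k) M θ *
    (fdiff (fine (lev L k) M) ((lev L k : ℕ) : ℂ) ν * calG (lev L k) (one_le_lev L k) M a ha *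
      star (fdiff (fine (lev L k) M) ((lev L k : ℕ) : ℂ) ν')) * Wop (lev L k) M θ) k

omit [NeZero L] in
/-- `n_k^θ = (L^θ)^k`. [folklore] -/
private theorem rpow_lev (θ : ℝ) (k : ℕ) : ((lev L k : ℕ) : ℝ) ^ θ = ((L : ℝ) ^ θ) ^ k := by
  have hL0 : (0 : ℝ) ≤ L := Nat.cast_nonneg L
  rw [cast_lev, ← Real.rpow_natCast ((L : ℝ) ^ θ) k, ← Real.rpow_mul hL0, ← Real.rpow_natCast (L : ℝ) k,
    ← Real.rpow_mul hL0, mul_comm]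

/-- **The unit-lattice limit of King's weighted item for `0 < θ ≤ 1` EXISTS (U = 1, finite torus, `L ≥ 2`), with rate
`L^{−θk}`**: `‖c_k − c_∞‖ ≤ CQWθ(d,a,θ)·(L^{−θ})^k/(1 − L^{−θ})`. [cite: King1986, Lemma 4.5 (4.38) p.674, (4.19)-(4.23)
p.672; Balaban1984PropagatorsI, Prop. 1.1 (1.89) p.33] — statement ours; the exponent `θ` is the soft one. [folklore] -/
theorem unitAvgWθ_tendsto (hL : 2 ≤ L) {θ : ℝ} (hθ0 : 0 < θ) (hθ1 : θ ≤ 1) (ν ν' : Fin d) :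
    ∃ Finf : TMat M (lev L 0),
      Tendsto (unitAvgWθ L M a ha θ ν ν') atTop (𝓝 Finf) ∧
      ∀ k, ‖unitAvgWθ L M a ha θ ν ν' k - Finf‖
        ≤ CQWθ d a θ * (((L : ℝ) ^ θ)⁻¹) ^ k / (1 - ((L : ℝ) ^ θ)⁻¹) := by
  have hL1 : 1 ≤ L := Nat.pos_of_ne_zero (NeZero.ne L)
  have hL1' : (1 : ℝ) < L := by exact_mod_cast (lt_of_lt_of_le one_lt_two hL : 1 < L)
  have hLθ : 1 < (L : ℝ) ^ θ := Real.one_lt_rpow hL1' hθ0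
  have hρ1 : ((L : ℝ) ^ θ)⁻¹ < 1 := inv_lt_one_of_one_lt₀ hLθ
  refine unitAvg_tendsto_geom L M _ hρ1 fun k => ?_
  have h := opNorm_Qavg_weightedItem_rate_theta (lev L k) L M (one_le_lev L k) hL1 (one_le_lev L (k + 1)) a ha
    hθ0.le hθ1 ν ν'
  have e : ((L : ℝ) ^ d)⁻¹ * (CQWθ d a θ * (((L : ℝ) ^ θ)⁻¹) ^ k)
      = ((L : ℝ) ^ d)⁻¹ * CQWθ d a θ / ((lev L k : ℕ) : ℝ) ^ θ := by
    rw [rpow_lev L θ k, inv_pow, mul_div_assoc, div_eq_mul_inv]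
  rw [e]
  exact h

end TowerGeom

/-! ## §6 (v1.2) The SHARP exponent `min(2θ,1)` for the `Q_R`-law of King's weighted item: the averaging defect
`(mulOp u_R − 1)·𝒲_θ∇_ν𝒢∇*_{ν′}𝒲_θ` is, after scaling by `η^{−min(2θ,1)}`, a `Wt`-ADMISSIBLE two-sided sandwich of
b05's fibre (1.83), hence uniformly bounded by Prop. 1.1's constant [folklore]

Mechanism (ours).  `(mulOp u_R − 1)·𝒲_θ(∇_ν𝒢∇*_{ν′})𝒲_θ = mulW((u_R − 1)W^θ∂_ν, W^θ∂_{ν′})` (b05's `mulW`).  On each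
coset `p = p′ + l` the pair of weights `w₁ = c(u_R − 1)W^θ∂_ν`, `w₂ = W^θ∂_{ν′}` with `c = η^{−γ}/Kθ`,
`γ = min(2θ,1)`, satisfies b05's admissibility `B5Prop11Bound.Fiber.Wt` (`|w_i(l)|, |w₁w₂(l)| ≤ Δ(p′+l)` off the
centre, `≤ max(1, Δ(p′))` at the centre): the PRODUCT condition is `c|u_R − 1|W^{2θ}|∂_ν||∂_{ν′}| ≤ Δ`, and
`|u_R − 1|W^{2θ} ≤ |u_R − 1|W^γ ≤ Cdefθ(d,γ)·η^γ` (§4's interpolation at the exponent `γ ≤ 1`, `W ≤ 1`); the single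
conditions only need `η^{−γ}|u_R − 1||∂_ν| ≤ (π/2)(Σ_μ|∂_μ|)|∂_ν| ≤ (π(d+1)/4)Δ`.  So the product of the two weights —
not each weight separately — carries the second power of `W`, which is exactly what b05's uniform bound
`opNorm_sandwich_G_le` (admissible PAIRS) can absorb; the soft multiplier bound of §4 cannot see this.
-/

section ThetaSharp

open Literature.MathematicalPhysics.QuantumFieldTheory.Balaban1983to89.B5G183RateO2Diag
open Literature.MathematicalPhysics.QuantumFieldTheory.Balaban1983to89.B5G183RateWTheta
open Literature.MathematicalPhysics.QuantumFieldTheory.Balaban1983to89.B5Prop11Leaves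

variable (N R : ℕ) [NeZero N] [NeZero R] (M : Fin d → ℕ) [hM : ∀ μ, NeZero (M μ)]

/-- scaling the left multiplier scales the sandwich. [folklore] -/
private theorem mulW_const_mul_left (hN : 1 ≤ N) (a : ℝ) (ha : 0 < a) (c : ℂ)
    (W₁ W₂ : Tor (fine N M) × Fin d → ℂ) :
    mulW N hN M a ha (fun i => c * W₁ i) W₂ = c • mulW N hN M a ha W₁ W₂ := by
  have hd : Matrix.diagonal (fun i => c * W₁ i) = c • Matrix.diagonal W₁ := by
    rw [← Matrix.diagonal_smul]
    rfl
  simp only [mulW, hd, Matrix.smul_mul, Matrix.mul_smul]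

/-- **b05's Plancherel packaging for GENERAL admissible pairs of weights** (the tree's `opNorm_mulW_le` only takes
integer derivative orders): if on every coset `p′ ≠ 0` the restricted weights are `Wt`-admissible for Bałaban's fibre
and on the coset `p′ = 0` they satisfy the corresponding product conditions, then `‖mulW W₁ W₂‖ ≤ Cst(d,a)`.
[cite: Balaban1984PropagatorsI, Prop. 1.1 (1.89) p.33 (kernel form with admissible multiplier pairs; packaging ours)]
[folklore] -/
theorem opNorm_mulW_le_of_wt (hN : 1 ≤ N) (a : ℝ) (ha : 0 < a)
    (W₁ W₂ : Tor (fine N M) × Fin d → ℂ) (w₁ w₂ : Tor M → (Fin d → Fin N) → ℂ)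
    (e₁ : ∀ I, W₁ ((blockEquiv N M).symm I) = w₁ I.2 I.1.1)
    (e₂ : ∀ I, W₂ ((blockEquiv N M).symm I) = w₂ I.2 I.1.1)
    (hoff : ∀ q l, l ≠ (fun _ => 0) →
      ‖w₁ q l‖ ≤ DeltaXir N 0 (shiftr N l (sOf M q)) ∧ ‖w₂ q l‖ ≤ DeltaXir N 0 (shiftr N l (sOf M q)) ∧
        ‖w₁ q l‖ * ‖w₂ q l‖ ≤ DeltaXir N 0 (shiftr N l (sOf M q)))
    (hcen : ∀ q,
      ‖w₁ q (fun _ => 0)‖ ≤ max 1 (DeltaXir N 0 (shiftr N (fun _ => 0) (sOf M q))) ∧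
        ‖w₂ q (fun _ => 0)‖ ≤ max 1 (DeltaXir N 0 (shiftr N (fun _ => 0) (sOf M q))) ∧
        ‖w₁ q (fun _ => 0)‖ * ‖w₂ q (fun _ => 0)‖ ≤ max 1 (DeltaXir N 0 (shiftr N (fun _ => 0) (sOf M q)))) :
    ‖mulW N hN M a ha W₁ W₂‖ ≤ Cst d a := by
  refine opNorm_le_of_blocks (dftV_mem_unitaryGroup (fine N M)) (blockEquiv N M) _ _
    (reindex_conj_mulW N hN M a ha W₁ W₂ w₁ w₂ e₁ e₂) (Cst_nonneg d a) fun q => ?_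
  by_cases hq : q = 0
  · subst hq
    rw [blocks, dif_pos rfl]
    have hs : ∀ μ : Fin d, |(0 : Fin d → ℝ) μ| ≤ Real.pi := fun μ => by simp [Real.pi_pos.le]
    refine (opNorm_sandwich_G₀_le (fun _ => (0 : Fin N)) ha _ (fun l hl => ?_) (w₁ 0) (w₂ 0) ?_ ?_).trans
      (le_max_right _ _)
    · linarith [DeltaXir_shift_ge_four N l hl 0 hs]
    · have h := (hcen 0).2.2
      rwa [sOf_zero, Delta_zero_zero, max_eq_left (zero_le_one : (0 : ℝ) ≤ 1)] at h
    · intro l hl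
      have h := (hoff 0 l hl).2.2
      rwa [sOf_zero] at h
  · rw [blocks, dif_neg hq]
    refine (B5Prop11Fiber.opNorm_sandwich_G_le N hN a ha (sOf M q) (abs_sOf_le M q) (sOf_ne_zero M hq)
      ?_).trans (le_max_left _ _)
    exact
      { left_le := fun l hl => (hoff q l hl).1
        right_le := fun l hl => (hoff q l hl).2.1
        prod_le := fun l hl => (hoff q l hl).2.2
        left_o := (hcen q).1
        right_o := (hcen q).2.1
        prod_o := (hcen q).2.2 }

/-- `0 ≤ t`, `t² ≤ T` give `t ≤ max(1, T)`. [folklore] -/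
private theorem le_max_one_of_sq_le {t T : ℝ} (ht : 0 ≤ t) (h : t ^ 2 ≤ T) : t ≤ max 1 T := by
  rcases le_or_gt t 1 with h1 | h1
  · exact h1.trans (le_max_left _ _)
  · have : t ≤ t ^ 2 := by nlinarith
    exact (this.trans h).trans (le_max_right _ _)

/-- OUR constant `Kθ(d,θ) = Cdefθ(d, min(2θ,1)) + π(d+1)/4`: the scale of the left weight. [folklore] -/
def Kθ (d : ℕ) (θ : ℝ) : ℝ := Cdefθ d (min (2 * θ) 1) + Real.pi * (d + 1) / 4

omit [NeZero N] [NeZero R] hM in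
/-- `Kθ > 0`. [folklore] -/
private theorem Kθ_pos (θ : ℝ) : 0 < Kθ d θ := by
  have := Cdefθ_nonneg d (min (2 * θ) 1)
  have : 0 < Real.pi * (d + 1) / 4 := by positivity
  rw [Kθ]
  linarith

/-- **the pointwise admissibility of the scaled pair** `(η^{−γ}Kθ^{−1}(u_R − 1)W^θ∂_ν, W^θ∂_{ν′})` on the coset
`(p′(q), l)`: `|w₁| ≤ Δ`, `|w₂|² ≤ Δ`, `|w₁||w₂| ≤ Δ` with `Δ = Δ(p′+l) = Σ_μ|∂_μ(p′+l)|²`. [folklore] -/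
private theorem sharpPair_pointwise (hN : 1 ≤ N) (hR : 1 ≤ R) {θ : ℝ} (hθ0 : 0 ≤ θ)
    (ν ν' : Fin d) (q : Tor M) (l : Fin d → Fin N) :
    let γ : ℝ := min (2 * θ) 1
    let w₁ : ℂ := (((N : ℝ) ^ γ / Kθ d θ : ℝ) : ℂ) *
      ((uSym R 0 (cen N l (sOf M q)) - 1) * wθdSym N θ l (sOf M q) ν)
    let w₂ : ℂ := wθdSym N θ l (sOf M q) ν'
    ‖w₁‖ ≤ DeltaXir N 0 (shiftr N l (sOf M q)) ∧ ‖w₂‖ ^ 2 ≤ DeltaXir N 0 (shiftr N l (sOf M q)) ∧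
      ‖w₁‖ * ‖w₂‖ ≤ DeltaXir N 0 (shiftr N l (sOf M q)) := by
  intro γ w₁ w₂
  have hNpos : (0 : ℝ) < N := by exact_mod_cast hN
  have hN1 : (1 : ℝ) ≤ N := by exact_mod_cast hN
  have hγ0 : 0 ≤ γ := le_min (by linarith) zero_le_one
  have hγ1 : γ ≤ 1 := min_le_right _ _
  have hγ2 : γ ≤ θ + θ := (min_le_left _ _).trans (by linarith)
  have hK := Kθ_pos (d := d) θ
  have hKC : Cdefθ d γ ≤ Kθ d θ := by
    have : 0 < Real.pi * (d + 1) / 4 := by positivity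
    show Cdefθ d (min (2 * θ) 1) ≤ Kθ d θ
    rw [Kθ]
    linarith
  have hKπ : Real.pi * (d + 1) / 4 ≤ Kθ d θ := by
    have := Cdefθ_nonneg d (min (2 * θ) 1)
    rw [Kθ]
    linarith
  set s := sOf M q with hs_def
  have hs : ∀ μ, |s μ| ≤ Real.pi := abs_sOf_le M q
  set P : Tor (fine N M) × Fin d := (blockEquiv N M).symm ((l, ν), q) with hP
  -- the symbols on the coset
  set W := Wc N l s with hW_def
  have hWb := Wc_nonneg_le_one (n := N) l hs
  have hW0 : 0 ≤ W := hWb.1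
  have hW1 : W ≤ 1 := hWb.2
  have hWθ0 : 0 ≤ W ^ θ := Real.rpow_nonneg hW0 θ
  have hWθ1 : W ^ θ ≤ 1 := Real.rpow_le_one hW0 hW1 hθ0
  set A := ‖dSym N l s ν‖ with hA
  set B := ‖dSym N l s ν'‖ with hB
  set S := ∑ μ, ‖dSym N l s μ‖ with hS
  set Δ := DeltaXir N 0 (shiftr N l s) with hΔ
  have hΔeq : Δ = ∑ μ, ‖dSym N l s μ‖ ^ 2 := Delta_eq N l s
  have hA0 : 0 ≤ A := norm_nonneg _
  have hB0 : 0 ≤ B := norm_nonneg _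
  have hS0 : 0 ≤ S := Finset.sum_nonneg fun μ _ => norm_nonneg _
  have hA2 : A ^ 2 ≤ Δ := by
    rw [hΔeq]
    exact Finset.single_le_sum (f := fun μ => ‖dSym N l s μ‖ ^ 2) (fun _ _ => sq_nonneg _) (Finset.mem_univ ν)
  have hB2 : B ^ 2 ≤ Δ := by
    rw [hΔeq]
    exact Finset.single_le_sum (f := fun μ => ‖dSym N l s μ‖ ^ 2) (fun _ _ => sq_nonneg _) (Finset.mem_univ ν')
  have hΔ0 : 0 ≤ Δ := (sq_nonneg _).trans hA2
  have hAB : A * B ≤ Δ := by nlinarith [two_mul_le_add_sq A B]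
  -- `S·A ≤ (Δ + d A²)/2 ≤ (d+1)Δ/2`
  have hSA : S * A ≤ (d + 1) * Δ / 2 := by
    have h1 : S * A ≤ ∑ μ, (‖dSym N l s μ‖ ^ 2 + A ^ 2) / 2 := by
      rw [hS, Finset.sum_mul]
      exact Finset.sum_le_sum fun μ _ => by nlinarith [two_mul_le_add_sq ‖dSym N l s μ‖ A]
    have h2 : ∑ μ, (‖dSym N l s μ‖ ^ 2 + A ^ 2) / 2 = (Δ + d * A ^ 2) / 2 := by
      rw [← Finset.sum_div, Finset.sum_add_distrib, Finset.sum_const, Finset.card_univ, Fintype.card_fin,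
        nsmul_eq_mul, hΔeq]
    rw [h2] at h1
    have h3 : (Δ + d * A ^ 2) / 2 ≤ (d + 1) * Δ / 2 := by
      have : (d : ℝ) * A ^ 2 ≤ d * Δ := mul_le_mul_of_nonneg_left hA2 (Nat.cast_nonneg d)
      linarith
    exact h1.trans h3
  -- the averaging weight: `|u_R − 1| ≤ (π/2)η Σ_μ |∂_μ|` and `|u_R − 1|·W^γ ≤ Cdefθ·η^γ`
  set u1 := ‖uSym R 0 (cen N l s) - 1‖ with hu1
  have hu10 : 0 ≤ u1 := norm_nonneg _
  have huP : uCen N R M P = uSym R 0 (cen N l s) := by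
    simp only [hP, uCen, Equiv.apply_symm_apply, hs_def]
  have hu : u1 ≤ Real.pi / (2 * N) * S := by
    have h := norm_uCen_sub_one_le N R M hN hR P
    rw [huP] at h
    refine h.trans (le_of_eq ?_)
    congr 1
    refine Finset.sum_congr rfl fun μ _ => ?_
    rw [hP, restrict_fsym]
  have huW : u1 * W ^ γ ≤ Cdefθ d γ / (N : ℝ) ^ γ := by
    have h := norm_uCen_sub_one_mul_wsym_le N R M hN hR hγ0 hγ1 P
    rw [norm_mul, huP, hP, wsym_restrict, Complex.norm_of_nonneg (Real.rpow_nonneg hW0 γ)] at h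
    exact h
  -- norms of the two weights
  have hc0 : 0 ≤ (N : ℝ) ^ γ / Kθ d θ := div_nonneg (Real.rpow_nonneg hNpos.le γ) hK.le
  have hw2 : ‖w₂‖ = W ^ θ * B := by
    show ‖wθdSym N θ l s ν'‖ = _
    rw [wθdSym, norm_mul, Complex.norm_of_nonneg hWθ0]
  have hw1 : ‖w₁‖ = (N : ℝ) ^ γ / Kθ d θ * (u1 * (W ^ θ * A)) := by
    show ‖(((N : ℝ) ^ γ / Kθ d θ : ℝ) : ℂ) * ((uSym R 0 (cen N l s) - 1) * wθdSym N θ l s ν)‖ = _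
    rw [norm_mul, Complex.norm_of_nonneg hc0, norm_mul, wθdSym, norm_mul, Complex.norm_of_nonneg hWθ0]
  have hw2B : ‖w₂‖ ≤ B := by
    rw [hw2]
    exact (mul_le_mul_of_nonneg_right hWθ1 hB0).trans (le_of_eq (one_mul B))
  -- (L) `|w₁| ≤ Δ`
  have hNγ : (N : ℝ) ^ γ ≤ N := by
    have := Real.rpow_le_rpow_of_exponent_le hN1 hγ1
    rwa [Real.rpow_one] at this
  have hNu : (N : ℝ) ^ γ * u1 ≤ Real.pi / 2 * S := by
    calc (N : ℝ) ^ γ * u1 ≤ N * u1 := mul_le_mul_of_nonneg_right hNγ hu10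
      _ ≤ N * (Real.pi / (2 * N) * S) := mul_le_mul_of_nonneg_left hu hNpos.le
      _ = Real.pi / 2 * S := by field_simp
  have hL : ‖w₁‖ ≤ Δ := by
    rw [hw1]
    have h1 : (N : ℝ) ^ γ / Kθ d θ * (u1 * (W ^ θ * A)) ≤ (N : ℝ) ^ γ / Kθ d θ * (u1 * A) := by
      refine mul_le_mul_of_nonneg_left (mul_le_mul_of_nonneg_left ?_ hu10) hc0
      exact (mul_le_mul_of_nonneg_right hWθ1 hA0).trans (le_of_eq (one_mul A))
    have h2 : (N : ℝ) ^ γ / Kθ d θ * (u1 * A) = ((N : ℝ) ^ γ * u1) * A / Kθ d θ := by ring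
    have h3 : ((N : ℝ) ^ γ * u1) * A / Kθ d θ ≤ (Real.pi / 2 * S) * A / Kθ d θ :=
      div_le_div_of_nonneg_right (mul_le_mul_of_nonneg_right hNu hA0) hK.le
    have h4 : (Real.pi / 2 * S) * A / Kθ d θ ≤ (Real.pi * (d + 1) / 4 * Δ) / Kθ d θ := by
      refine div_le_div_of_nonneg_right ?_ hK.le
      have := mul_le_mul_of_nonneg_left hSA (by positivity : (0 : ℝ) ≤ Real.pi / 2)
      calc Real.pi / 2 * S * A = Real.pi / 2 * (S * A) := by ring
        _ ≤ Real.pi / 2 * ((d + 1) * Δ / 2) := this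
        _ = Real.pi * (d + 1) / 4 * Δ := by ring
    have h5 : (Real.pi * (d + 1) / 4 * Δ) / Kθ d θ ≤ Δ := by
      rw [div_le_iff₀ hK]
      calc Real.pi * (d + 1) / 4 * Δ ≤ Kθ d θ * Δ := mul_le_mul_of_nonneg_right hKπ hΔ0
        _ = Δ * Kθ d θ := mul_comm _ _
    exact h1.trans (h2.le.trans (h3.trans (h4.trans h5)))
  -- (P) `|w₁||w₂| ≤ Δ`
  have hWW : W ^ θ * W ^ θ ≤ W ^ γ := by
    rw [← Real.rpow_add_of_nonneg hW0 hθ0 hθ0]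
    exact Real.rpow_le_rpow_of_exponent_ge' hW0 hW1 hγ0 hγ2
  have hP' : ‖w₁‖ * ‖w₂‖ ≤ Δ := by
    rw [hw1, hw2]
    have e : (N : ℝ) ^ γ / Kθ d θ * (u1 * (W ^ θ * A)) * (W ^ θ * B)
        = (N : ℝ) ^ γ / Kθ d θ * (u1 * (W ^ θ * W ^ θ)) * (A * B) := by ring
    rw [e]
    have h1 : u1 * (W ^ θ * W ^ θ) ≤ Cdefθ d γ / (N : ℝ) ^ γ :=
      (mul_le_mul_of_nonneg_left hWW hu10).trans huW
    have hNγpos : 0 < (N : ℝ) ^ γ := Real.rpow_pos_of_pos hNpos γ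
    have h2 : (N : ℝ) ^ γ / Kθ d θ * (u1 * (W ^ θ * W ^ θ)) ≤ (N : ℝ) ^ γ / Kθ d θ * (Cdefθ d γ / (N : ℝ) ^ γ) :=
      mul_le_mul_of_nonneg_left h1 hc0
    have h3 : (N : ℝ) ^ γ / Kθ d θ * (Cdefθ d γ / (N : ℝ) ^ γ) = Cdefθ d γ / Kθ d θ := by
      field_simp
    have h4 : Cdefθ d γ / Kθ d θ ≤ 1 := (div_le_one hK).mpr hKC
    have hAB0 : 0 ≤ A * B := mul_nonneg hA0 hB0
    calc (N : ℝ) ^ γ / Kθ d θ * (u1 * (W ^ θ * W ^ θ)) * (A * B)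
        ≤ Cdefθ d γ / Kθ d θ * (A * B) := by
          refine mul_le_mul_of_nonneg_right (h2.trans h3.le) hAB0
      _ ≤ 1 * (A * B) := mul_le_mul_of_nonneg_right h4 hAB0
      _ ≤ Δ := by rw [one_mul]; exact hAB
  refine ⟨hL, ?_, hP'⟩
  calc ‖w₂‖ ^ 2 ≤ B ^ 2 := pow_le_pow_left₀ (norm_nonneg _) hw2B 2
    _ ≤ Δ := hB2

/-- **the sharp defect bound**: `‖(mulOp u_R − 1)·𝒲_θ(∇_ν𝒢∇*_{ν′})𝒲_θ‖ ≤ Kθ(d,θ)·Cst(d,a)·η^{min(2θ,1)}`.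
[cite: Balaban1984PropagatorsI, Prop. 1.1 (1.89) p.33; King1986, (4.19)-(4.23) p.672] — statement and proof ours.
[folklore] -/
theorem opNorm_mulOp_uCen_sub_one_mul_weightedItem_le (hN : 1 ≤ N) (hR : 1 ≤ R) (a : ℝ) (ha : 0 < a)
    {θ : ℝ} (hθ0 : 0 ≤ θ) (ν ν' : Fin d) :
    ‖(mulOp N M (uCen N R M) - 1)
        * (Wop N M θ * (fdiff (fine N M) (N : ℂ) ν * calG N hN M a ha * star (fdiff (fine N M) (N : ℂ) ν'))
            * Wop N M θ)‖
      ≤ Kθ d θ * Cst d a / (N : ℝ) ^ (min (2 * θ) 1) := by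
  have hNpos : (0 : ℝ) < N := by exact_mod_cast hN
  set γ : ℝ := min (2 * θ) 1 with hγ
  have hK := Kθ_pos (d := d) θ
  have hNγpos : 0 < (N : ℝ) ^ γ := Real.rpow_pos_of_pos hNpos γ
  set c : ℝ := (N : ℝ) ^ γ / Kθ d θ with hc
  set κ : ℝ := Kθ d θ / (N : ℝ) ^ γ with hκ
  have hκ0 : 0 ≤ κ := div_nonneg hK.le hNγpos.le
  have hκc : (κ : ℂ) * (c : ℂ) = 1 := by
    rw [← Complex.ofReal_mul, hκ, hc, div_mul_div_comm, mul_comm (Kθ d θ), div_self (mul_ne_zero hNγpos.ne' hK.ne')]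
    simp
  -- the scaled left weight and the right weight, torus level
  set W₁ : Tor (fine N M) × Fin d → ℂ := fun i => (c : ℂ) *
    ((uCen N R M i - 1) * (wsym N M θ i * fsym (fine N M) (N : ℂ) ν i)) with hW₁
  set W₂ : Tor (fine N M) × Fin d → ℂ := fun i => wsym N M θ i * fsym (fine N M) (N : ℂ) ν' i with hW₂
  have hop : (mulOp N M (uCen N R M) - 1)
        * (Wop N M θ * (fdiff (fine N M) (N : ℂ) ν * calG N hN M a ha * star (fdiff (fine N M) (N : ℂ) ν'))
            * Wop N M θ)
      = (κ : ℂ) • mulW N hN M a ha W₁ W₂ := by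
    rw [weightedItem_eq_mulW, mulOp_sub_one', mulOp_mul_mulW, ← mulW_const_mul_left N M hN a ha (κ : ℂ)]
    congr 1
    funext i
    simp only [hW₁]
    calc (uCen N R M i - 1) * (wsym N M θ i * fsym (fine N M) (N : ℂ) ν i)
        = ((κ : ℂ) * (c : ℂ)) * ((uCen N R M i - 1) * (wsym N M θ i * fsym (fine N M) (N : ℂ) ν i)) := by
          rw [hκc, one_mul]
      _ = (κ : ℂ) * ((c : ℂ) * ((uCen N R M i - 1) * (wsym N M θ i * fsym (fine N M) (N : ℂ) ν i))) := by ring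
  rw [hop, norm_smul, Complex.norm_of_nonneg hκ0]
  have hmain : ‖mulW N hN M a ha W₁ W₂‖ ≤ Cst d a := by
    refine opNorm_mulW_le_of_wt N M hN a ha W₁ W₂
      (fun q l => (c : ℂ) * ((uSym R 0 (cen N l (sOf M q)) - 1) * wθdSym N θ l (sOf M q) ν))
      (fun q l => wθdSym N θ l (sOf M q) ν') (fun I => ?_) (fun I => wfsym_restrict N M θ ν' I)
      (fun q l hl => ?_) (fun q => ?_)
    · -- restriction of the left weight
      have hu : uCen N R M ((blockEquiv N M).symm I) = uSym R 0 (cen N I.1.1 (sOf M I.2)) := by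
        simp only [uCen, Equiv.apply_symm_apply]
      have hw : wsym N M θ ((blockEquiv N M).symm I) * fsym (fine N M) (N : ℂ) ν ((blockEquiv N M).symm I)
          = wθdSym N θ I.1.1 (sOf M I.2) ν := wfsym_restrict N M θ ν I
      simp only [hW₁, hu, hw]
    · -- off the centre: `Δ ≥ 4`
      have h := sharpPair_pointwise N R M hN hR hθ0 ν ν' q l
      have h4 : 4 ≤ DeltaXir N 0 (shiftr N l (sOf M q)) := DeltaXir_shift_ge_four N l hl _ (abs_sOf_le M q)
      refine ⟨h.1, ?_, h.2.2⟩
      have hw := le_max_one_of_sq_le (norm_nonneg _) h.2.1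
      rwa [max_eq_right (by linarith : (1 : ℝ) ≤ DeltaXir N 0 (shiftr N l (sOf M q)))] at hw
    · -- the centre `l = 0`
      have h := sharpPair_pointwise N R M hN hR hθ0 ν ν' q (fun _ => 0)
      exact ⟨h.1.trans (le_max_right _ _), le_max_one_of_sq_le (norm_nonneg _) h.2.1,
        h.2.2.trans (le_max_right _ _)⟩
  calc κ * ‖mulW N hN M a ha W₁ W₂‖ ≤ κ * Cst d a := mul_le_mul_of_nonneg_left hmain hκ0
    _ = Kθ d θ * Cst d a / (N : ℝ) ^ γ := by rw [hκ]; ring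

/-- the adjoint defect `‖𝒲_θ(∇_ν𝒢∇*_{ν′})𝒲_θ·(mulOp ū_R − 1)‖ ≤ Kθ·Cst·η^{min(2θ,1)}`. [folklore] -/
private theorem opNorm_weightedItem_mul_mulOp_star_uCen_sub_one_le (hN : 1 ≤ N) (hR : 1 ≤ R) (a : ℝ)
    (ha : 0 < a) {θ : ℝ} (hθ0 : 0 ≤ θ) (ν ν' : Fin d) :
    ‖Wop N M θ * (fdiff (fine N M) (N : ℂ) ν * calG N hN M a ha * star (fdiff (fine N M) (N : ℂ) ν'))
        * Wop N M θ * (mulOp N M (star (uCen N R M)) - 1)‖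
      ≤ Kθ d θ * Cst d a / (N : ℝ) ^ (min (2 * θ) 1) := by
  have hsw : star (wsym N M θ) = wsym N M θ := funext fun i => by rw [Pi.star_apply, star_wsym]
  have hWop : (Wop N M θ)ᴴ = Wop N M θ := by rw [Wop, conjTranspose_mulOp', hsw]
  have hG : (calG N hN M a ha)ᴴ = calG N hN M a ha := (calG_isHermitian N hN M a ha).eq
  have hY : (fdiff (fine N M) (N : ℂ) ν' * calG N hN M a ha * star (fdiff (fine N M) (N : ℂ) ν))ᴴ
      = fdiff (fine N M) (N : ℂ) ν * calG N hN M a ha * star (fdiff (fine N M) (N : ℂ) ν') := by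
    rw [Matrix.conjTranspose_mul, Matrix.conjTranspose_mul, Matrix.star_eq_conjTranspose,
      Matrix.star_eq_conjTranspose, Matrix.conjTranspose_conjTranspose, hG, Matrix.mul_assoc]
  have e : Wop N M θ * (fdiff (fine N M) (N : ℂ) ν * calG N hN M a ha * star (fdiff (fine N M) (N : ℂ) ν'))
        * Wop N M θ * (mulOp N M (star (uCen N R M)) - 1)
      = ((mulOp N M (uCen N R M) - 1)
          * (Wop N M θ * (fdiff (fine N M) (N : ℂ) ν' * calG N hN M a ha * star (fdiff (fine N M) (N : ℂ) ν))
              * Wop N M θ))ᴴ := by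
    rw [Matrix.conjTranspose_mul, Matrix.conjTranspose_mul, Matrix.conjTranspose_mul, hWop, hY,
      Matrix.conjTranspose_sub, conjTranspose_mulOp', Matrix.conjTranspose_one]
    simp only [Matrix.mul_assoc]
  rw [e, Matrix.l2_opNorm_conjTranspose]
  exact opNorm_mulOp_uCen_sub_one_mul_weightedItem_le N R M hN hR a ha hθ0 ν' ν

/-- OUR constant of the sharp `Q_R`-law: `CQWθS = CTW + 2·Kθ·Cst`. [folklore] -/
def CQWθS (d : ℕ) (a θ : ℝ) : ℝ := CTW d a + 2 * Kθ d θ * Cst d a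

/-- **King's weighted order-two item for real `θ ∈ [0,1]` against block averaging at the SHARP rate
`η^{min(2θ,1)}`** (U = 1, every finite unit torus, every `d`, `a > 0`, `R ≥ 1`):
`‖Q_R(𝒲_θ′∇′_ν𝒢′∇′*_{ν′}𝒲_θ′)Q_Rᴴ − R^{−d}𝒲_θ∇_ν𝒢∇*_{ν′}𝒲_θ‖ ≤ R^{−d}·CQWθS(d,a,θ)·η^{min(2θ,1)}` — the same exponent
as the `J_R`-law `B5G183RateTorusW.opNorm_weightedItem_rate`.  [cite: King1986, (2.10) p.653, (4.19)-(4.23) p.672,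
Lemma 4.3 (4.18) p.672; Balaban1984PropagatorsI, Prop. 1.1 (1.89) p.33] — statement, exponent and constant ours; King's
printed scalar rates are the template only. [folklore] -/
theorem opNorm_Qavg_weightedItem_rate_sharp (hN : 1 ≤ N) (hR : 1 ≤ R) (hRN : 1 ≤ R * N) (a : ℝ) (ha : 0 < a)
    {θ : ℝ} (hθ0 : 0 ≤ θ) (hθ1 : θ ≤ 1) (ν ν' : Fin d) :
    ‖Qavg N R M
          * (Wop (R * N) M θ
              * (fdiff (fine (R * N) M) ((R * N : ℕ) : ℂ) ν * calG (R * N) hRN M a ha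
                  * star (fdiff (fine (R * N) M) ((R * N : ℕ) : ℂ) ν'))
              * Wop (R * N) M θ)
          * (Qavg N R M)ᴴ
        - ((R : ℂ) ^ d)⁻¹
          • (Wop N M θ * (fdiff (fine N M) (N : ℂ) ν * calG N hN M a ha * star (fdiff (fine N M) (N : ℂ) ν'))
              * Wop N M θ)‖
      ≤ ((R : ℝ) ^ d)⁻¹ * CQWθS d a θ / (N : ℝ) ^ (min (2 * θ) 1) := by
  have hNpos : (0 : ℝ) < N := by exact_mod_cast hN
  set γ : ℝ := min (2 * θ) 1 with hγ
  have hNγ : 0 < (N : ℝ) ^ γ := Real.rpow_pos_of_pos hNpos γ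
  have hK := Kθ_pos (d := d) θ
  have hC := Cst_nonneg d a
  have hK0 : 0 ≤ Kθ d θ * Cst d a / (N : ℝ) ^ γ := by positivity
  have h1 := opNorm_mulOp_uCen_sub_one_mul_weightedItem_le N R M hN hR a ha hθ0 ν ν'
  have h2 := opNorm_weightedItem_mul_mulOp_star_uCen_sub_one_le N R M hN hR a ha hθ0 ν ν'
  have hr := opNorm_weightedItem_rate N R M hN hR hRN a ha hθ0 hθ1 ν ν'
  refine (opNorm_Qavg_conj_sub_le' N R M hR _ _ (div_nonneg (CTW_pos d a).le hNγ.le) hK0 hr h1 h2).trans ?_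
  have hNγ' : (N : ℝ) ^ γ ≠ 0 := hNγ.ne'
  rw [CQWθS]
  apply le_of_eq
  field_simp

end ThetaSharp

/-! ## §7 (v1.2) The unit-lattice limit of the `θ`-item at the sharp rate `L^{−min(2θ,1)k}` [folklore] -/

section TowerSharp

variable (L : ℕ) [NeZero L] (M : Fin d → ℕ) [hM : ∀ μ, NeZero (M μ)] (a : ℝ) (ha : 0 < a)

/-- **The unit-lattice limit of King's weighted item for `0 < θ ≤ 1` with the SHARP rate `L^{−min(2θ,1)k}`**
(U = 1, finite torus, `L ≥ 2`): `‖c_k − c_∞‖ ≤ CQWθS(d,a,θ)·(L^{−γ})^k/(1 − L^{−γ})`, `γ = min(2θ,1)`.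
[cite: King1986, Lemma 4.5 (4.38) p.674, (4.19)-(4.23) p.672; Balaban1984PropagatorsI, Prop. 1.1 (1.89) p.33] —
statement ours. [folklore] -/
theorem unitAvgWθ_tendsto_sharp (hL : 2 ≤ L) {θ : ℝ} (hθ0 : 0 < θ) (hθ1 : θ ≤ 1) (ν ν' : Fin d) :
    ∃ Finf : TMat M (lev L 0),
      Tendsto (unitAvgWθ L M a ha θ ν ν') atTop (𝓝 Finf) ∧
      ∀ k, ‖unitAvgWθ L M a ha θ ν ν' k - Finf‖
        ≤ CQWθS d a θ * (((L : ℝ) ^ (min (2 * θ) 1))⁻¹) ^ k / (1 - ((L : ℝ) ^ (min (2 * θ) 1))⁻¹) := by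
  have hL1 : 1 ≤ L := Nat.pos_of_ne_zero (NeZero.ne L)
  have hL1' : (1 : ℝ) < L := by exact_mod_cast (lt_of_lt_of_le one_lt_two hL : 1 < L)
  have hγ0 : 0 < min (2 * θ) 1 := lt_min (by linarith) one_pos
  have hLγ : 1 < (L : ℝ) ^ (min (2 * θ) 1) := Real.one_lt_rpow hL1' hγ0
  have hρ1 : ((L : ℝ) ^ (min (2 * θ) 1))⁻¹ < 1 := inv_lt_one_of_one_lt₀ hLγ
  refine unitAvg_tendsto_geom L M _ hρ1 fun k => ?_
  have h := opNorm_Qavg_weightedItem_rate_sharp (lev L k) L M (one_le_lev L k) hL1 (one_le_lev L (k + 1)) a ha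
    hθ0.le hθ1 ν ν'
  have e : ((L : ℝ) ^ d)⁻¹ * (CQWθS d a θ * (((L : ℝ) ^ (min (2 * θ) 1))⁻¹) ^ k)
      = ((L : ℝ) ^ d)⁻¹ * CQWθS d a θ / ((lev L k : ℕ) : ℝ) ^ (min (2 * θ) 1) := by
    rw [rpow_lev L (min (2 * θ) 1) k, inv_pow, mul_div_assoc, div_eq_mul_inv]
  rw [e]
  exact h

end TowerSharp

/-! ## §8 (v1.3) The one-sided King-weighted items `∇_ν∇_{ν′}𝒲₂𝒢`, `𝒢𝒲₂∇*_ν∇*_{ν′}` against `Q_R` at the full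
rate `η` [folklore]

The fifth and sixth items of (1.89) with King's weight `W²` on the pair of derivatives are ONE-SIDED multiplier
sandwiches `mulW (∂_ν·W²·∂_{ν′}) 1`, `mulW 1 (∂_ν·W²·∂_{ν′})` (`B5G183RateTorusW.oneSidedL_eq_mulW`,
`oneSidedR_eq_mulW`), `J_R`-close at rate `CT2·η` (`opNorm_oneSidedL_rate`, `opNorm_oneSidedR_rate`).  Their LEFT
averaging defects `(mulOp u_R − 1)·X` are again sandwiches admissible for §6's `opNorm_mulW_le_of_wt` after scaling
by `c = η^{−1}K₂^{−1}`, `K₂ = dπ²/2 + π(d+1)/2`: TYPE I `(c(u_R − 1)·∂_νW²∂_{ν′}, 1)` (fifth item) and TYPE II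
`(c(u_R − 1), ∂_νW²∂_{ν′})` (sixth item).  Pointwise on a coset: `|∂_ν|W²|∂_{ν′}| ≤ |∂_ν||∂_{ν′}| ≤ Δ`;
`c|u_R − 1| ≤ (π/(2K₂))Σ_μ|∂_μ| ≤ (πd/(2K₂))·max(1,Δ) ≤ max(1,Δ)` (`norm_uCen_sub_one_le`, `|∂_μ| ≤ max(1,|∂_μ|²)`);
`c|u_R − 1|·|∂_ν|W²|∂_{ν′}| ≤ c(|u_R − 1|W)|∂_ν||∂_{ν′}| ≤ (Cdefθ(d,1)/K₂)Δ ≤ Δ` (§4's `|u_R − 1|W ≤ Cdefθ(d,1)η`).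
The RIGHT defects are adjoints of left defects of the mirror item (`(∇_ν∇_{ν′}𝒲₂𝒢)ᴴ = 𝒢𝒲₂∇*_{ν′}∇*_ν`).  Result:
both one-sided items obey the `Q_R`-law at the FULL rate `η` with constant `CQ2 = CT2 + 2K₂·Cst` — so ALL SIX items
of (1.89) (King's weights on the order-two items) now have `Q_R`-laws and unit-lattice towers at `U = 1`.
Statements, constants and proofs OURS; Bałaban prints the uniform bounds, King the scalar template.
-/

section OneSidedAvg

open Literature.MathematicalPhysics.QuantumFieldTheory.Balaban1983to89.B5G183RateO2Diag
open Literature.MathematicalPhysics.QuantumFieldTheory.Balaban1983to89.B5G183RateO2Op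
open Literature.MathematicalPhysics.QuantumFieldTheory.Balaban1983to89.B5Prop11Leaves

variable (N R : ℕ) [NeZero N] [NeZero R] (M : Fin d → ℕ) [hM : ∀ μ, NeZero (M μ)]

/-- OUR constant `K₂(d) = dπ²/2 + π(d+1)/2`: the scale of the averaging weight in the one-sided defects. [folklore] -/
def K2 (d : ℕ) : ℝ := d * Real.pi ^ 2 / 2 + Real.pi * (d + 1) / 2

omit [NeZero N] [NeZero R] hM in
/-- `K₂ > 0`, `πd/2 ≤ K₂`, `Cdefθ(d,1) ≤ K₂`. [folklore] -/
private theorem K2_facts : 0 < K2 d ∧ Real.pi * d / 2 ≤ K2 d ∧ Cdefθ d 1 ≤ K2 d := by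
  have hπ := Real.pi_pos
  have h1 : Cdefθ d 1 = d * Real.pi ^ 2 / 2 := by
    rw [Cdefθ, sub_self, Real.rpow_zero, Real.rpow_one, one_mul]
  have h2 : (0 : ℝ) ≤ d * Real.pi ^ 2 / 2 := by positivity
  have h3 : (0 : ℝ) < Real.pi * (d + 1) / 2 := by positivity
  have h4 : Real.pi * d / 2 ≤ Real.pi * (d + 1) / 2 := by nlinarith
  refine ⟨?_, ?_, ?_⟩
  · rw [K2]; linarith
  · rw [K2]; linarith
  · rw [h1, K2]; linarith

/-- the symbol `∂_ν·W²·∂_{ν′}` restricts to the cosets as `dSym ν · wdSym ν′` (re-derived; private in TorusW).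
[folklore] -/
private theorem ddwsym_restrict' (ν ν' : Fin d) (I : ((Fin d → Fin N) × Fin d) × Tor M) :
    (fun i => fsym (fine N M) (N : ℂ) ν i * (wsym N M 2 i * fsym (fine N M) (N : ℂ) ν' i)) ((blockEquiv N M).symm I)
      = dSym N I.1.1 (sOf M I.2) ν * wdSym N I.1.1 (sOf M I.2) ν' := by
  show fsym (fine N M) (N : ℂ) ν ((blockEquiv N M).symm I)
      * (wsym N M 2 ((blockEquiv N M).symm I) * fsym (fine N M) (N : ℂ) ν' ((blockEquiv N M).symm I)) = _
  rw [wsym_restrict, restrict_fsym, restrict_fsym, wdSym, Real.rpow_two]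

/-- **pointwise admissibility for the one-sided defects** on the coset `(p′(q), l)`: with `c = N/K₂`,
`v = c(u_R − 1)`, `z = ∂_ν·W²·∂_{ν′}`: `|v| ≤ max(1,Δ)`, `|z| ≤ Δ`, `|v||z| ≤ Δ` (`Δ = Δ(p′+l) = Σ_μ|∂_μ(p′+l)|²`).
[folklore] -/
private theorem oneSidedPair_pointwise (hN : 1 ≤ N) (hR : 1 ≤ R) (ν ν' : Fin d) (q : Tor M) (l : Fin d → Fin N) :
    let v : ℂ := (((N : ℝ) / K2 d : ℝ) : ℂ) * (uSym R 0 (cen N l (sOf M q)) - 1)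
    let z : ℂ := dSym N l (sOf M q) ν * wdSym N l (sOf M q) ν'
    ‖v‖ ≤ max 1 (DeltaXir N 0 (shiftr N l (sOf M q))) ∧ ‖z‖ ≤ DeltaXir N 0 (shiftr N l (sOf M q)) ∧
      ‖v‖ * ‖z‖ ≤ DeltaXir N 0 (shiftr N l (sOf M q)) := by
  intro v z
  have hNpos : (0 : ℝ) < N := by exact_mod_cast hN
  have hN0 : (N : ℝ) ≠ 0 := hNpos.ne'
  obtain ⟨hK, hKπ, hKC⟩ := K2_facts (d := d)
  have hKne : K2 d ≠ 0 := hK.ne'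
  set s := sOf M q with hs_def
  have hs : ∀ μ, |s μ| ≤ Real.pi := abs_sOf_le M q
  set P : Tor (fine N M) × Fin d := (blockEquiv N M).symm ((l, ν), q) with hP
  set W := Wc N l s with hW_def
  have hWb := Wc_nonneg_le_one (n := N) l hs
  have hW0 : 0 ≤ W := hWb.1
  have hW1 : W ≤ 1 := hWb.2
  set A := ‖dSym N l s ν‖ with hA
  set B := ‖dSym N l s ν'‖ with hB
  set S := ∑ μ, ‖dSym N l s μ‖ with hS
  set Δ := DeltaXir N 0 (shiftr N l s) with hΔ
  have hΔeq : Δ = ∑ μ, ‖dSym N l s μ‖ ^ 2 := Delta_eq N l s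
  have hA0 : 0 ≤ A := norm_nonneg _
  have hB0 : 0 ≤ B := norm_nonneg _
  have hsq : ∀ μ, ‖dSym N l s μ‖ ^ 2 ≤ Δ := fun μ => by
    rw [hΔeq]
    exact Finset.single_le_sum (f := fun μ => ‖dSym N l s μ‖ ^ 2) (fun _ _ => sq_nonneg _) (Finset.mem_univ μ)
  have hΔ0 : 0 ≤ Δ := (sq_nonneg _).trans (hsq ν)
  have hAB : A * B ≤ Δ := by nlinarith [two_mul_le_add_sq A B, hsq ν, hsq ν']
  have hm0 : 0 ≤ max 1 Δ := zero_le_one.trans (le_max_left _ _)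
  -- `S ≤ d·max(1,Δ)`
  have hS1 : S ≤ d * max 1 Δ := by
    calc S ≤ ∑ _μ : Fin d, max 1 Δ :=
          Finset.sum_le_sum fun μ _ => le_max_one_of_sq_le (norm_nonneg _) (hsq μ)
      _ = d * max 1 Δ := by rw [Finset.sum_const, Finset.card_univ, Fintype.card_fin, nsmul_eq_mul]
  -- the averaging weight: `|u_R − 1| ≤ (π/2)ηΣ_μ|∂_μ|` and `|u_R − 1|·W ≤ Cdefθ(d,1)·η`
  set u1 := ‖uSym R 0 (cen N l s) - 1‖ with hu1
  have hu10 : 0 ≤ u1 := norm_nonneg _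
  have huP : uCen N R M P = uSym R 0 (cen N l s) := by
    simp only [hP, uCen, Equiv.apply_symm_apply, hs_def]
  have hu : u1 ≤ Real.pi / (2 * N) * S := by
    have h := norm_uCen_sub_one_le N R M hN hR P
    rw [huP] at h
    refine h.trans (le_of_eq ?_)
    congr 1
    refine Finset.sum_congr rfl fun μ _ => ?_
    rw [hP, restrict_fsym]
  have huW : u1 * W ≤ Cdefθ d 1 / N := by
    have h := norm_uCen_sub_one_mul_wsym_le N R M hN hR zero_le_one le_rfl P
    rw [norm_mul, huP, hP, wsym_restrict, Real.rpow_one, Real.rpow_one, Complex.norm_of_nonneg hW0] at h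
    exact h
  -- norms of `v` and `z`
  have hc0 : 0 ≤ (N : ℝ) / K2 d := div_nonneg hNpos.le hK.le
  have hv : ‖v‖ = (N : ℝ) / K2 d * u1 := by
    show ‖(((N : ℝ) / K2 d : ℝ) : ℂ) * (uSym R 0 (cen N l s) - 1)‖ = _
    rw [norm_mul, Complex.norm_of_nonneg hc0]
  have hz : ‖z‖ = A * (W ^ 2 * B) := by
    show ‖dSym N l s ν * wdSym N l s ν'‖ = _
    rw [norm_mul, wdSym, norm_mul, Complex.norm_of_nonneg (sq_nonneg W)]
  have hW2 : W ^ 2 ≤ W := by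
    calc W ^ 2 = W * W := sq W
      _ ≤ 1 * W := mul_le_mul_of_nonneg_right hW1 hW0
      _ = W := one_mul W
  have hzAB : ‖z‖ ≤ A * B := by
    rw [hz]
    refine mul_le_mul_of_nonneg_left ?_ hA0
    calc W ^ 2 * B ≤ 1 * B := mul_le_mul_of_nonneg_right (hW2.trans hW1) hB0
      _ = B := one_mul B
  -- (i) `|v| ≤ max(1,Δ)`
  have hvle : ‖v‖ ≤ max 1 Δ := by
    rw [hv]
    have e1 : (N : ℝ) / K2 d * (Real.pi / (2 * N) * S) = (Real.pi / 2) / K2 d * S := by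
      field_simp
    have e2 : (Real.pi / 2) / K2 d * (d * max 1 Δ) = (Real.pi * d / 2) / K2 d * max 1 Δ := by ring
    calc (N : ℝ) / K2 d * u1 ≤ (N : ℝ) / K2 d * (Real.pi / (2 * N) * S) := mul_le_mul_of_nonneg_left hu hc0
      _ = (Real.pi / 2) / K2 d * S := e1
      _ ≤ (Real.pi / 2) / K2 d * (d * max 1 Δ) := mul_le_mul_of_nonneg_left hS1 (by positivity)
      _ = (Real.pi * d / 2) / K2 d * max 1 Δ := e2
      _ ≤ 1 * max 1 Δ := mul_le_mul_of_nonneg_right ((div_le_one hK).mpr hKπ) hm0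
      _ = max 1 Δ := one_mul _
  -- (iii) `|v||z| ≤ Δ`
  have hvz : ‖v‖ * ‖z‖ ≤ Δ := by
    rw [hv, hz]
    have e : (N : ℝ) / K2 d * u1 * (A * (W ^ 2 * B)) = (N : ℝ) / K2 d * (u1 * W ^ 2) * (A * B) := by ring
    rw [e]
    have h1 : (N : ℝ) / K2 d * (u1 * W ^ 2) ≤ (N : ℝ) / K2 d * (Cdefθ d 1 / N) :=
      mul_le_mul_of_nonneg_left ((mul_le_mul_of_nonneg_left hW2 hu10).trans huW) hc0
    have h2 : (N : ℝ) / K2 d * (Cdefθ d 1 / N) = Cdefθ d 1 / K2 d := by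
      field_simp
    have h3 : Cdefθ d 1 / K2 d ≤ 1 := (div_le_one hK).mpr hKC
    have hAB0 : 0 ≤ A * B := mul_nonneg hA0 hB0
    calc (N : ℝ) / K2 d * (u1 * W ^ 2) * (A * B) ≤ Cdefθ d 1 / K2 d * (A * B) :=
          mul_le_mul_of_nonneg_right (h1.trans h2.le) hAB0
      _ ≤ 1 * (A * B) := mul_le_mul_of_nonneg_right h3 hAB0
      _ ≤ Δ := by rw [one_mul]; exact hAB
  exact ⟨hvle, hzAB.trans hAB, hvz⟩

/-- **the left averaging defect of the weighted fifth item**: `‖(mulOp u_R − 1)·∇_ν∇_{ν′}𝒲₂𝒢‖ ≤ K₂·Cst(d,a)·η`.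
[cite: Balaban1984PropagatorsI, Prop. 1.1 (1.89) p.33; King1986, (4.19)-(4.20), (4.23) p.672] — statement and proof
ours. [folklore] -/
theorem opNorm_mulOp_uCen_sub_one_mul_oneSidedL_le (hN : 1 ≤ N) (hR : 1 ≤ R) (a : ℝ) (ha : 0 < a)
    (ν ν' : Fin d) :
    ‖(mulOp N M (uCen N R M) - 1)
        * (fdiff (fine N M) (N : ℂ) ν * fdiff (fine N M) (N : ℂ) ν' * Wop N M 2 * calG N hN M a ha)‖
      ≤ K2 d * Cst d a / N := by
  have hNpos : (0 : ℝ) < N := by exact_mod_cast hN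
  obtain ⟨hK, -, -⟩ := K2_facts (d := d)
  set c : ℝ := (N : ℝ) / K2 d with hc
  set κ : ℝ := K2 d / N with hκ
  have hκ0 : 0 ≤ κ := div_nonneg hK.le hNpos.le
  have hκc : (κ : ℂ) * (c : ℂ) = 1 := by
    rw [← Complex.ofReal_mul, hκ, hc, div_mul_div_comm, mul_comm (K2 d), div_self (mul_ne_zero hNpos.ne' hK.ne')]
    simp
  set W₁ : Tor (fine N M) × Fin d → ℂ := fun i => (c : ℂ) * ((uCen N R M i - 1)
    * (fsym (fine N M) (N : ℂ) ν i * (wsym N M 2 i * fsym (fine N M) (N : ℂ) ν' i))) with hW₁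
  have hop : (mulOp N M (uCen N R M) - 1)
        * (fdiff (fine N M) (N : ℂ) ν * fdiff (fine N M) (N : ℂ) ν' * Wop N M 2 * calG N hN M a ha)
      = (κ : ℂ) • mulW N hN M a ha W₁ (fun _ => (1 : ℂ)) := by
    rw [oneSidedL_eq_mulW, mulOp_sub_one', mulOp_mul_mulW, ← mulW_const_mul_left N M hN a ha (κ : ℂ)]
    congr 1
    funext i
    simp only [hW₁]
    calc (uCen N R M i - 1) * (fsym (fine N M) (N : ℂ) ν i * (wsym N M 2 i * fsym (fine N M) (N : ℂ) ν' i))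
        = ((κ : ℂ) * (c : ℂ)) * ((uCen N R M i - 1)
            * (fsym (fine N M) (N : ℂ) ν i * (wsym N M 2 i * fsym (fine N M) (N : ℂ) ν' i))) := by
          rw [hκc, one_mul]
      _ = (κ : ℂ) * ((c : ℂ) * ((uCen N R M i - 1)
            * (fsym (fine N M) (N : ℂ) ν i * (wsym N M 2 i * fsym (fine N M) (N : ℂ) ν' i)))) := by ring
  rw [hop, norm_smul, Complex.norm_of_nonneg hκ0]
  have hmain : ‖mulW N hN M a ha W₁ (fun _ => (1 : ℂ))‖ ≤ Cst d a := by
    refine opNorm_mulW_le_of_wt N M hN a ha W₁ _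
      (fun q l => (c : ℂ) * ((uSym R 0 (cen N l (sOf M q)) - 1)
        * (dSym N l (sOf M q) ν * wdSym N l (sOf M q) ν')))
      (fun _ _ => (1 : ℂ)) (fun I => ?_) (fun _ => rfl) (fun q l hl => ?_) (fun q => ?_)
    · -- restriction of the left weight
      have hu : uCen N R M ((blockEquiv N M).symm I) = uSym R 0 (cen N I.1.1 (sOf M I.2)) := by
        simp only [uCen, Equiv.apply_symm_apply]
      have hz : fsym (fine N M) (N : ℂ) ν ((blockEquiv N M).symm I)
            * (wsym N M 2 ((blockEquiv N M).symm I) * fsym (fine N M) (N : ℂ) ν' ((blockEquiv N M).symm I))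
          = dSym N I.1.1 (sOf M I.2) ν * wdSym N I.1.1 (sOf M I.2) ν' := ddwsym_restrict' N M ν ν' I
      simp only [hW₁, hu, hz]
    · -- off the centre: `Δ ≥ 4`
      have h := oneSidedPair_pointwise N R M hN hR ν ν' q l
      have h4 : 4 ≤ DeltaXir N 0 (shiftr N l (sOf M q)) := DeltaXir_shift_ge_four N l hl _ (abs_sOf_le M q)
      have e : ‖(c : ℂ) * ((uSym R 0 (cen N l (sOf M q)) - 1) * (dSym N l (sOf M q) ν * wdSym N l (sOf M q) ν'))‖
          = ‖(c : ℂ) * (uSym R 0 (cen N l (sOf M q)) - 1)‖ * ‖dSym N l (sOf M q) ν * wdSym N l (sOf M q) ν'‖ := by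
        simp only [norm_mul, mul_assoc]
      refine ⟨?_, ?_, ?_⟩
      · rw [e]; exact h.2.2
      · show ‖(1 : ℂ)‖ ≤ _
        rw [norm_one]; linarith
      · show _ * ‖(1 : ℂ)‖ ≤ _
        rw [norm_one, mul_one, e]; exact h.2.2
    · -- the centre `l = 0`
      have h := oneSidedPair_pointwise N R M hN hR ν ν' q (fun _ => 0)
      have e : ‖(c : ℂ) * ((uSym R 0 (cen N (fun _ => 0) (sOf M q)) - 1)
            * (dSym N (fun _ => 0) (sOf M q) ν * wdSym N (fun _ => 0) (sOf M q) ν'))‖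
          = ‖(c : ℂ) * (uSym R 0 (cen N (fun _ => 0) (sOf M q)) - 1)‖
            * ‖dSym N (fun _ => 0) (sOf M q) ν * wdSym N (fun _ => 0) (sOf M q) ν'‖ := by
        simp only [norm_mul, mul_assoc]
      refine ⟨?_, ?_, ?_⟩
      · rw [e]; exact h.2.2.trans (le_max_right _ _)
      · show ‖(1 : ℂ)‖ ≤ _
        rw [norm_one]; exact le_max_left _ _
      · show _ * ‖(1 : ℂ)‖ ≤ _
        rw [norm_one, mul_one, e]; exact h.2.2.trans (le_max_right _ _)
  calc κ * ‖mulW N hN M a ha W₁ (fun _ => (1 : ℂ))‖ ≤ κ * Cst d a := mul_le_mul_of_nonneg_left hmain hκ0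
    _ = K2 d * Cst d a / N := by rw [hκ]; ring

/-- **the left averaging defect of the weighted sixth item**: `‖(mulOp u_R − 1)·𝒢𝒲₂∇*_ν∇*_{ν′}‖ ≤ K₂·Cst(d,a)·η`.
[cite: Balaban1984PropagatorsI, Prop. 1.1 (1.89) p.33; King1986, (4.19)-(4.20), (4.23) p.672] — statement and proof
ours. [folklore] -/
theorem opNorm_mulOp_uCen_sub_one_mul_oneSidedR_le (hN : 1 ≤ N) (hR : 1 ≤ R) (a : ℝ) (ha : 0 < a)
    (ν ν' : Fin d) :
    ‖(mulOp N M (uCen N R M) - 1)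
        * (calG N hN M a ha * Wop N M 2 * star (fdiff (fine N M) (N : ℂ) ν)
            * star (fdiff (fine N M) (N : ℂ) ν'))‖
      ≤ K2 d * Cst d a / N := by
  have hNpos : (0 : ℝ) < N := by exact_mod_cast hN
  obtain ⟨hK, -, -⟩ := K2_facts (d := d)
  set c : ℝ := (N : ℝ) / K2 d with hc
  set κ : ℝ := K2 d / N with hκ
  have hκ0 : 0 ≤ κ := div_nonneg hK.le hNpos.le
  have hκc : (κ : ℂ) * (c : ℂ) = 1 := by
    rw [← Complex.ofReal_mul, hκ, hc, div_mul_div_comm, mul_comm (K2 d), div_self (mul_ne_zero hNpos.ne' hK.ne')]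
    simp
  set W₁ : Tor (fine N M) × Fin d → ℂ := fun i => (c : ℂ) * (uCen N R M i - 1) with hW₁
  have hop : (mulOp N M (uCen N R M) - 1)
        * (calG N hN M a ha * Wop N M 2 * star (fdiff (fine N M) (N : ℂ) ν)
            * star (fdiff (fine N M) (N : ℂ) ν'))
      = (κ : ℂ) • mulW N hN M a ha W₁
          (fun i => fsym (fine N M) (N : ℂ) ν i * (wsym N M 2 i * fsym (fine N M) (N : ℂ) ν' i)) := by
    rw [oneSidedR_eq_mulW, mulOp_sub_one', mulOp_mul_mulW, ← mulW_const_mul_left N M hN a ha (κ : ℂ)]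
    congr 1
    funext i
    simp only [hW₁]
    calc (uCen N R M i - 1) * (1 : ℂ) = ((κ : ℂ) * (c : ℂ)) * (uCen N R M i - 1) := by
          rw [hκc, one_mul, mul_one]
      _ = (κ : ℂ) * ((c : ℂ) * (uCen N R M i - 1)) := by ring
  rw [hop, norm_smul, Complex.norm_of_nonneg hκ0]
  have hmain : ‖mulW N hN M a ha W₁
      (fun i => fsym (fine N M) (N : ℂ) ν i * (wsym N M 2 i * fsym (fine N M) (N : ℂ) ν' i))‖ ≤ Cst d a := by
    refine opNorm_mulW_le_of_wt N M hN a ha W₁ _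
      (fun q l => (c : ℂ) * (uSym R 0 (cen N l (sOf M q)) - 1))
      (fun q l => dSym N l (sOf M q) ν * wdSym N l (sOf M q) ν') (fun I => ?_)
      (fun I => ddwsym_restrict' N M ν ν' I) (fun q l hl => ?_) (fun q => ?_)
    · have hu : uCen N R M ((blockEquiv N M).symm I) = uSym R 0 (cen N I.1.1 (sOf M I.2)) := by
        simp only [uCen, Equiv.apply_symm_apply]
      simp only [hW₁, hu]
    · have h := oneSidedPair_pointwise N R M hN hR ν ν' q l
      have h4 : 4 ≤ DeltaXir N 0 (shiftr N l (sOf M q)) := DeltaXir_shift_ge_four N l hl _ (abs_sOf_le M q)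
      have hm : max 1 (DeltaXir N 0 (shiftr N l (sOf M q))) = DeltaXir N 0 (shiftr N l (sOf M q)) :=
        max_eq_right (by linarith)
      have h1 := h.1
      rw [hm] at h1
      exact ⟨h1, h.2.1, h.2.2⟩
    · have h := oneSidedPair_pointwise N R M hN hR ν ν' q (fun _ => 0)
      exact ⟨h.1, h.2.1.trans (le_max_right _ _), h.2.2.trans (le_max_right _ _)⟩
  calc κ * ‖mulW N hN M a ha W₁
          (fun i => fsym (fine N M) (N : ℂ) ν i * (wsym N M 2 i * fsym (fine N M) (N : ℂ) ν' i))‖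
        ≤ κ * Cst d a := mul_le_mul_of_nonneg_left hmain hκ0
    _ = K2 d * Cst d a / N := by rw [hκ]; ring

/-- the right defect of the fifth item is the adjoint of the left defect of the mirror sixth item:
`‖∇_ν∇_{ν′}𝒲₂𝒢·(mulOp ū_R − 1)‖ ≤ K₂·Cst·η`. [folklore] -/
private theorem opNorm_oneSidedL_mul_mulOp_star_uCen_sub_one_le (hN : 1 ≤ N) (hR : 1 ≤ R) (a : ℝ) (ha : 0 < a)
    (ν ν' : Fin d) :
    ‖fdiff (fine N M) (N : ℂ) ν * fdiff (fine N M) (N : ℂ) ν' * Wop N M 2 * calG N hN M a ha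
        * (mulOp N M (star (uCen N R M)) - 1)‖ ≤ K2 d * Cst d a / N := by
  have hsw : star (wsym N M 2) = wsym N M 2 := funext fun i => by rw [Pi.star_apply, star_wsym]
  have hWop : (Wop N M 2)ᴴ = Wop N M 2 := by rw [Wop, conjTranspose_mulOp', hsw]
  have hG : (calG N hN M a ha)ᴴ = calG N hN M a ha := (calG_isHermitian N hN M a ha).eq
  have e : fdiff (fine N M) (N : ℂ) ν * fdiff (fine N M) (N : ℂ) ν' * Wop N M 2 * calG N hN M a ha
        * (mulOp N M (star (uCen N R M)) - 1)
      = ((mulOp N M (uCen N R M) - 1)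
          * (calG N hN M a ha * Wop N M 2 * star (fdiff (fine N M) (N : ℂ) ν')
              * star (fdiff (fine N M) (N : ℂ) ν)))ᴴ := by
    rw [Matrix.conjTranspose_mul, Matrix.conjTranspose_mul, Matrix.conjTranspose_mul, Matrix.conjTranspose_mul,
      Matrix.star_eq_conjTranspose, Matrix.star_eq_conjTranspose, Matrix.conjTranspose_conjTranspose,
      Matrix.conjTranspose_conjTranspose, hWop, hG, Matrix.conjTranspose_sub, conjTranspose_mulOp',
      Matrix.conjTranspose_one]
    simp only [Matrix.mul_assoc]
  rw [e, Matrix.l2_opNorm_conjTranspose]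
  exact opNorm_mulOp_uCen_sub_one_mul_oneSidedR_le N R M hN hR a ha ν' ν

/-- the right defect of the sixth item is the adjoint of the left defect of the mirror fifth item:
`‖𝒢𝒲₂∇*_ν∇*_{ν′}·(mulOp ū_R − 1)‖ ≤ K₂·Cst·η`. [folklore] -/
private theorem opNorm_oneSidedR_mul_mulOp_star_uCen_sub_one_le (hN : 1 ≤ N) (hR : 1 ≤ R) (a : ℝ) (ha : 0 < a)
    (ν ν' : Fin d) :
    ‖calG N hN M a ha * Wop N M 2 * star (fdiff (fine N M) (N : ℂ) ν) * star (fdiff (fine N M) (N : ℂ) ν')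
        * (mulOp N M (star (uCen N R M)) - 1)‖ ≤ K2 d * Cst d a / N := by
  have hsw : star (wsym N M 2) = wsym N M 2 := funext fun i => by rw [Pi.star_apply, star_wsym]
  have hWop : (Wop N M 2)ᴴ = Wop N M 2 := by rw [Wop, conjTranspose_mulOp', hsw]
  have hG : (calG N hN M a ha)ᴴ = calG N hN M a ha := (calG_isHermitian N hN M a ha).eq
  have e : calG N hN M a ha * Wop N M 2 * star (fdiff (fine N M) (N : ℂ) ν) * star (fdiff (fine N M) (N : ℂ) ν')
        * (mulOp N M (star (uCen N R M)) - 1)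
      = ((mulOp N M (uCen N R M) - 1)
          * (fdiff (fine N M) (N : ℂ) ν' * fdiff (fine N M) (N : ℂ) ν * Wop N M 2 * calG N hN M a ha))ᴴ := by
    rw [Matrix.conjTranspose_mul, Matrix.conjTranspose_mul, Matrix.conjTranspose_mul, Matrix.conjTranspose_mul,
      hWop, hG, Matrix.conjTranspose_sub, conjTranspose_mulOp', Matrix.conjTranspose_one,
      ← Matrix.star_eq_conjTranspose, ← Matrix.star_eq_conjTranspose]
    simp only [Matrix.mul_assoc]
  rw [e, Matrix.l2_opNorm_conjTranspose]
  exact opNorm_mulOp_uCen_sub_one_mul_oneSidedL_le N R M hN hR a ha ν' ν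

/-- OUR constant of the one-sided `Q_R`-laws: `CQ2 = CT2 + 2K₂·Cst`. [folklore] -/
def CQ2 (d : ℕ) (a : ℝ) : ℝ := CT2 d a + 2 * K2 d * Cst d a

/-- **The weighted fifth item `∇_ν∇_{ν′}𝒲₂𝒢` of (1.89) against block averaging at the FULL rate `η`** (U = 1, every
finite unit torus, every `d`, `a > 0`, `R ≥ 1`):
`‖Q_R(∇′_ν∇′_{ν′}𝒲₂′𝒢′)Q_Rᴴ − R^{−d}∇_ν∇_{ν′}𝒲₂𝒢‖ ≤ R^{−d}·CQ2(d,a)·η`.  [cite: King1986, (2.10) p.653, (4.19)-(4.20),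
(4.23) p.672; Balaban1984PropagatorsI, Prop. 1.1 (1.89) p.33] — statement, weight placement and constant ours.
[folklore] -/
theorem opNorm_Qavg_oneSidedL_rate (hN : 1 ≤ N) (hR : 1 ≤ R) (hRN : 1 ≤ R * N) (a : ℝ) (ha : 0 < a)
    (ν ν' : Fin d) :
    ‖Qavg N R M
          * (fdiff (fine (R * N) M) ((R * N : ℕ) : ℂ) ν * fdiff (fine (R * N) M) ((R * N : ℕ) : ℂ) ν'
              * Wop (R * N) M 2 * calG (R * N) hRN M a ha)
          * (Qavg N R M)ᴴ
        - ((R : ℂ) ^ d)⁻¹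
          • (fdiff (fine N M) (N : ℂ) ν * fdiff (fine N M) (N : ℂ) ν' * Wop N M 2 * calG N hN M a ha)‖
      ≤ ((R : ℝ) ^ d)⁻¹ * CQ2 d a / N := by
  have hNpos : (0 : ℝ) < N := by exact_mod_cast hN
  obtain ⟨hK, -, -⟩ := K2_facts (d := d)
  have hC := Cst_nonneg d a
  have hK0 : 0 ≤ K2 d * Cst d a / N := by positivity
  have hr := opNorm_oneSidedL_rate N R M hN hR hRN a ha ν ν'
  have hr0 : 0 ≤ CT2 d a / N := (norm_nonneg _).trans hr
  have h1 := opNorm_mulOp_uCen_sub_one_mul_oneSidedL_le N R M hN hR a ha ν ν'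
  have h2 := opNorm_oneSidedL_mul_mulOp_star_uCen_sub_one_le N R M hN hR a ha ν ν'
  refine (opNorm_Qavg_conj_sub_le' N R M hR _ _ hr0 hK0 hr h1 h2).trans (le_of_eq ?_)
  rw [CQ2]
  ring

/-- **The weighted sixth item `𝒢𝒲₂∇*_ν∇*_{ν′}` of (1.89) against block averaging at the FULL rate `η`**:
`‖Q_R(𝒢′𝒲₂′∇′*_ν∇′*_{ν′})Q_Rᴴ − R^{−d}𝒢𝒲₂∇*_ν∇*_{ν′}‖ ≤ R^{−d}·CQ2(d,a)·η`.  [cite: King1986, (2.10) p.653,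
(4.19)-(4.20), (4.23) p.672; Balaban1984PropagatorsI, Prop. 1.1 (1.89) p.33] — statement, weight placement and constant
ours. [folklore] -/
theorem opNorm_Qavg_oneSidedR_rate (hN : 1 ≤ N) (hR : 1 ≤ R) (hRN : 1 ≤ R * N) (a : ℝ) (ha : 0 < a)
    (ν ν' : Fin d) :
    ‖Qavg N R M
          * (calG (R * N) hRN M a ha * Wop (R * N) M 2 * star (fdiff (fine (R * N) M) ((R * N : ℕ) : ℂ) ν)
              * star (fdiff (fine (R * N) M) ((R * N : ℕ) : ℂ) ν'))
          * (Qavg N R M)ᴴ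
        - ((R : ℂ) ^ d)⁻¹
          • (calG N hN M a ha * Wop N M 2 * star (fdiff (fine N M) (N : ℂ) ν)
              * star (fdiff (fine N M) (N : ℂ) ν'))‖
      ≤ ((R : ℝ) ^ d)⁻¹ * CQ2 d a / N := by
  have hNpos : (0 : ℝ) < N := by exact_mod_cast hN
  obtain ⟨hK, -, -⟩ := K2_facts (d := d)
  have hC := Cst_nonneg d a
  have hK0 : 0 ≤ K2 d * Cst d a / N := by positivity
  have hr := opNorm_oneSidedR_rate N R M hN hR hRN a ha ν ν'
  have hr0 : 0 ≤ CT2 d a / N := (norm_nonneg _).trans hr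
  have h1 := opNorm_mulOp_uCen_sub_one_mul_oneSidedR_le N R M hN hR a ha ν ν'
  have h2 := opNorm_oneSidedR_mul_mulOp_star_uCen_sub_one_le N R M hN hR a ha ν ν'
  refine (opNorm_Qavg_conj_sub_le' N R M hR _ _ hr0 hK0 hr h1 h2).trans (le_of_eq ?_)
  rw [CQ2]
  ring

end OneSidedAvg

/-! ## §9 (v1.3) The unit-lattice limits of the one-sided items (rate `L^{−k}`) [folklore] -/

section TowerOneSided

variable (L : ℕ) [NeZero L] (M : Fin d → ℕ) [hM : ∀ μ, NeZero (M μ)] (a : ℝ) (ha : 0 < a)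

/-- the unit-lattice image of the weighted fifth item `∇_ν∇_{ν′}𝒲₂𝒢`. [folklore] -/
def unitAvgDDWG (ν ν' : Fin d) (k : ℕ) : TMat M (lev L 0) :=
  unitAvg L M (fun k => fdiff (fine (lev L k) M) ((lev L k : ℕ) : ℂ) ν * fdiff (fine (lev L k) M) ((lev L k : ℕ) : ℂ) ν'
    * Wop (lev L k) M 2 * calG (lev L k) (one_le_lev L k) M a ha) k

/-- the unit-lattice image of the weighted sixth item `𝒢𝒲₂∇*_ν∇*_{ν′}`. [folklore] -/
def unitAvgGWDD (ν ν' : Fin d) (k : ℕ) : TMat M (lev L 0) :=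
  unitAvg L M (fun k => calG (lev L k) (one_le_lev L k) M a ha * Wop (lev L k) M 2
    * star (fdiff (fine (lev L k) M) ((lev L k : ℕ) : ℂ) ν) * star (fdiff (fine (lev L k) M) ((lev L k : ℕ) : ℂ) ν')) k

/-- **Continuum limits of the two one-sided weighted items against block averaging (U = 1, `L ≥ 2`)**: the unit-lattice
images of `∇_ν∇_{ν′}𝒲₂𝒢` and `𝒢𝒲₂∇*_ν∇*_{ν′}` converge with geometric rate, `‖c_k − c_∞‖ ≤ CQ2(d,a)·L^{−k}/(1 − L^{−1})`.
With §3 this covers ALL SIX items of (1.89) (King's weights on the order-two items).  [cite: King1986, Lemma 4.5 (4.38)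
p.674, (4.19)-(4.20) p.672; Balaban1984PropagatorsI, Prop. 1.1 (1.89) p.33] — statement ours. [folklore] -/
theorem unitAvg_oneSided_tendsto (hL : 2 ≤ L) (ν ν' : Fin d) :
    (∃ F : TMat M (lev L 0), Tendsto (unitAvgDDWG L M a ha ν ν') atTop (𝓝 F) ∧
      ∀ k, ‖unitAvgDDWG L M a ha ν ν' k - F‖ ≤ CQ2 d a * ((L : ℝ)⁻¹) ^ k / (1 - (L : ℝ)⁻¹)) ∧
    (∃ F : TMat M (lev L 0), Tendsto (unitAvgGWDD L M a ha ν ν') atTop (𝓝 F) ∧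
      ∀ k, ‖unitAvgGWDD L M a ha ν ν' k - F‖ ≤ CQ2 d a * ((L : ℝ)⁻¹) ^ k / (1 - (L : ℝ)⁻¹)) := by
  have hL1 : 1 ≤ L := Nat.pos_of_ne_zero (NeZero.ne L)
  exact ⟨unitAvg_tendsto L M hL _ fun k =>
      opNorm_Qavg_oneSidedL_rate (lev L k) L M (one_le_lev L k) hL1 (one_le_lev L (k + 1)) a ha ν ν',
    unitAvg_tendsto L M hL _ fun k =>
      opNorm_Qavg_oneSidedR_rate (lev L k) L M (one_le_lev L k) hL1 (one_le_lev L (k + 1)) a ha ν ν'⟩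

end TowerOneSided

/-! ## §10 (v1.4) The composite `Qtow_k` IS King's block averaging over `L^k`-blocks — the semigroup property
of (2.10), entrywise [cite: King1986, (2.10) p.653] [folklore] -/

section KingQk

variable (L : ℕ) [NeZero L] (M : Fin d → ℕ) [hM : ∀ μ, NeZero (M μ)]

/-- the PARENT (coarse) site `⌊y/L⌋` (coordinatewise on representatives `0 ≤ y_ν < L·N·M_ν`) of a fine site `y` of
the `L·N`-lattice: a site of the `N`-lattice. [folklore] -/
def parSite (N : ℕ) [NeZero N] (y : Tor (fine (L * N) M)) : Tor (fine N M) :=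
  fun ν => (((y ν).val / L : ℕ) : ZMod (fine N M ν))

/-- the representative of the parent site is `⌊y_ν/L⌋`. [folklore] -/
private theorem val_parSite (N : ℕ) [NeZero N] (y : Tor (fine (L * N) M)) (ν : Fin d) :
    ((parSite L M N y) ν).val = (y ν).val / L := by
  have hL : 0 < L := Nat.pos_of_ne_zero (NeZero.ne L)
  have hy : (y ν).val < L * N * M ν := ZMod.val_lt (y ν)
  show (((y ν).val / L : ℕ) : ZMod (fine N M ν)).val = (y ν).val / L
  rw [ZMod.val_natCast, Nat.mod_eq_of_lt]
  show (y ν).val / L < N * M ν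
  rw [Nat.div_lt_iff_lt_mul hL]
  calc (y ν).val < L * N * M ν := hy
    _ = N * M ν * L := by ring

/-- ONE `L`-BLOCK STEP, entrywise: the fine site `y` lies in the block `{L·z + j : j ∈ {0,…,L−1}^d}` of the coarse
site `z` (King's block `B(z)` of (2.10), quoted in the docstring of `B5G183RateTorusW.Qavg`) iff `z` is the parent of
`y`, and then for exactly one offset `j`. [cite: King1986, (2.10) p.653] [folklore] -/
private theorem sum_ite_block (N : ℕ) [NeZero N] (z : Tor (fine N M) × Fin d) (y : Tor (fine (L * N) M) × Fin d) :
    (∑ j : Fin d → Fin L, if y = (cpt N L M z.1 + off N L M j, z.2) then (1 : ℂ) else 0)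
      = if (y.2 = z.2 ∧ parSite L M N y.1 = z.1) then 1 else 0 := by
  have hL : 0 < L := Nat.pos_of_ne_zero (NeZero.ne L)
  set j₀ : Fin d → Fin L := fun ν => ⟨(y.1 ν).val % L, Nat.mod_lt _ hL⟩ with hj₀
  have key : ∀ j : Fin d → Fin L,
      y = (cpt N L M z.1 + off N L M j, z.2) ↔ ((y.2 = z.2 ∧ parSite L M N y.1 = z.1) ∧ j = j₀) := by
    intro j
    constructor
    · intro h
      have h1 : y.1 = cpt N L M z.1 + off N L M j := by rw [h]
      have h2 : y.2 = z.2 := by rw [h]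
      have hval : ∀ ν, (y.1 ν).val = (j ν : ℕ) + L * (z.1 ν).val := by
        intro ν
        have hz : (z.1 ν).val < N * M ν := ZMod.val_lt (z.1 ν)
        have hj : (j ν : ℕ) < L := (j ν).isLt
        have hlt : (j ν : ℕ) + L * (z.1 ν).val < L * N * M ν :=
          calc (j ν : ℕ) + L * (z.1 ν).val < L + L * (z.1 ν).val := Nat.add_lt_add_right hj _
            _ = L * ((z.1 ν).val + 1) := by ring
            _ ≤ L * (N * M ν) := Nat.mul_le_mul_left _ hz
            _ = L * N * M ν := by ring
        have e : y.1 ν = (((j ν : ℕ) + L * (z.1 ν).val : ℕ) : ZMod (fine (L * N) M ν)) := by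
          rw [h1]
          simp only [Pi.add_apply, cpt, off, Nat.cast_add]
          ring
        rw [e, ZMod.val_natCast, Nat.mod_eq_of_lt hlt]
      refine ⟨⟨h2, funext fun ν => ?_⟩, funext fun ν => Fin.ext ?_⟩
      · show (((y.1 ν).val / L : ℕ) : ZMod (fine N M ν)) = z.1 ν
        rw [hval ν, Nat.add_mul_div_left _ _ hL, Nat.div_eq_of_lt (j ν).isLt, zero_add, ZMod.natCast_zmod_val]
      · show (j ν : ℕ) = (y.1 ν).val % L
        rw [hval ν, Nat.add_mul_mod_self_left, Nat.mod_eq_of_lt (j ν).isLt]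
    · rintro ⟨⟨h2, hp⟩, hj⟩
      refine Prod.ext (funext fun ν => ?_) h2
      have hv : (z.1 ν).val = (y.1 ν).val / L := by rw [← hp, val_parSite]
      simp only [Pi.add_apply, cpt, off, hj, hv]
      show y.1 ν = ((L * ((y.1 ν).val / L) : ℕ) : ZMod (fine (L * N) M ν)) + (((y.1 ν).val % L : ℕ) : ZMod _)
      rw [← Nat.cast_add, Nat.div_add_mod, ZMod.natCast_zmod_val]
  simp_rw [key]
  by_cases hc : (y.2 = z.2 ∧ parSite L M N y.1 = z.1)
  · simp [hc, Finset.sum_ite_eq']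
  · simp [hc]

/-- **The composite `Qtow_k` IS KING's block averaging over `L^k`-blocks** ((2.10) with `L^k` in place of `L`: the
average over the block `B^k(x₀) = {y : n_k x₀ ≤ y < n_k x₀ + n_k coordinatewise}`, `n_k = L^k`): ENTRYWISE,
`Qtow_k ((x₀, μ), (y, ν)) = n_k^{−d}·δ_{μν}·[⌊y_i/n_k⌋ = (x₀)_i for all i]` (sites by their representatives
`0 ≤ y_i < n_k M_i`, `0 ≤ (x₀)_i < M_i`).  This is the SEMIGROUP PROPERTY of (2.10) (`k` steps of `L`-block averaging
= one `L^k`-block averaging), proved by induction on `k`; it identifies every tower of §3/§5/§7/§9 with King's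
`Q_k X_k Q_k^*` on the unit lattice (`unitAvg_apply`). [cite: King1986, (2.10) p.653] [folklore] -/
theorem Qtow_apply (k : ℕ) (i : Tor (fine (lev L 0) M) × Fin d) (y : Tor (fine (lev L k) M) × Fin d) :
    Qtow L M k i y
      = if (y.2 = i.2 ∧ ∀ ν, (y.1 ν).val / lev L k = (i.1 ν).val) then ((((lev L k : ℕ) : ℂ)) ^ d)⁻¹ else 0 := by
  induction k with
  | zero =>
    change (1 : Matrix (Tor (fine (lev L 0) M) × Fin d) (Tor (fine (lev L 0) M) × Fin d) ℂ) i y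
      = if (y.2 = i.2 ∧ ∀ ν, (y.1 ν).val / 1 = (i.1 ν).val) then ((((1 : ℕ) : ℂ)) ^ d)⁻¹ else 0
    rw [Matrix.one_apply]
    simp only [Nat.div_one, Nat.cast_one, one_pow, inv_one]
    by_cases h : i = y
    · subst h
      simp
    · rw [if_neg h, if_neg]
      rintro ⟨h2, h1⟩
      exact h (Prod.ext (funext fun ν => ZMod.val_injective _ (h1 ν).symm) h2.symm)
  | succ k ih =>
    rw [Qtow_succ, Matrix.mul_apply]
    have hQ : ∀ z : Tor (fine (lev L k) M) × Fin d, Qavg (lev L k) L M z y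
        = ((L : ℂ) ^ d)⁻¹ * (if (y.2 = z.2 ∧ parSite L M (lev L k) y.1 = z.1) then 1 else 0) := by
      intro z
      simp only [Qavg]
      rw [sum_ite_block L M (lev L k) z y]
      try exact rfl
    simp_rw [hQ]
    rw [Finset.sum_eq_single (parSite L M (lev L k) y.1, y.2)]
    · rw [ih]
      dsimp only
      have hz0 : (y.2 = y.2 ∧ parSite L M (lev L k) y.1 = parSite L M (lev L k) y.1) := ⟨rfl, rfl⟩
      rw [if_pos hz0, mul_one]
      have hc : (∀ ν, ((parSite L M (lev L k) y.1) ν).val / lev L k = (i.1 ν).val)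
          ↔ (∀ ν, (y.1 ν).val / lev L (k + 1) = (i.1 ν).val) := by
        refine forall_congr' fun ν => ?_
        rw [val_parSite, Nat.div_div_eq_div_mul]
        exact Iff.rfl
      have hv : ((((lev L k : ℕ) : ℂ)) ^ d)⁻¹ * ((L : ℂ) ^ d)⁻¹ = ((((lev L (k + 1) : ℕ) : ℂ)) ^ d)⁻¹ := by
        rw [lev_succ, Nat.cast_mul, mul_pow, mul_inv, mul_comm]
      by_cases hA : (y.2 = i.2 ∧ ∀ ν, ((parSite L M (lev L k) y.1) ν).val / lev L k = (i.1 ν).val)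
      · have hB : (y.2 = i.2 ∧ ∀ ν, (y.1 ν).val / lev L (k + 1) = (i.1 ν).val) := ⟨hA.1, hc.mp hA.2⟩
        rw [if_pos hA, if_pos hB]
        exact hv
      · have hB : ¬ (y.2 = i.2 ∧ ∀ ν, (y.1 ν).val / lev L (k + 1) = (i.1 ν).val) :=
          fun h => hA ⟨h.1, hc.mpr h.2⟩
        rw [if_neg hA, if_neg hB, zero_mul]
    · intro z _ hz
      rw [if_neg, mul_zero, mul_zero]
      rintro ⟨h2, h1⟩
      exact hz (Prod.ext h1.symm h2.symm)
    · intro h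
      exact absurd (Finset.mem_univ _) h

/-- Corollary: the unit-lattice image `unitAvg X k = n_k^d·Qtow_k X_k Qtow_kᴴ` has the entries
`n_k^{−d} Σ_{y ∈ B^k(x₀) × {μ}, y′ ∈ B^k(x₀′) × {μ′}} X_k(y, y′)` — King's `Q_k X_k Q_k^*` for the `L^k`-block averaging
(2.10), i.e. the BLOCK MEANS of the kernel of `X_k`. [cite: King1986, (2.10) p.653] [folklore] -/
theorem unitAvg_apply (X : (k : ℕ) → TMat M (lev L k)) (k : ℕ) (i i' : Tor (fine (lev L 0) M) × Fin d) :
    unitAvg L M X k i i'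
      = ((((lev L k : ℕ) : ℂ)) ^ d)⁻¹ *
          ∑ y : Tor (fine (lev L k) M) × Fin d, ∑ y' : Tor (fine (lev L k) M) × Fin d,
            (if (y.2 = i.2 ∧ ∀ ν, (y.1 ν).val / lev L k = (i.1 ν).val) then (1 : ℂ) else 0) *
              X k y y' * (if (y'.2 = i'.2 ∧ ∀ ν, (y'.1 ν).val / lev L k = (i'.1 ν).val) then (1 : ℂ) else 0) := by
  have hn : (((lev L k : ℕ) : ℂ)) ^ d ≠ 0 :=
    pow_ne_zero _ (Nat.cast_ne_zero.mpr (NeZero.ne (lev L k)))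
  have hs : star (((((lev L k : ℕ) : ℂ)) ^ d)⁻¹) = ((((lev L k : ℕ) : ℂ)) ^ d)⁻¹ := by
    rw [Complex.star_def, map_inv₀, map_pow, map_natCast]
  rw [unitAvg, Matrix.smul_apply, smul_eq_mul, Matrix.mul_apply]
  simp_rw [Matrix.mul_apply, Matrix.conjTranspose_apply, Qtow_apply, Finset.sum_mul]
  rw [Finset.sum_comm, Finset.mul_sum, Finset.mul_sum]
  refine Finset.sum_congr rfl fun y _ => ?_
  rw [Finset.mul_sum, Finset.mul_sum]
  refine Finset.sum_congr rfl fun y' _ => ?_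
  by_cases hy : (y.2 = i.2 ∧ ∀ ν, (y.1 ν).val / lev L k = (i.1 ν).val)
  · by_cases hy' : (y'.2 = i'.2 ∧ ∀ ν, (y'.1 ν).val / lev L k = (i'.1 ν).val)
    · rw [if_pos hy, if_pos hy', if_pos hy, if_pos hy', hs, one_mul, mul_one, ← mul_assoc, ← mul_assoc,
        mul_inv_cancel₀ hn, one_mul]
      exact mul_comm _ _
    · rw [if_pos hy, if_neg hy', if_pos hy, if_neg hy']
      simp only [star_zero, mul_zero]
  · rw [if_neg hy, if_neg hy]
    simp only [zero_mul, mul_zero]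

end KingQk

/-! ## §11 (v1.4) King's Lemma 4.5 (4.38) SHAPE at two finite levels: `‖c_k − c_{k+n}‖ ≤ C·L^{−k}/(1 − L^{−1})`
[cite: King1986, Lemma 4.5 (4.38) p.674] [folklore] -/

section TwoLevels

variable (L : ℕ) [NeZero L] (M : Fin d → ℕ) [hM : ∀ μ, NeZero (M μ)]

/-- **King's (4.38) shape, abstract tower**: under the one-step `Q_L`-law with constant `C` at every level and `L ≥ 2`,
ANY TWO finite levels satisfy `‖unitAvg X k − unitAvg X (k+n)‖ ≤ C·L^{−k}/(1 − L^{−1})` (King's Lemma 4.5 (4.38) compares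
`C^{(k)}` with `C^{(k+n)}` at rate `L^{−k}`: scalar, entrywise with exponential decay; here operator norm, vector layer,
U = 1, no decay factor — statement and constant OURS). [cite: King1986, Lemma 4.5 (4.38) p.674; (2.10) p.653] [folklore] -/
theorem opNorm_unitAvg_sub_unitAvg_le (hL : 2 ≤ L) (X : (k : ℕ) → TMat M (lev L k)) {C : ℝ}
    (hX : ∀ k, ‖Qavg (lev L k) L M * atSucc L M k (X (k + 1)) * (Qavg (lev L k) L M)ᴴ - ((L : ℂ) ^ d)⁻¹ • X k‖
      ≤ ((L : ℝ) ^ d)⁻¹ * C / (lev L k : ℕ)) (k n : ℕ) :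
    ‖unitAvg L M X k - unitAvg L M X (k + n)‖ ≤ C * ((L : ℝ)⁻¹) ^ k / (1 - (L : ℝ)⁻¹) := by
  have hL1 : (1 : ℝ) < L := by exact_mod_cast (lt_of_lt_of_le one_lt_two hL : 1 < L)
  have hr : (L : ℝ)⁻¹ < 1 := inv_lt_one_of_one_lt₀ hL1
  have hr0 : 0 ≤ (L : ℝ)⁻¹ := inv_nonneg.mpr (Nat.cast_nonneg _)
  have hu : ∀ m, dist (unitAvg L M X m) (unitAvg L M X (m + 1)) ≤ C * ((L : ℝ)⁻¹) ^ m := by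
    intro m
    rw [dist_eq_norm, ← norm_neg, neg_sub, inv_pow, ← cast_lev, ← div_eq_mul_inv]
    exact opNorm_unitAvg_succ_sub_le L M X m (hX m)
  have hC : 0 ≤ C := by
    have h0 : (0 : ℝ) ≤ C * ((L : ℝ)⁻¹) ^ 0 := dist_nonneg.trans (hu 0)
    simpa using h0
  rw [← dist_eq_norm]
  calc dist (unitAvg L M X k) (unitAvg L M X (k + n))
      ≤ ∑ i ∈ Finset.Ico k (k + n), C * ((L : ℝ)⁻¹) ^ i :=
        dist_le_Ico_sum_of_dist_le (Nat.le_add_right k n) (fun {m} _ _ => hu m)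
    _ = C * ∑ i ∈ Finset.Ico k (k + n), ((L : ℝ)⁻¹) ^ i := by rw [Finset.mul_sum]
    _ ≤ C * (((L : ℝ)⁻¹) ^ k / (1 - (L : ℝ)⁻¹)) :=
        mul_le_mul_of_nonneg_left (geom_sum_Ico_le_of_lt_one hr0 hr) hC
    _ = C * ((L : ℝ)⁻¹) ^ k / (1 - (L : ℝ)⁻¹) := by ring

variable (a : ℝ) (ha : 0 < a)

/-- **(4.38) shape for the block-averaged free vector covariance at U = 1**: for any two levels `k`, `k + n`,
`‖c_k − c_{k+n}‖ ≤ CQ(d,a)·L^{−k}/(1 − L^{−1})` (`c_k = unitCov k` = King's `Q_k 𝒢^{(L^{−k})} Q_k^*` on the unit lattice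
by `Qtow_apply`). [cite: King1986, Lemma 4.5 (4.38) p.674; Balaban1984PropagatorsI, Prop. 1.1 (1.89) p.33] — statement,
currency and constant ours. [folklore] -/
theorem opNorm_unitCov_sub_unitCov_le (hL : 2 ≤ L) (k n : ℕ) :
    ‖unitCov L M a ha k - unitCov L M a ha (k + n)‖ ≤ CQ d a * ((L : ℝ)⁻¹) ^ k / (1 - (L : ℝ)⁻¹) := by
  have hL1 : 1 ≤ L := Nat.pos_of_ne_zero (NeZero.ne L)
  exact opNorm_unitAvg_sub_unitAvg_le L M hL (fun k => calG (lev L k) (one_le_lev L k) M a ha) (fun k =>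
    opNorm_Qavg_calG_rate (lev L k) L M (one_le_lev L k) hL1 (one_le_lev L (k + 1)) a ha) k n

/-- (4.38) shape for the five further items of (1.89) at U = 1 (first-order `∇𝒢`, `𝒢∇*` with `CQL`; King-weighted
`𝒲₁∇𝒢∇*𝒲₁` with `CQW`; one-sided `∇∇′𝒲₂𝒢`, `𝒢𝒲₂∇*∇′*` with `CQ2`): any two levels `k`, `k + n` differ by
`≤ C·L^{−k}/(1 − L^{−1})`. [cite: King1986, Lemma 4.5 (4.38) p.674, (4.19)-(4.20) p.672; Balaban1984PropagatorsI, Prop. 1.1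
(1.89) p.33] — statement, currency and constants ours. [folklore] -/
theorem opNorm_unitAvg_items_sub_le (hL : 2 ≤ L) (ν ν' : Fin d) (k n : ℕ) :
    ‖unitAvgDG L M a ha ν k - unitAvgDG L M a ha ν (k + n)‖ ≤ CQL d a * ((L : ℝ)⁻¹) ^ k / (1 - (L : ℝ)⁻¹) ∧
    ‖unitAvgGD L M a ha ν k - unitAvgGD L M a ha ν (k + n)‖ ≤ CQL d a * ((L : ℝ)⁻¹) ^ k / (1 - (L : ℝ)⁻¹) ∧
    ‖unitAvgWDGDW L M a ha ν ν' k - unitAvgWDGDW L M a ha ν ν' (k + n)‖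
      ≤ CQW d a * ((L : ℝ)⁻¹) ^ k / (1 - (L : ℝ)⁻¹) ∧
    ‖unitAvgDDWG L M a ha ν ν' k - unitAvgDDWG L M a ha ν ν' (k + n)‖
      ≤ CQ2 d a * ((L : ℝ)⁻¹) ^ k / (1 - (L : ℝ)⁻¹) ∧
    ‖unitAvgGWDD L M a ha ν ν' k - unitAvgGWDD L M a ha ν ν' (k + n)‖
      ≤ CQ2 d a * ((L : ℝ)⁻¹) ^ k / (1 - (L : ℝ)⁻¹) := by
  have hL1 : 1 ≤ L := Nat.pos_of_ne_zero (NeZero.ne L)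
  refine ⟨?_, ?_, ?_, ?_, ?_⟩
  · exact opNorm_unitAvg_sub_unitAvg_le L M hL
      (fun k => fdiff (fine (lev L k) M) ((lev L k : ℕ) : ℂ) ν * calG (lev L k) (one_le_lev L k) M a ha) (fun k =>
      opNorm_Qavg_fdiff_calG_rate (lev L k) L M (one_le_lev L k) hL1 (one_le_lev L (k + 1)) a ha ν) k n
  · exact opNorm_unitAvg_sub_unitAvg_le L M hL
      (fun k => calG (lev L k) (one_le_lev L k) M a ha * star (fdiff (fine (lev L k) M) ((lev L k : ℕ) : ℂ) ν)) (fun k =>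
      opNorm_Qavg_calG_star_fdiff_rate (lev L k) L M (one_le_lev L k) hL1 (one_le_lev L (k + 1)) a ha ν) k n
  · exact opNorm_unitAvg_sub_unitAvg_le L M hL
      (fun k => Wop (lev L k) M 1 *
        (fdiff (fine (lev L k) M) ((lev L k : ℕ) : ℂ) ν * calG (lev L k) (one_le_lev L k) M a ha *
          star (fdiff (fine (lev L k) M) ((lev L k : ℕ) : ℂ) ν')) * Wop (lev L k) M 1) (fun k =>
      opNorm_Qavg_weightedItem_rate_one (lev L k) L M (one_le_lev L k) hL1 (one_le_lev L (k + 1)) a ha ν ν') k n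
  · exact opNorm_unitAvg_sub_unitAvg_le L M hL
      (fun k => fdiff (fine (lev L k) M) ((lev L k : ℕ) : ℂ) ν * fdiff (fine (lev L k) M) ((lev L k : ℕ) : ℂ) ν'
        * Wop (lev L k) M 2 * calG (lev L k) (one_le_lev L k) M a ha) (fun k =>
      opNorm_Qavg_oneSidedL_rate (lev L k) L M (one_le_lev L k) hL1 (one_le_lev L (k + 1)) a ha ν ν') k n
  · exact opNorm_unitAvg_sub_unitAvg_le L M hL
      (fun k => calG (lev L k) (one_le_lev L k) M a ha * Wop (lev L k) M 2
        * star (fdiff (fine (lev L k) M) ((lev L k : ℕ) : ℂ) ν) * star (fdiff (fine (lev L k) M) ((lev L k : ℕ) : ℂ) ν')) (fun k =>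
      opNorm_Qavg_oneSidedR_rate (lev L k) L M (one_le_lev L k) hL1 (one_le_lev L (k + 1)) a ha ν ν') k n

end TwoLevels

/-! ## §12 Zero modes and positivity of the tower: `𝒢(J₀) = a^{−1}J₀` (1.82), `c_k(c) = a^{−1}c`, `a^{−1} ≤ ‖c_k‖ ≤ Cst`, `0 ≤ c_k` [folklore]

The `x`-constant vector fields `(x, μ) ↦ c_μ` are the zero-momentum modes; Bałaban's Landau-gauge block propagator at
`U = 1` multiplies them by `a^{−1}` («GJ = GJ′ + a^{−1}J₀. (1.82)», the `p′ = 0`, `l = 0` entry of (1.83)), King's block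
averaging (2.10) maps constants to constants and its adjoint spreads them (`Qtow_k Qtow_kᴴ = n_k^{−d}·1`), so every
`c_k = n_k^d Qtow_k 𝒢 Qtow_kᴴ` has the eigenvalue `a^{−1}` on them; with `0 ≤ 𝒢` (b05's `B5Prop11Lower.calG_posSemidef`)
every `c_k` is positive semidefinite.  Statements ours; finite-dimensional linear algebra on b05's typed objects. -/

section ZeroModes

open scoped ComplexOrder

variable (L : ℕ) [NeZero L] (M : Fin d → ℕ) [hM : ∀ μ, NeZero (M μ)] (a : ℝ) (ha : 0 < a)

/-- a positive semidefinite complex matrix scaled by a real `r ≥ 0` is positive semidefinite (Gram factor: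
`B5Prop11Lower.exists_gram`, `B5Prop11Lower.smul_gram_posSemidef`). [folklore] -/
private theorem posSemidef_real_smul {ι : Type*} [Fintype ι] [DecidableEq ι] {X : Matrix ι ι ℂ}
    (hX : X.PosSemidef) {r : ℝ} (hr : 0 ≤ r) : ((r : ℂ) • X).PosSemidef := by
  obtain ⟨B, hB⟩ := B5Prop11Lower.exists_gram hX
  rw [hB]
  exact B5Prop11Lower.smul_gram_posSemidef r hr B

/-- **`0 ≤ c_k`**: the unit-lattice block-averaged free covariance `c_k = n_k^d·Qtow_k 𝒢 Qtow_kᴴ` is positive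
semidefinite — a congruence of b05's `B5Prop11Lower.calG_posSemidef` («Δ_a is a positive operator … G = Δ_a^{−1}», p. 30).
[cite: Balaban1984PropagatorsI, p.30 ((1.71)-(1.73), Δ_a positive); King1986, (2.10) p.653] — statement ours. [folklore] -/
theorem unitCov_posSemidef (k : ℕ) : (unitCov L M a ha k).PosSemidef := by
  have h := (B5Prop11Lower.calG_posSemidef (lev L k) (one_le_lev L k) M a ha).mul_mul_conjTranspose_same
    (Qtow L M k)
  have h2 := posSemidef_real_smul h (show (0 : ℝ) ≤ ((lev L k : ℕ) : ℝ) ^ d by positivity)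
  have e : ((((lev L k : ℕ) : ℝ) ^ d : ℝ) : ℂ) = ((lev L k : ℕ) : ℂ) ^ d := by push_cast; rfl
  rw [e] at h2
  exact h2

/-- `c_k` is Hermitian. [cite: Balaban1984PropagatorsI, Prop. 1.1 p.33 («G is a symmetric operator»); King1986, (2.10) p.653] —
statement ours. [folklore] -/
theorem unitCov_isHermitian (k : ℕ) : (unitCov L M a ha k).IsHermitian :=
  (unitCov_posSemidef L M a ha k).isHermitian

/-- **`‖c_k‖ ≤ Cst(d,a)`** uniformly in `k`: `n_k^d‖Qtow_k‖² ≤ 1` and b05's `‖𝒢‖ ≤ Cst` (`opNorm_calG_le`, the typed (1.89)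
for the item `G`). [cite: Balaban1984PropagatorsI, Prop. 1.1 (1.89) p.33; King1986, (2.10) p.653] — statement ours. [folklore] -/
theorem opNorm_unitCov_le (k : ℕ) : ‖unitCov L M a ha k‖ ≤ Cst d a := by
  have hQ := opNorm_Qtow_sq_le L M k
  set G := calG (lev L k) (one_le_lev L k) M a ha with hGdef
  have hG : ‖G‖ ≤ Cst d a := opNorm_calG_le (lev L k) (one_le_lev L k) M a ha
  have hn : (0 : ℝ) < ((lev L k : ℕ) : ℝ) ^ d := by
    have h1 : (0 : ℝ) < ((lev L k : ℕ) : ℝ) := by exact_mod_cast (one_le_lev L k)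
    positivity
  show ‖(((lev L k : ℕ) : ℂ) ^ d) • (Qtow L M k * G * (Qtow L M k)ᴴ)‖ ≤ Cst d a
  rw [norm_smul, norm_pow, Complex.norm_natCast]
  calc ((lev L k : ℕ) : ℝ) ^ d * ‖Qtow L M k * G * (Qtow L M k)ᴴ‖
      ≤ ((lev L k : ℕ) : ℝ) ^ d * (‖Qtow L M k‖ * Cst d a * ‖Qtow L M k‖) := by
        refine mul_le_mul_of_nonneg_left ?_ (by positivity)
        calc ‖Qtow L M k * G * (Qtow L M k)ᴴ‖ ≤ ‖Qtow L M k * G‖ * ‖(Qtow L M k)ᴴ‖ := Matrix.l2_opNorm_mul _ _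
          _ ≤ ‖Qtow L M k‖ * ‖G‖ * ‖Qtow L M k‖ := by
              rw [Matrix.l2_opNorm_conjTranspose]
              exact mul_le_mul_of_nonneg_right (Matrix.l2_opNorm_mul _ _) (norm_nonneg _)
          _ ≤ ‖Qtow L M k‖ * Cst d a * ‖Qtow L M k‖ := by gcongr
    _ = (((lev L k : ℕ) : ℝ) ^ d * ‖Qtow L M k‖ ^ 2) * Cst d a := by ring
    _ ≤ 1 * Cst d a := by
        refine mul_le_mul_of_nonneg_right ?_ (Cst_nonneg d a)
        calc ((lev L k : ℕ) : ℝ) ^ d * ‖Qtow L M k‖ ^ 2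
            ≤ ((lev L k : ℕ) : ℝ) ^ d * ((((lev L k : ℕ) : ℝ) ^ d)⁻¹) := mul_le_mul_of_nonneg_left hQ hn.le
          _ = 1 := mul_inv_cancel₀ hn.ne'
    _ = Cst d a := one_mul _

/-- **`Qtow_k Qtow_kᴴ = n_k^{−d}·1`**: the `L^k`-blocks tile the level-`n_k` torus, so the rows of the block averaging
(2.10) are orthogonal with squared norm `n_k^{−d}` (from TorusW's one-step `Qavg_mul_conjTranspose`, by induction on `k`).
[cite: King1986, (2.10) p.653] — statement ours. [folklore] -/
theorem Qtow_mul_conjTranspose (k : ℕ) :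
    Qtow L M k * (Qtow L M k)ᴴ = ((((lev L k : ℕ) : ℂ)) ^ d)⁻¹ • (1 : TMat M (lev L 0)) := by
  induction k with
  | zero =>
    show (1 : TMat M (lev L 0)) * (1 : TMat M (lev L 0))ᴴ = ((((lev L 0 : ℕ) : ℂ)) ^ d)⁻¹ • (1 : TMat M (lev L 0))
    rw [Matrix.conjTranspose_one, Matrix.mul_one]
    have h0 : ((((lev L 0 : ℕ) : ℂ)) ^ d)⁻¹ = 1 := by
      show ((((1 : ℕ) : ℂ)) ^ d)⁻¹ = 1
      simp
    rw [h0, one_smul]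
  | succ k ih =>
    show Qtow L M k * Qavg (lev L k) L M * (Qtow L M k * Qavg (lev L k) L M)ᴴ
        = ((((L * lev L k : ℕ) : ℂ)) ^ d)⁻¹ • (1 : TMat M (lev L 0))
    rw [Matrix.conjTranspose_mul, Matrix.mul_assoc, ← Matrix.mul_assoc (Qavg (lev L k) L M),
      Qavg_mul_conjTranspose, Matrix.smul_mul, Matrix.one_mul, Matrix.mul_smul, ih, smul_smul, Nat.cast_mul, mul_pow,
      mul_inv]

/-- the adjoint block averaging spreads an `x`-constant unit-lattice vector field `(x₀, μ) ↦ c_μ` to the `x`-constant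
field `n_k^{−d}·c_μ` on the level-`n_k` lattice (every fine site has exactly one `L^k`-block parent, §10 `Qtow_apply`).
[cite: King1986, (2.10) p.653] — statement ours. [folklore] -/
theorem Qtow_conjTranspose_mulVec_const (k : ℕ) (c : Fin d → ℂ) :
    (Qtow L M k)ᴴ *ᵥ (fun i : Tor (fine (lev L 0) M) × Fin d => c i.2)
      = fun y : Tor (fine (lev L k) M) × Fin d => ((((lev L k : ℕ) : ℂ)) ^ d)⁻¹ * c y.2 := by
  have hn : 0 < lev L k := one_le_lev L k
  funext y
  set p₀ : Tor (fine (lev L 0) M) := fun ν => ((((y.1 ν).val / lev L k : ℕ)) : ZMod (fine (lev L 0) M ν)) with hp₀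
  have hval : ∀ ν, (p₀ ν).val = (y.1 ν).val / lev L k := by
    intro ν
    have hy : (y.1 ν).val < lev L k * M ν := ZMod.val_lt (y.1 ν)
    show ((((y.1 ν).val / lev L k : ℕ)) : ZMod (fine (lev L 0) M ν)).val = (y.1 ν).val / lev L k
    rw [ZMod.val_natCast, Nat.mod_eq_of_lt]
    show (y.1 ν).val / lev L k < lev L 0 * M ν
    rw [show lev L 0 = 1 from rfl, one_mul, Nat.div_lt_iff_lt_mul hn]
    rwa [mul_comm] at hy
  rw [Matrix.mulVec, dotProduct]
  simp_rw [Matrix.conjTranspose_apply, Qtow_apply]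
  rw [Finset.sum_eq_single (p₀, y.2)]
  · have hc : (y.2 = (p₀, y.2).2 ∧ ∀ ν, (y.1 ν).val / lev L k = ((p₀, y.2).1 ν).val) := ⟨rfl, fun ν => (hval ν).symm⟩
    rw [if_pos hc]
    simp
  · intro i _ hi
    have hc : ¬ (y.2 = i.2 ∧ ∀ ν, (y.1 ν).val / lev L k = (i.1 ν).val) := by
      rintro ⟨h2, h1⟩
      apply hi
      refine Prod.ext (funext fun ν => ZMod.val_injective _ ?_) h2.symm
      show (i.1 ν).val = (p₀ ν).val
      rw [hval ν, h1 ν]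
    rw [if_neg hc, star_zero, zero_mul]
  · intro h
    exact absurd (Finset.mem_univ _) h

/-- the componentwise unitary DFT of an `x`-constant vector field is supported on the zero momentum:
`(F c)(p, μ) = [p = 0]·√|T|·c_μ` (character orthogonality `sum_chi`). [cite: Balaban1984PropagatorsI, (1.29) p.23] —
statement ours (b05's unitary normalisation `dftV`). [folklore] -/
theorem dftV_mulVec_const (N : Fin d → ℕ) [∀ μ, NeZero (N μ)] (c : Fin d → ℂ) :
    dftV N *ᵥ (fun j : Tor N × Fin d => c j.2)
      = fun i => if i.1 = 0 then ((Real.sqrt (Fintype.card (Tor N)) : ℝ) : ℂ) * c i.2 else 0 := by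
  classical
  funext i
  rw [Matrix.mulVec, dotProduct, Fintype.sum_prod_type]
  simp_rw [show ∀ (x : Tor N) (μ' : Fin d), dftV N i (x, μ') = dftV N (i.1, i.2) (x, μ') from fun _ _ => rfl,
    dftV_apply]
  simp_rw [ite_mul, zero_mul, Finset.sum_ite_eq, Finset.mem_univ, if_true]
  simp only [dft]
  rw [← Finset.sum_mul, ← Finset.mul_sum, ← map_sum, sum_chi]
  have hcard : (0 : ℝ) < Fintype.card (Tor N) := by exact_mod_cast Fintype.card_pos
  by_cases hi : i.1 = 0
  · rw [if_pos hi, if_pos hi, map_natCast]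
    congr 1
    have e : ((Fintype.card (Tor N) : ℕ) : ℂ) = (((Real.sqrt (Fintype.card (Tor N)) * Real.sqrt (Fintype.card (Tor N)) : ℝ)) : ℂ) := by
      rw [Real.mul_self_sqrt hcard.le]; push_cast; rfl
    rw [e]; push_cast
    rw [inv_mul_cancel_left₀]
    exact_mod_cast (Real.sqrt_pos.mpr hcard).ne'
  · rw [if_neg hi, if_neg hi, map_zero, mul_zero, zero_mul]

variable {L M} in
/-- b05's coset parametrisation sends the zero momentum to (offset `l = 0`, coarse class `p′ = 0`). [folklore] -/
private theorem blockEquiv_zero (n : ℕ) [NeZero n] (μ : Fin d) :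
    B5Prop11Plancherel.blockEquiv n M ((0 : Tor (fine n M)), μ) = (((fun _ => (0 : Fin n)), μ), (0 : Tor M)) := by
  rw [Equiv.apply_eq_iff_eq_symm_apply, blockEquiv_symm_apply]
  refine Prod.ext (funext fun ν => ?_) rfl
  simp [B5Prop11Plancherel.emb]

/-- the zero-momentum COLUMN of `Ĝ`: `Ĝ(i, (0, μ′)) = [i = (0, μ′)]·a^{−1}` — at `p′ = 0`, `l = 0` b05's block is the
diagonal `G₀` with the entry `a^{−1}` («Ã_μ(0) = a^{−1}J̃_μ(0)», p. 31 after (1.83)).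
[cite: Balaban1984PropagatorsI, (1.83) p.31 (fibre p′ = 0)] — statement ours (b05's `blocks` / `B5Prop11Bound.G₀`). [folklore] -/
theorem calGhat_apply_zero (n : ℕ) [NeZero n] (hn : 1 ≤ n) (i : Tor (fine n M) × Fin d) (μ' : Fin d) :
    calGhat n hn M a ha i ((0 : Tor (fine n M)), μ') = if i = ((0 : Tor (fine n M)), μ') then ((a : ℂ))⁻¹ else 0 := by
  classical
  have key : calGhat n hn M a ha i ((0 : Tor (fine n M)), μ')
      = Matrix.blockDiagonal (blocks n hn M a ha) (B5Prop11Plancherel.blockEquiv n M i)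
          (B5Prop11Plancherel.blockEquiv n M ((0 : Tor (fine n M)), μ')) := by
    simp [calGhat, Matrix.reindex_apply, Matrix.submatrix_apply]
  rw [key, blockEquiv_zero, Matrix.blockDiagonal_apply]
  by_cases hi : i = ((0 : Tor (fine n M)), μ')
  · subst hi
    rw [blockEquiv_zero, if_pos rfl, if_pos rfl]
    simp only [blocks, dif_pos, G₀]
    rw [Matrix.diagonal_apply_eq, if_pos rfl, one_div]
  · rw [if_neg hi]
    have hne : B5Prop11Plancherel.blockEquiv n M i ≠ (((fun _ => (0 : Fin n)), μ'), (0 : Tor M)) := by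
      intro h
      apply hi
      rw [← blockEquiv_zero (M := M) n μ'] at h
      exact (B5Prop11Plancherel.blockEquiv n M).injective h
    by_cases h2 : (B5Prop11Plancherel.blockEquiv n M i).2 = (0 : Tor M)
    · rw [if_pos h2]
      simp only [blocks, h2, dif_pos, G₀]
      rw [Matrix.diagonal_apply_ne]
      intro h1
      apply hne
      exact Prod.ext h1 h2
    · rw [if_neg h2]

/-- **`𝒢(J₀) = a^{−1}J₀` for `x`-constant `J₀`** — Bałaban p. 31: «GJ = GJ′ + a^{−1}J₀. (1.82)» («J = J′ + J₀, J₀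
constant, J′ orthogonal to constant functions»), from p. 30: «a⟨1, Q*QA_μ⟩ = a⟨1, A_μ⟩ = ⟨1, J_μ⟩, (1.74) so ⟨1, A_μ⟩ =
a^{−1}⟨1, J_μ⟩»; in momentum space «Ã_μ(0) = a^{−1}J̃_μ(0)» (p. 31).  Typed for b05's `calG` at `U = 1`: Fourier
transform, the zero-momentum column of `Ĝ`, inverse transform. [cite: Balaban1984PropagatorsI, (1.82) p.31, (1.74) p.30] —
the matrix statement is ours. [folklore] -/
theorem calG_mulVec_const (n : ℕ) [NeZero n] (hn : 1 ≤ n) (c : Fin d → ℂ) :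
    calG n hn M a ha *ᵥ (fun j : Tor (fine n M) × Fin d => c j.2) = ((a : ℂ))⁻¹ • (fun j : Tor (fine n M) × Fin d => c j.2) := by
  classical
  set g : Tor (fine n M) × Fin d → ℂ := fun j => c j.2 with hg
  have h1 := dftV_mulVec_const (fine n M) c
  set s : ℂ := (((Real.sqrt (Fintype.card (Tor (fine n M))) : ℝ)) : ℂ) with hs
  have h2 : calGhat n hn M a ha *ᵥ (dftV (fine n M) *ᵥ g) = ((a : ℂ))⁻¹ • (dftV (fine n M) *ᵥ g) := by
    rw [hg, h1]
    funext i
    rw [Matrix.mulVec, dotProduct, Pi.smul_apply, smul_eq_mul, Fintype.sum_prod_type]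
    have inner : ∀ p : Tor (fine n M), (∑ μ' : Fin d, calGhat n hn M a ha i (p, μ') *
        (if ((p, μ') : Tor (fine n M) × Fin d).1 = 0 then s * c ((p, μ') : Tor (fine n M) × Fin d).2 else 0))
        = if p = 0 then ∑ μ' : Fin d, calGhat n hn M a ha i (0, μ') * (s * c μ') else 0 := by
      intro p
      by_cases hp : p = 0
      · subst hp; simp
      · simp [hp]
    simp_rw [inner]
    rw [Finset.sum_ite_eq', if_pos (Finset.mem_univ _)]
    simp_rw [calGhat_apply_zero, ite_mul, zero_mul]
    by_cases hi : i.1 = 0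
    · have : ∀ μ' : Fin d, (i = ((0 : Tor (fine n M)), μ')) ↔ (μ' = i.2) := by
        intro μ'
        constructor
        · intro h; rw [h]
        · intro h; rw [h]; exact Prod.ext hi rfl
      simp_rw [this]
      rw [Finset.sum_ite_eq' Finset.univ i.2, if_pos (Finset.mem_univ _), if_pos hi]
    · have : ∀ μ' : Fin d, ¬ (i = ((0 : Tor (fine n M)), μ')) := by
        intro μ' h; apply hi; rw [h]
      simp_rw [if_neg (this _)]
      rw [Finset.sum_const_zero, if_neg hi, mul_zero]
  calc calG n hn M a ha *ᵥ g
      = star (dftV (fine n M)) *ᵥ (calGhat n hn M a ha *ᵥ (dftV (fine n M) *ᵥ g)) := by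
        rw [calG, ← Matrix.mulVec_mulVec, ← Matrix.mulVec_mulVec]
    _ = ((a : ℂ))⁻¹ • ((star (dftV (fine n M)) * dftV (fine n M)) *ᵥ g) := by
        rw [h2, Matrix.mulVec_smul, Matrix.mulVec_mulVec]
    _ = ((a : ℂ))⁻¹ • g := by rw [star_dftV_mul, Matrix.one_mulVec]

/-- **`c_k(c) = a^{−1}·c`**: every unit-lattice block-averaged covariance of the tower multiplies the `x`-constant
vector fields by `a^{−1}` (`Qtow_kᴴ` spreads a constant to `n_k^{−d}`·constant, `𝒢` multiplies it by `a^{−1}` (1.82),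
`Qtow_k` averages it back) — so `a^{−1}` is an eigenvalue of EVERY `c_k`, and of the limit `c_∞`.
[cite: Balaban1984PropagatorsI, (1.82) p.31; King1986, (2.10) p.653] — statement ours. [folklore] -/
theorem unitCov_mulVec_const (k : ℕ) (c : Fin d → ℂ) :
    unitCov L M a ha k *ᵥ (fun i : Tor (fine (lev L 0) M) × Fin d => c i.2)
      = ((a : ℂ))⁻¹ • (fun i : Tor (fine (lev L 0) M) × Fin d => c i.2) := by
  have hn0 : (((lev L k : ℕ) : ℂ)) ^ d ≠ 0 :=
    pow_ne_zero _ (Nat.cast_ne_zero.mpr (Nat.pos_iff_ne_zero.mp (one_le_lev L k)))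
  set f : Tor (fine (lev L 0) M) × Fin d → ℂ := fun i => c i.2 with hf
  set f' : Tor (fine (lev L k) M) × Fin d → ℂ := fun y => c y.2 with hf'
  have ha' := Qtow_conjTranspose_mulVec_const L M k c
  have hQf : (Qtow L M k)ᴴ *ᵥ f = ((((lev L k : ℕ) : ℂ)) ^ d)⁻¹ • f' := by
    rw [hf, ha']; funext y; simp [hf']
  have hQf' : Qtow L M k *ᵥ f' = f := by
    have e : f' = ((((lev L k : ℕ) : ℂ)) ^ d) • ((Qtow L M k)ᴴ *ᵥ f) := by
      rw [hQf, smul_smul, mul_inv_cancel₀ hn0, one_smul]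
    rw [e, Matrix.mulVec_smul, Matrix.mulVec_mulVec, Qtow_mul_conjTranspose, Matrix.smul_mulVec, Matrix.one_mulVec,
      smul_smul, mul_inv_cancel₀ hn0, one_smul]
  have hG : calG (lev L k) (one_le_lev L k) M a ha *ᵥ f' = ((a : ℂ))⁻¹ • f' := by
    rw [hf']; exact calG_mulVec_const M a ha (lev L k) (one_le_lev L k) c
  show ((((lev L k : ℕ) : ℂ)) ^ d • (Qtow L M k * calG (lev L k) (one_le_lev L k) M a ha * (Qtow L M k)ᴴ)) *ᵥ f
      = ((a : ℂ))⁻¹ • f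
  rw [Matrix.smul_mulVec, ← Matrix.mulVec_mulVec, ← Matrix.mulVec_mulVec, hQf, Matrix.mulVec_smul, hG,
    Matrix.mulVec_smul, Matrix.mulVec_smul, hQf', smul_smul, mul_inv_cancel₀ hn0, one_smul]

/-- **`a^{−1} ≤ ‖c_k‖`** (`d ≥ 1`), from the eigenvalue `a^{−1}` on constants (b05's `nsq_mulVec_le`).
[cite: Balaban1984PropagatorsI, (1.82) p.31; King1986, (2.10) p.653] — statement ours. [folklore] -/
theorem inv_le_opNorm_unitCov (hd : 0 < d) (k : ℕ) : a⁻¹ ≤ ‖unitCov L M a ha k‖ := by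
  classical
  set μ₀ : Fin d := ⟨0, hd⟩ with hμ₀
  set c : Fin d → ℂ := fun μ => if μ = μ₀ then 1 else 0 with hc
  set f : Tor (fine (lev L 0) M) × Fin d → ℂ := fun i => c i.2 with hf
  have hev := unitCov_mulVec_const L M a ha k c
  have h1 := B5Prop11Lower.nsq_mulVec_le (unitCov L M a ha k) f
  rw [hf, hev] at h1
  have hnsq : B5Prop11Lower.nsq (((a : ℂ))⁻¹ • fun i : Tor (fine (lev L 0) M) × Fin d => c i.2)
      = (a⁻¹) ^ 2 * B5Prop11Lower.nsq (fun i : Tor (fine (lev L 0) M) × Fin d => c i.2) := by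
    simp only [B5Prop11Lower.nsq, Pi.smul_apply, smul_eq_mul, norm_mul, mul_pow, Finset.mul_sum]
    congr 1; funext i
    rw [norm_inv, Complex.norm_real, Real.norm_of_nonneg ha.le]
  rw [hnsq] at h1
  have hpos : 0 < B5Prop11Lower.nsq (fun i : Tor (fine (lev L 0) M) × Fin d => c i.2) := by
    have hle : ‖(fun i : Tor (fine (lev L 0) M) × Fin d => c i.2) ((0 : Tor (fine (lev L 0) M)), μ₀)‖ ^ 2
        ≤ B5Prop11Lower.nsq (fun i : Tor (fine (lev L 0) M) × Fin d => c i.2) :=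
      Finset.single_le_sum (f := fun i => ‖(fun i : Tor (fine (lev L 0) M) × Fin d => c i.2) i‖ ^ 2)
        (fun i _ => sq_nonneg _) (Finset.mem_univ _)
    have h1' : ‖(fun i : Tor (fine (lev L 0) M) × Fin d => c i.2) ((0 : Tor (fine (lev L 0) M)), μ₀)‖ ^ 2 = 1 := by
      simp [hc]
    linarith
  have h2 : (a⁻¹) ^ 2 ≤ ‖unitCov L M a ha k‖ ^ 2 := le_of_mul_le_mul_right h1 hpos
  exact (pow_le_pow_iff_left₀ (inv_nonneg.mpr ha.le) (norm_nonneg _) two_ne_zero).mp h2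

end ZeroModes

end Literature.MathematicalPhysics.QuantumFieldTheory.Balaban1983to89.B5G183RateUnitTower

end
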